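import Mathlib
import HarnessLib
import HarnessLib.Audit
import Summits.FinalStateConjecture.Statement
import Literature.Geometry.Lorentzian.TrappedSurface
import Literature.Geometry.Lorentzian.EventHorizon
import Literature.Geometry.Lorentzian.CutBondiMass
import HarnessLib.Audit.Status.Attr

/-!
Route: RootDecompFarLedgerCells

# Route RootDecompFarLedgerCells — Root decomposition N2f «FarLedgerCells» (form b″-bis) —
FinalChargeCells leaves by signature; the no-honest-Bondi-account leaf 28426 cut by the
KLAINERMAN–NICOLÒ far-field tail class

DECOMPOSITION CELL decomp-fsc (D-0178; doctrine D-0170/0171/0172), summit S =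
`_root_.FinalStateConjecture` exactly as typed; LADDER rung 0 — NOTHING IN THIS FILE PROVES THE
FINAL STATE CONJECTURE. THIN SIBLING in FILING FORM (b″)-bis (critic FORM RULING
2026-08-30T06:07:07Z + RULING R1 06:11:22Z; standing rules 03:00:14Z / 03:45:00Z; precedents
RootDecompFinalChargeCells, RootDecompStaticJunction) of Theses/RootDecompFinalChargeCells.lean rev
1 ba1a8969f6f6: its five layer-2 children of BoundedSingleExit 27603 {SubextremalChargeExit 28422,
HeavyChargeDoor 28423, HeavyChargeExit 28424, LightChargeExit 28425, NoChargeExit 28426} and its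
eight other leaves {CascadeSingleExit 27604, MultiHoleCaptureExit 26646, InfiniteHoleCaptureExit
26647, TrappedNakedExit 25598, TrappedExtremalExit 25599, ExtremalThresholdExit 24765,
DispersiveExit 24766, NakedThresholdExit 24767} become the THIRTEEN top-level items here BY
SIGNATURE (all existing ledger signatures, dedup-attached; 13 is the MINIMUM faithful exposure of
28426: the N2 basin is a nested chain S ⊃ TrappedExit 24764 ⊃ TrappedCaptureExit 25597 ⊃
SingleHoleCaptureExit 26645 ⊃ BoundedSingleExit 27603 ⊃ NoChargeExit 28426 and every born ancestor
of a sibling group contains that spine — writer NOTE 06:08:53Z, accepted R1), so that the layer-2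
leaf NoChargeExit (no direct split possible on its home route: D-0019 max depth) receives the lens-5
g6 cut «FarLedgerCells» as a glued split on THIS route. It suffices to show the thirteen cell-exit
statements; the deciding theorem `closes` is RootDecompFinalChargeCells' closes₉ with its binder hB
: BoundedSingleExit obtained INLINE from the five children by the proved four-excluded-middle chain
of boundedSingleExitGlue_proof (item 28427's candidate proof), std axioms, binder_used 13/13.
Lean: `NoChargeExit ∧ SubextremalChargeExit ∧ HeavyChargeExit ∧ LightChargeExit ∧
MultiHoleCaptureExit ∧ InfiniteHoleCaptureExit ∧ TrappedNakedExit ∧ HeavyChargeDoor ∧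
CascadeSingleExit ∧ TrappedExtremalExit ∧ ExtremalThresholdExit ∧ DispersiveExit ∧
NakedThresholdExit` (the thirteen by-signature decls of this file; `closes` in folder/fl2/glue.lean;
the lens-5 g6 cells enter as the glued split of NoChargeExit)

## Assembly
Pure logic inside `closes` (folder/fl2/glue.lean): hB : BoundedSingleExit from the five children by
four nested excluded middles on the charge predicates Acc / KerrB / HeavyB and the horizon door Hor
(the proved shape of item 28427), then RootDecompFinalChargeCells' closes₉ verbatim — single-hole
dispatch by the future census (BoundedSingleExit / CascadeSingleExit), the born N2b/N2c case
analysis (dispersive / trapped: single, finitely many, infinitely many holes / naked / extremal /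
thresholds). `#print axioms` = {propext, Classical.choice, Quot.sound} (folder/fl2/Sketch.lean rc
0).

Rationale: WHY THIS LINE. Population splits of the exceptional set are free and exact (critic
`fsc_iff_cellSplit`), hence judged on content; this one imports, for the first time on this summit,
LARGE-DATA EXTERIOR STABILITY (Klainerman–Nicolò 2003, KlainermanNicolo2003 Thm 3.7.1 and Ch. 8:
Prop 8.1.1, Def 8.5.2, Thm 8.5.2, Thm 8.5.3; tree named fact
`Literature.Geometry.Lorentzian.klainerman_nicolo_exterior_null_completeness`, which today gives
null completeness only) as a CELL-EMPTYING BRIDGE on the fate side: the born leaf NoChargeExit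
(censored single-hole data whose own MGHD admits no honest Bondi account) is cut by whether the
datum's TAIL lies in the printed theorem's hypothesis class KN d := maximal slice ∧ sole
strongly-asymptotically-flat end with (3/2+η, 5/2+η, 4, 3) weights, ∃ η > 0 (no hand-picked
threshold, caution c4-clean) — for such data of ANY size the far exterior D⁺(ι(Σ∖K)) is the K–N
double-null region with complete cones, asymptotically round sections, Hawking-mass limits M_B(λ) ≤
M = E_ADM, so the door FarAccountDoor is EMPTY once three porting-grade supports are theorems (S1
exterior Bondi ledger = D9 wi-97120, S3 ADM chart ledger = D10 wi-97121, S2 development-transport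
coherence = wi-96536), and ALL of the leaf's content is LOCALISED to the residual RoughTailExit:
far-field regularity strictly below Klainerman–Nicolò (non-maximal gauge r1; Hintz-class
polyhomogeneous tails r2a, arXiv:2302.13804; derivative-poor borderline tails r2b = IDEA-NEEDED),
independent of every interior clause. Imported from: hyperbolic PDE exterior stability (K–N
double-null foliations), ADM/Bondi positive-mass bookkeeping (Bartnik1986, Chrusciel1986),
Choquet-Bruhat–Geroch uniqueness (ChoquetBruhatGeroch1969).

RANKED CRUXES. #2 NoChargeExit (crux) — = the BORN item stmt-FinalStateConjecture-28426 of
route-FinalStateConjecture-RootDecompFinalChargeCells (node N2e; born there as layer-2 child N of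
BoundedSingleExit 27603, split #15; home tag UNDECIDED (𝓘⁺-regularity)), reused BY SIGNATURE
(dedup-attach); EXPOSED AT TOP LEVEL HERE to receive, right after birth, the critic-CLEARED
(06:07:07Z; R1 06:11:22Z) lens-5 g6 cut «FarLedgerCells» as its glued split: FarAccountDoor
(K–N-class tail yet no honest Bondi account; EMPTY GIVEN supports S1 ∧ S3 ∧ S2, kernel
farAccountDoor_of_ledgers) ∧ RoughTailExit (residual: tail non-maximal or below K–N regularity), one
excluded middle on KN d (noChargeExit_iff_cells); text as born: [crux · UNDECIDED ·
asymptotic-regularity leaf N of lens-5 g5 on stmt-27603] Same population with ¬Acc: the asymptotic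
books do NOT close — no asymptotically round receding family with a Hawking-mass limit
MGHD-coherently bounded by m_ADM in every AF chart (no Bondi account at all; includes every ENNReal
junk corner: empty family ⇒ MassF = ⊤): exit tamely … (full text as born on the home route)
[difficulty: open-problem] (why it might fail: That a large censored development carries ANY
asymptotically round receding family with a Hawking-mass limit (a Bondi mass at all),
MGHD-coherently and ≤ m_ADM in every AF chart, is open: 𝓘⁺ of large data may be too irregular, and
Hawking-energy limits depend on the approach to the cut (Mars–Soria).) [arXiv:1506.01545,
ChristodoulouKlainerman1993PMS41 Ch.17,
Literature/Barriers/FinalStateConjecture/NonSmoothNullInfinity.lean,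
ChruscielMacCallumSingleton1995]
#3 SubextremalChargeExit (crux) — = the BORN item stmt-FinalStateConjecture-28422 of
route-FinalStateConjecture-RootDecompFinalChargeCells (layer-2 child K of 27603; home tag NEW
RESIDUAL · PARKED), reused BY SIGNATURE (dedup-attach); text as born: [crux · NEW RESIDUAL · PARKED
residual · internal node K of lens-5 g5 «FinalChargeCells» on stmt-27603] Admissible non-generic
data outside the dispersive and threshold cells whose maximal developments are censored, trapped,
with exactly ONE and finitely many future black holes (the BoundedSingleExit population) AND whose
asymptotic books close … (full text as born on the home route) [difficulty: open-problem] (why it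
might fail: Kerr-compatible books (8πM_f² < A_f ≤ 16πM_f²) do not force convergence: no theorem
excludes an eternally non-settling censored exterior whose monotone limits sit on a Kerr curve; the
χ̄-margin stability theorems consume slice-norm closeness that monotone limits never supply (caution
c4).) [arXiv:2104.11857, arXiv:2606.28253, arXiv:2605.18730, arXiv:2205.14808,
doi:10.1111/j.1749-6632.1973.tb41447.x]
#4 HeavyChargeExit (crux) — = the BORN item stmt-FinalStateConjecture-28424 of
route-FinalStateConjecture-RootDecompFinalChargeCells (layer-2 child L of 27603; home tag
SPECIAL-TYPE, vacuum third law), reused BY SIGNATURE (dedup-attach); text as born: [crux ·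
SPECIAL-TYPE · leaf L of lens-5 g5 on stmt-27603] Same population with Acc ∧ ¬KerrB ∧ HeavyB ∧ ¬Hor:
the books are at or below the extremal Kerr line (AreaF ≤ 8π·MassF²) and NO honest outermost horizon
of area ≥ 16π(0.81)m² is available — the EXTREMAL END STATE corner (A_f = 8πM_f²: dynamical
formation of an extremal vacuum horizon) together with … (full text as born on the home route)
[difficulty: open-problem] (why it might fail: Extremal horizons DO form dynamically in finite time
for Einstein–Maxwell–charged matter (Kehle–Unger); a vacuum analogue A_f = 8πM_f², or an eternal
non-radiating exterior reservoir giving A_f < 8πM_f², is excluded by no theorem (no-periodic results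
need analyticity/stationarity near 𝓘).) [arXiv:2211.15742, arXiv:2402.10190, arXiv:1504.04592,
arXiv:1008.0248]
#5 LightChargeExit (crux) — = the BORN item stmt-FinalStateConjecture-28425 of
route-FinalStateConjecture-RootDecompFinalChargeCells (layer-2 child H of 27603; home tag
IDEA-NEEDED, limiting-Bondi-mass Penrose inequality), reused BY SIGNATURE (dedup-attach); text as
born: [crux · IDEA-NEEDED · leaf H of lens-5 g5 on stmt-27603] Same population with Acc ∧ AreaF >
16π·MassF² (the books ABOVE the Schwarzschild line: more final horizon area than any Kerr of the
final Bondi mass can carry): exit tamely with codimension ≥ 1. Conjecturally EMPTY by the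
LIMITING-BONDI-MASS (null, late-time) PENROSE INEQUALITY M_f ≥ √(A_f/16π) — … (full text as born on
the home route) [difficulty: open-problem] (why it might fail: M_f ≥ √(A_f/16π) for the LIMITING
Bondi mass is Penrose's stronger spacetime statement, proved only near Schwarzschild (Alexakis; Le)
or under a quasi-final-state hypothesis (2026); a censored development whose horizon area outgrows
16πM_f² contradicts no theorem.) [arXiv:1506.06400, arXiv:2605.18730, arXiv:1609.02875,
arXiv:2404.17137, arXiv:2505.11399]
#6 MultiHoleCaptureExit (crux) — = the BORN item stmt-FinalStateConjecture-26646 of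
route-FinalStateConjecture-RootDecompTrappedBasinCells (node N2b; top level by signature on N2c/N2e;
split #16 on RootDecompHoleCountCells), reused BY SIGNATURE (dedup-attach); text as born: = the BORN
gen-1 child of TrappedCaptureExit (stmt-25597) on
route-FinalStateConjecture-RootDecompTrappedBasinCells, reused BY SIGNATURE; text as born: [crux ·
child 𝓣₂² of TrappedCaptureExit · SPECIAL-TYPE (configurational) · … (full text as born on the home
route) [difficulty: open-problem] (why it might fail: A tame-open set of admissible data whose MGHD
keeps two holes on an eternal quasi-periodic censored orbit (a vacuum 'floating' binary), or n ≥ 3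
co-axial multi-Kerr(–NUT) equilibria that exist AND are attained from an open set, would refute it;
n ≥ 3 non-existence is open (CCH12 p.14).) [doi:10.1007/BF00770326, arXiv:0905.4179,
arXiv:1103.5248, arXiv:1105.5830, arXiv:1111.1448, arXiv:0811.1727, arXiv:1205.6112,
arXiv:gr-qc/0210103, arXiv:2210.13960, arXiv:2001.10401, arXiv:1904.04831, arXiv:0710.3823]
#7 InfiniteHoleCaptureExit (crux) — = the BORN item stmt-FinalStateConjecture-26647 of
route-FinalStateConjecture-RootDecompTrappedBasinCells (node N2b; THIN BRIDGE ⟸ FiniteCensus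
stmt-13847), reused BY SIGNATURE (dedup-attach); text as born: = the BORN gen-1 child of
TrappedCaptureExit (stmt-25597) on route-FinalStateConjecture-RootDecompTrappedBasinCells, reused BY
SIGNATURE; text as born: [crux · child 𝓣₂^∞ of TrappedCaptureExit · thin · conjecturally EMPTY ·
IDEA-NEEDED; … (full text as born on the home route) [difficulty: open-problem] (why it might fail:
Late-time tails refocusing through an already formed hole's strong field (caustics near photon
spheres) could keep forming ever smaller holes at ever later times on a tame-open set; no statement
either way is in print (arXiv:2210.13960 p.6).) [arXiv:0805.3880, arXiv:1409.6270,
Christodoulou1999, arXiv:0811.0354, arXiv:2210.13960, HawkingEllis1973]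
#8 TrappedNakedExit (crux) — = the BORN item stmt-FinalStateConjecture-25598 of
route-FinalStateConjecture-RootDecompTrappedBasinCells (node N2b), reused BY SIGNATURE
(dedup-attach); text as born: = the BORN N2b item stmt-FinalStateConjecture-25598 reused BY
SIGNATURE (dedup-attach), text as born (abridged; full docstring in
Theses/RootDecompTrappedBasinCells.lean): PIECE 𝓣₁ — TrappedNakedExit [WEAKER·COUNTS·SPECIAL-TYPE —
critic … (full text as born on the home route) [difficulty: open-problem] (why it might fail: a
tame-open set of admissible vacuum data whose MGHD traps a sphere AND forms a naked singularity
outside the resulting black hole (smooth-data analogue of the Hölder-class stability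
arXiv:2605.16235), or incompleteness of 𝓘⁺ generated by the black-hole region itself on an open
set.) [doi:10.1088/0264-9381/22/11/019, arXiv:2402.10190, arXiv:2211.15742, arXiv:1912.08478,
arXiv:2204.09891, arXiv:1407.4766, arXiv:2605.16235, Christodoulou1999]
#9 HeavyChargeDoor (support) — = the BORN item stmt-FinalStateConjecture-28423 of
route-FinalStateConjecture-RootDecompFinalChargeCells (layer-2 door Dr of 27603; home tag THIN ·
EMPTY BY BRIDGE HorizonAreaBridge = D5 wi-96862), reused BY SIGNATURE (dedup-attach); text as born:
[support · THIN · EMPTY BY BRIDGE · door Dr of lens-5 g5 on stmt-27603] Same population with Acc ∧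
¬KerrB ∧ HeavyB (AreaF ≤ 8π·MassF²) ∧ Hor (lens-1 horizon let of stmt-26560 verbatim: an honest
outermost future horizon with A_min ≥ 16π(0.81)m²): exit tamely with codimension ≥ 1. expectedly
EMPTY: lens kernel theorem heavyChargeDoor_of_bridge : … (full text as born on the home route)
[difficulty: open-problem] (why it might fail: Empty only modulo HorizonAreaBridge: should the
outermost trapped region of some censored MGHD be visible from 𝓘⁺ in the sojourn formalism (HE 9.2.8
/ Wald 12.2.4 porting fails without future causal simplicity) or A_min exceed the Lipschitz
horizon-cut area, heavy books could coexist with Hor.) [HawkingEllis1973 §9.2, Wald1984 §12.2,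
arXiv:2605.18730 p.3, ChruscielEtAl2001 §3-4,
decomp-fsc-lens-5/g5/FinalChargeCells.lean:heavyChargeDoor_of_bridge,
stmt-FinalStateConjecture-26560]
#9 CascadeSingleExit (support) — = the BORN item stmt-FinalStateConjecture-27604 of
route-FinalStateConjecture-RootDecompHoleCountCells (node N2c; layer-2 child of 26645; THIN BRIDGE ⟸
stmt-13847, kernel-certified), reused BY SIGNATURE (dedup-attach); text as born: [support · THIN
BRIDGE ⟸ stmt-13847 · expectedly VACUOUS · dominated] lens-5 g4 «FutureCensusCarve» child 2 of
SingleHoleCaptureExit (stmt-26645; CLEARED[split] 2026-08-30T04:18:58Z): the cell 𝓒 AND ¬CenFinF d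
(one final hole, yet some … (full text as born on the home route) [difficulty: open-problem] (why it
might fail: Vacuous iff 13847 FiniteCensus holds on the cell; a single-final-hole development whose
future slices carry unboundedly many disjoint shrinking outermost-MOTS bodies (not excluded by
Penrose-type area/mass heuristics) would make it contentful and as hard as 26645 there.)
[HawkingEllis1973, AnderssonMetzgerTrapped2009, arXiv:0805.3880, arXiv:1407.4766,
doi:10.1103/PhysRevLett.14.57]
#9 TrappedExtremalExit (support) — = the BORN item stmt-FinalStateConjecture-25599 of
route-FinalStateConjecture-RootDecompTrappedBasinCells (node N2b; local kind support = cap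
arithmetic only, home kind crux), reused BY SIGNATURE (dedup-attach); text as born: = the BORN N2b
item stmt-FinalStateConjecture-25599 reused BY SIGNATURE (dedup-attach), text as born (abridged;
full docstring in Theses/RootDecompTrappedBasinCells.lean): PIECE 𝓣₃ — TrappedExtremalExit
[WEAKER·COUNTS·SPECIAL-TYPE — critic … (full text as born on the home route) [difficulty:
open-problem] (why it might fail: the set of trapped data with exactly extremal remnants could be
tame-thick (accumulating on itself along every tame line through a member), or every tame exit from
it could pass through uncensored data; vacuum extremal Kerr formation itself is open
(arXiv:2402.10190 p.12).) [arXiv:2211.15742, arXiv:2402.10190, arXiv:2304.08455, Aretakis2015,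
arXiv:1402.7034, Israel1986]
#9 ExtremalThresholdExit (support) — = the BORN item stmt-FinalStateConjecture-24765 of
route-FinalStateConjecture-RootDecompCausalCells (node N2; local kind support = cap arithmetic only,
home kind crux), reused BY SIGNATURE (dedup-attach); text as born: = the BORN N2 item
stmt-FinalStateConjecture-24765 reused BY SIGNATURE (dedup-attach; declared kind SUPPORT on this
route only to respect the 7-crux cap — it stays a crux on its home routes N2/N2b and is LOAD-BEARING
in `closes` here), … (full text as born on the home route) [difficulty: open-problem] (why it might
fail: the extremal critical set B_crit could be thick in the tame topology (extremal thresholds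
accumulating on themselves along every tame line), or leaving the threshold could land in naked
data; vacuum extremal formation itself is open (arXiv:2402.10190 p.12).) [arXiv:2402.10190,
arXiv:2211.15742, arXiv:2304.08455]
#9 DispersiveExit (support) — = the BORN item stmt-FinalStateConjecture-24766 of
route-FinalStateConjecture-RootDecompCausalCells (node N2; lens-2 g6 SolitonCarve cut pending),
reused BY SIGNATURE (dedup-attach); text as born: = the BORN N2 item stmt-FinalStateConjecture-24766
reused BY SIGNATURE (dedup-attach; declared kind SUPPORT on this route only to respect the 7-crux
cap — it stays a crux on its home routes N2/N2b and is LOAD-BEARING in `closes` here), … (full text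
as born on the home route) [difficulty: open-problem] (why it might fail: a non-radiating vacuum
breather or a complete development with curvature not decaying at i⁺ whose tame neighbours are also
exceptional (an open set) refutes it; no-breather results hold only near 𝓘 (arXiv:1504.04592) or for
decaying solutions (arXiv:2108.13379).) [arXiv:2108.13379, arXiv:1504.04592, doi:10.1007/PL00001021]
#9 NakedThresholdExit (support) — = the BORN item stmt-FinalStateConjecture-24767 of
route-FinalStateConjecture-RootDecompCausalCells (node N2), reused BY SIGNATURE (dedup-attach); text
as born: = the BORN N2 item stmt-FinalStateConjecture-24767 reused BY SIGNATURE (dedup-attach;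
declared kind SUPPORT on this route only to respect the 7-crux cap — it stays a crux on its home
routes N2/N2b and is LOAD-BEARING in `closes` here), … (full text as born on the home route)
[difficulty: open-problem] (why it might fail: a smooth-data analogue of the Singh–Zheng stability —
a tame-open set of admissible vacuum data forming naked singularities (RSR arXiv:1912.08478
exteriors are fine-tuned, consistent so far).) [Christodoulou1999, arXiv:1912.08478,
arXiv:2204.09891, arXiv:2605.16235, arXiv:0811.0354]

TWO-LAYER PLAN. Layer 2 here = {FarAccountDoor (support · THIN · EMPTY GIVEN SUPPORTS · does NOT
count), RoughTailExit (crux · NEW RESIDUAL of N · COUNTS · replaces N in the census)} under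
NoChargeExit, filed as the glued split right after birth with glue 'FarAccountDoor → RoughTailExit →
NoChargeExit' (provable now: lens kernel noCharge_of_cells, one Classical.em on KN d). The three
cell-free supports S1 ExteriorBondiLedger / S3 ADMChartLedger / S2 ChargeCoherence are NOT route
items (critic: not S-implied, the leaf conjunction must stay EQUIVALENT to the born parent) — they
live on the ledger as typer / Literature work (D9 wi-97120, D10 wi-97121, wi-96536) and as the
door's kill path `farAccountDoor_of_ledgers : S1 → S3 → S2 → FarAccountDoor` (to be landed
--supports the door item once S1–S3 are theorems). Foreseen, NOT filed: the r1/r2a/r2b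
stratification of RoughTailExit (lens-5 NODE-g6 §3) — r1 needs ONE of {maximal SAF slice existence
in censored MGHDs (Bartnik 1984 interior condition; BCÓM 1990), K–N without maximality}, r2a needs
Hintz's class with an explicit N (F6, not typed: c4), r2b is the honest terminal residual.

KILL CRITERIA. Every binder and both split children are S-implied (lens kernel necessity; critic
pieces_of_summit), so a refutation of any of them refutes S as typed: for this node specifically — a
tame-open family of censored single-hole developments with Klainerman–Nicolò-class tails and NO
Hawking-mass limit along any asymptotically round receding family (kills FarAccountDoor, hence S1 or
the causal bridge F3: a typing finding about HasCutBondiMass / the K–N identification), or with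
rough admissible tails (o₂(r⁻¹)/o₁(r⁻²), e.g. r^{-3-ε} sin r ripples) carrying no convergent round
family at all (kills RoughTailExit and S). The route is closed `superseded` if a tenure --resplit of
27603 on RootDecompFinalChargeCells absorbs the two cells, and `not-a-thesis` can never apply:
`closes` reaches `_root_.FinalStateConjecture`.

NOT DECOMPOSED YET. RoughTailExit's strata (r1 gauge / r2a Hintz class / r2b derivative-poor) are
deliberately NOT items (c4: no regularity NUMBER is certified yet; r2b is idea-needed); the
interiors of SubextremalChargeExit (large-data Kerr stability proper), HeavyChargeExit (vacuum third
law), LightChargeExit (limiting-Bondi-mass Penrose inequality) stay parked as on the home route; the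
eight N2/N2b/N2c leaves are carried by signature only and are decomposed, if at all, on their home
routes (MultiHoleCaptureExit: split #16 on RootDecompHoleCountCells; DispersiveExit: lens-2 g6
SolitonCarve pending).

CHEAPEST FALSIFIER. FarAccountDoor / D9: port the Klainerman–Nicolò Ch. 8 exterior Bondi ledger into
RoundSectionFamily / HasCutBondiMass currency and the causal bridge K–N exterior ≅ D⁺(ι(Σ∖K)) inside
every MGHD — if the tree's hawkingMass / round_iff cannot be matched to K–N's m(λ, ν) and r⁻²γ →
γ̃_∞, the door is not empty AS TYPED (statement-audit finding on CutBondiMass, cheap: a typer reads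
K–N pp. 427–445 against CutBondiMass.lean); expected to go through. RoughTailExit: exhibit ONE
censored admissible datum with a derivative-poor tail (r^{-3-ε} sin r) whose MGHD has no convergent
Hawking-mass limit along any round receding family — none known; Hintz arXiv:2302.13804 Rem 3.38 is
the nearest printed obstruction (Bondi mass unproved in the polyhomogeneous class).

NUMBERS. No constant enters a binder: KN d quantifies ∃ η > 0 with the printed weights (3/2+η,
5/2+η, 4, 3) of the tree fact; the admissible class is o₂(r⁻¹)/o₁(r⁻²). Print only: K–N smallness is
of the EXTERIOR weighted norm J_K(Σ∖K) < ε², achieved for every KN datum by enlarging K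
(KlainermanNicolo2003 Thm 3.7.1, remark p.140).

DEFINITION REQUESTS. Filed by the writer per the critic's ruling (kind cite, typer queue, --for
stmt-FinalStateConjecture-28426, re-pointed to the door item once born): D9 = wi-97120 «port:
ExteriorBondiLedger facts F1 + F3» (K–N Ch. 8 exterior Bondi ledger in RoundSectionFamily currency:
Prop 8.1.1 p.427, Def 8.5.2 p.443, Thm 8.5.2 p.444, Thm 8.5.3 p.445; causal bridge via
ChoquetBruhatGeroch1969 + domain of dependence, tree CauchyDevelopment.IsMaximal / EmbedsInto /
CauchyDevelopmentReslice); D10 = wi-97121 «port: ADMChartLedger fact F2» (ADM 4-momentum chart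
invariance, Chrusciel1986; energy part on tree facts AFEnd.HasADMEnergy.Of_isSameEnd /
HasADMEnergy_of_isAsymptoticallyFlat, Bartnik1986 Thm 4.2/4.3). S2 ChargeCoherence = existing
wi-96536 (lens-4 B0 DevelopmentTransport + LC-naturality). No new `def` is needed: KN and every let
elaborate over existing declarations (IsMaximalData, AFEnd.IsSoleEnd,
IsStronglyAsymptoticallyFlatWith, CutBondiMass).

Novelty: GEN-6 on 28426 (2026-08-30T05:47:59Z, lens-5 g6 + critic 06:07:07Z / R1 06:11:22Z + writer): the
move = cut a fate-side leaf by the HYPOTHESIS CLASS OF A PRINTED LARGE-DATA EXTERIOR THEOREM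
(Klainerman–Nicolò 2003), typed verbatim as the hypothesis block of the tree's own named fact, so
that the theorem EMPTIES a cell given cell-free porting supports and the leaf's content is localised
to far-field regularity strictly below that class — the first node of the tree whose boundary is a
regularity class of the Cauchy datum's TAIL rather than an interior, horizon, census or charge
predicate. Searches (lens-5 g6, 2026-08-30, NODE-g6.md §5, corpus fts+vec AND galaxy, labelled):
`lit search --hybrid "Klainerman Nicolo exterior stability Bondi mass peeling large data"` →
[corpus:book:klainermannd-evolution-problem-general-relativity p.139, p.427, p.443–445] (the
imported theorem itself); `lit search --hybrid "polyhomogeneous initial data Bondi mass existence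
exterior"` → [corpus:arxiv-2302.13804 p.3, Rem 3.38] (Hintz: gluing/exterior in polyhomogeneous
class, Bondi mass not established), [corpus:arxiv-2405.00735] (Shen, borderline decay exterior
stability, no Bondi ledger); `lit vsearch «existence of Bondi mass for rough asymptotically flat
vacuum data»` -k 8 → [corpus:arxiv-2303.12758], [corpus:arxiv-2606.08716] (scattering /
low-regularity exterior results, no Hawking-mass limits); `lit galaxy search
"Klainerman-Nicolo|exterior stability|Bondi mass loss" --star all -n 10` → [galaxy:  [refs: 2302.13804, 2405.00735, book:klainermannd-evolution-problem-general-relativity, arxiv-2302.13804, arxiv-2405.00735, arxiv-2303.12758, arxiv-2606.08716, KlainermanNicolo2003]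

Barriers (technique_class: population-split, far-field tail class, K-N exterior ledger): - technique_class: population-split, far-field tail class, K-N exterior ledger
- Literature.Barriers.FinalStateConjecture.KerrStabilityHoldsBelowNarrow: the printed
slowly-rotating Kerr stability frontier (∃ α > 0; KlainermanSzeftel2023 Thm 1.2.1) is a POSITIVE
theorem about near-Kerr data; no item here is a perturbation-of-Kerr statement and no binder carries
a smallness-in-spin or closeness-to-Kerr hypothesis — the K–N class KN d is a FAR-FIELD tail class
for data of any size; outside the class (the frontier bites only roads inside SubextremalChargeExit,
acknowledged there as on the home route).
- Literature.Barriers.FinalStateConjecture.KehrbergerLogarithmicAsymptoticsNarrow: the K–N class KN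
d (o₄(r^{-3/2-η}) beyond Schwarzschild, ∃ η > 0) EXCLUDES the logarithmic / polyhomogeneous tails of
the barrier by hypothesis — those data fall into RoughTailExit (stratum r2a), where the barrier is
DECLARED (no peeling or smooth 𝓘⁺ is claimed; HasCutBondiMass is the sojourn/cut form); outside for
the door, inside-and-acknowledged for the residual.
- Literature.Barriers.FinalStateConjecture.nakedSingularityInstability: genericity-blind methods
excluded; NakedThresholdExit / TrappedNakedExit / all pieces are the GENERIC (tame-curve) forms —
outside the class; the barrier's own theorem (Christodoulou 1999 Thm 4.1) is the model exit family.
- Literature.Barriers.FinalStateConjecture.AretakisInstability: bites settling ON an extremal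
horizon and every uniform-in-spin road inside TrappedC

History (route lifecycle, newest last):
- 2026-08-30T06:23:14Z · AUTO-CRUX (open): HeavyChargeDoor — hypotheses of the deciding theorem that nothing in the route derives are cruxes (planner-decomp-fsc-writer-1-g2-0)

sub-problem: FinalStateConjecture · status: draft · opened planner-decomp-fsc-writer-1-g2-0 2026-08-30T06:22:22Z · rev 3 · ledger route-FinalStateConjecture-RootDecompFarLedgerCells
GENERATED by the gate from the ledger (D-0016/17). Provers cite these decls: `theorem foo : Summit.FinalStateConjecture.FinalStateConjecture.Theses.RootDecompFarLedgerCells.<Decl> := …` in Summits/FinalStateConjecture/FinalStateConjecture/Theorems/<Name>.lean.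
-/

namespace Summit.FinalStateConjecture.FinalStateConjecture.Theses.RootDecompFarLedgerCells

open scoped BigOperators Topology Manifold Classical MeasureTheory ProbabilityTheory Matrix InnerProductSpace ComplexConjugate ContinuousMap
open Filter Set Function TopologicalSpace MeasureTheory

attribute [summit_statement] _root_.FinalStateConjecture

/-- item stmt-FinalStateConjecture-28426 · crux · rank 2 · SPLIT (gen 1) into FarAccountDoor, RoughTailExit + glue NoChargeExitGlue · direct attempts still welcome (low priority) · by planner
why it might fail: That a large censored development carries ANY asymptotically round receding family with a Hawking-mass limit (a Bondi mass at all), MGHD-coherently and ≤ m_ADM in every AF chart, is open: 𝓘⁺ of large data may be too irregular, and Hawking-energy limits depend on the approach to the cut (Mars–Soria).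
sources: arXiv:1506.01545, ChristodoulouKlainerman1993PMS41 Ch.17, Literature/Barriers/FinalStateConjecture/NonSmoothNullInfinity.lean, ChruscielMacCallumSingleton1995
[crux · UNDECIDED · asymptotic-regularity leaf N of lens-5 g5 on stmt-27603] Same population with
¬Acc: the asymptotic books do NOT close — no asymptotically round receding family with a
Hawking-mass limit MGHD-coherently bounded by m_ADM in every AF chart (no Bondi account at all;
includes every ENNReal junk corner: empty family ⇒ MassF = ⊤): exit tamely with codimension ≥ 1.
Conjecturally EMPTY (large censored developments should possess a Bondi mass with the mass-loss
law), but OPEN for large data: 𝓘⁺ may be too irregular and Hawking-energy limits depend on the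
approach to the cut (Mars–Soria arXiv:1506.01545); Bondi mass needs Christodoulou–Klainerman-level
decay, not peeling — adjacent to, but outside, the NonSmoothNullInfinity barrier class (Kehrberger). -/
@[route_item "route-FinalStateConjecture-RootDecompFarLedgerCells", crux]
def NoChargeExit : Prop :=
  ∀ (X : Type) [TopologicalSpace X] [ChartedSpace Literature.Geometry.Lorentzian.E3 X] [IsManifold (𝓡 3) ((⊤ : ℕ∞) : WithTop ℕ∞) X] [T2Space X] [SecondCountableTopology X] [ConnectedSpace X], let P : Literature.Geometry.Lorentzian.InitialDataSet (𝓡 3) X → Prop := fun D ↦ (∃ 𝒟 : Literature.Geometry.Lorentzian.VacuumCauchyDevelopment D, 𝒟.IsMaximal) ∧ ∀ 𝒟 : Literature.Geometry.Lorentzian.VacuumCauchyDevelopment D, 𝒟.IsMaximal → Summit.FinalStateConjecture.HasCompleteNullInfinity 𝒟.toCauchyDevelopment ∧ ∃ (O : Set 𝒟.carrier) (d : Literature.Geometry.Lorentzian.FinalStateDecomposition 𝒟.toSpacetime O 2), (∀ i, Literature.Geometry.Lorentzian.Kerr.IsSubextremal (d.mass i) (d.spin i)) ∧ O = Summit.FinalStateConjecture.exteriorOf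 𝒟.toCauchyDevelopment d.charted ∧ Summit.FinalStateConjecture.RaysStayInClosure 𝒟.toCauchyDevelopment O ∧ Summit.FinalStateConjecture.HasExhaustiveCharts d ∧ Summit.FinalStateConjecture.IsFutureOriented d; let Pw0 : Literature.Geometry.Lorentzian.InitialDataSet (𝓡 3) X → Prop := fun D ↦ (∃ 𝒟 : Literature.Geometry.Lorentzian.VacuumCauchyDevelopment D, 𝒟.IsMaximal) ∧ ∀ 𝒟 : Literature.Geometry.Lorentzian.VacuumCauchyDevelopment D, 𝒟.IsMaximal → Summit.FinalStateConjecture.HasCompleteNullInfinity 𝒟.toCauchyDevelopment ∧ ∃ (O : Set 𝒟.carrier) (d : Literature.Geometry.Lorentzian.FinalStateDecomposition 𝒟.toSpacetime O 0), O = Summit.FinalStateConjecture.exteriorOf 𝒟.toCauchyDevelopment d.charted ∧ Summit.FinalStateConjecture.RaysStayInClosure 𝒟.toCauchyDevelopment O ∧ Summit.FinalStateConjecture.HasExhaustiveCharts d ∧ Summit.FinalStateConjecture.IsFutureOriented d; let Disp : Literature.Geometry.Lorentzian.InitialDataSet (𝓡 3) X → Prop := fun D ↦ (∃ 𝒟 :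 Literature.Geometry.Lorentzian.VacuumCauchyDevelopment D, 𝒟.IsMaximal) ∧ ∀ 𝒟 : Literature.Geometry.Lorentzian.VacuumCauchyDevelopment D, 𝒟.IsMaximal → ∀ [𝒟.metric.HasLeviCivita], ¬ 𝒟.metric.IsFutureNullGeodesicallyIncomplete 𝒟.timeOrientation ∧ ¬ 𝒟.metric.IsFutureTimelikeGeodesicallyIncomplete 𝒟.timeOrientation; let Trap : Literature.Geometry.Lorentzian.InitialDataSet (𝓡 3) X → Prop := fun D ↦ (∃ 𝒟 : Literature.Geometry.Lorentzian.VacuumCauchyDevelopment D, 𝒟.IsMaximal) ∧ ∀ 𝒟 : Literature.Geometry.Lorentzian.VacuumCauchyDevelopment D, 𝒟.IsMaximal → ∀ [𝒟.metric.HasLeviCivita], ∃ f : Metric.sphere (0 : Literature.Geometry.Lorentzian.E3) 1 → 𝒟.carrier, Set.range f ⊆ 𝒟.metric.causalFuture 𝒟.timeOrientation (Set.range 𝒟.embed) ∧ 𝒟.metric.IsTrappedSurface (𝓡 2) 𝒟.timeOrientation f; let Cens : Literature.Geometry.Lorentzian.InitialDataSet (𝓡 3) X → Prop := fun D ↦ ∀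 𝒟 : Literature.Geometry.Lorentzian.VacuumCauchyDevelopment D, 𝒟.IsMaximal → Summit.FinalStateConjecture.HasCompleteNullInfinity 𝒟.toCauchyDevelopment; let Single : Literature.Geometry.Lorentzian.InitialDataSet (𝓡 3) X → Prop := fun D ↦ ∀ 𝒟 : Literature.Geometry.Lorentzian.VacuumCauchyDevelopment D, 𝒟.IsMaximal → ∀ [𝒟.metric.HasLeviCivita], Subsingleton (ConnectedComponents ↥(Literature.Geometry.Lorentzian.DataEmbedding.blackHoleRegion 𝒟.toDataEmbedding ∩ 𝒟.metric.causalFuture 𝒟.timeOrientation (Set.range 𝒟.embed))); let CenFinF : Literature.Geometry.Lorentzian.InitialDataSet (𝓡 3) X → Prop := fun D ↦ ∀ 𝒟 : Literature.Geometry.Lorentzian.VacuumCauchyDevelopment D, 𝒟.IsMaximal → ∃ n : ℕ, ∀ (X' : Type) [TopologicalSpace X'] [ChartedSpace Literature.Geometry.Lorentzian.E3 X'] [IsManifold (𝓡 3) ((⊤ : ℕ∞) : WithTop ℕ∞) X'] [ConnectedSpace X'] (D' : Literature.Geometry.Lorentzian.InitialDataSet (𝓡 3) X') (ι' : X' → 𝒟.carrier)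 (ν' : Literature.Geometry.Lorentzian.NormalField (𝓡 4) ι'), Manifold.IsSmoothEmbedding (𝓡 3) (𝓡 4) ((⊤ : ℕ∞) : WithTop ℕ∞) ι' → 𝒟.metric.IsFutureUnitNormal (𝓡 3) 𝒟.timeOrientation ι' ν' → (∀ y : X', Literature.Geometry.Lorentzian.pullbackBilin (I := 𝓡 4) (I' := 𝓡 3) ι' 𝒟.metric.val y = D'.h.inner y) → (∀ [𝒟.metric.toPseudoRiemannianMetric.HasLeviCivita] (y : X'), 𝒟.metric.toPseudoRiemannianMetric.secondFundamentalForm (𝓡 3) ι' ν' y = D'.kBilin y) → 𝒟.metric.IsCauchyHypersurface 𝒟.timeOrientation (Set.range ι') → Set.range ι' ⊆ 𝒟.metric.causalFuture 𝒟.timeOrientation (Set.range 𝒟.embed) → ∀ S : Fin (n + 1) → Literature.Geometry.Lorentzian.OutermostMOTS (𝓡 3) D'.h D'.k, (∀ j, ConnectedSpace (S j).surf) → (∀ j, IsCompact (((S j).exterior : Set X'))ᶜ ∧ (interior (((S j).exterior : Set X'))ᶜ).Nonempty) → ∃ j j', j ≠ j' ∧ ((((S j).exterior : Set X'))ᶜ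 ∩ (((S j').exterior : Set X'))ᶜ).Nonempty; let MassF : (D : Literature.Geometry.Lorentzian.InitialDataSet (𝓡 3) X) → Literature.Geometry.Lorentzian.VacuumCauchyDevelopment D → ENNReal := fun D 𝒟 ↦ ⨅ (K : Set 𝒟.carrier) (_ : IsCompact K) (m : ℝ) (_ : 𝒟.toCauchyDevelopment.HasCutBondiMass K m), ENNReal.ofReal m; let AreaF : (D : Literature.Geometry.Lorentzian.InitialDataSet (𝓡 3) X) → (𝒟 : Literature.Geometry.Lorentzian.VacuumCauchyDevelopment D) → [𝒟.metric.HasLeviCivita] → ENNReal := fun D 𝒟 hLC ↦ sInf {a : ENNReal | ∀ (X' : Type) [TopologicalSpace X'] [ChartedSpace Literature.Geometry.Lorentzian.E3 X'] [IsManifold (𝓡 3) ((⊤ : ℕ∞) : WithTop ℕ∞) X'] [ConnectedSpace X'] [T2Space X'] (D' : Literature.Geometry.Lorentzian.InitialDataSet (𝓡 3) X') (ι' : X' → 𝒟.carrier) (ν' : Literature.Geometry.Lorentzian.NormalField (𝓡 4) ι'), Manifold.IsSmoothEmbedding (𝓡 3) (𝓡 4) ((⊤ : ℕ∞) : WithTop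 ℕ∞) ι' → 𝒟.metric.IsFutureUnitNormal (𝓡 3) 𝒟.timeOrientation ι' ν' → (∀ y : X', Literature.Geometry.Lorentzian.pullbackBilin (I := 𝓡 4) (I' := 𝓡 3) ι' 𝒟.metric.val y = D'.h.inner y) → (∀ [𝒟.metric.toPseudoRiemannianMetric.HasLeviCivita] (y : X'), 𝒟.metric.toPseudoRiemannianMetric.secondFundamentalForm (𝓡 3) ι' ν' y = D'.kBilin y) → 𝒟.metric.IsCauchyHypersurface 𝒟.timeOrientation (Set.range ι') → Set.range ι' ⊆ 𝒟.metric.causalFuture 𝒟.timeOrientation (Set.range 𝒟.embed) → (letI : MeasurableSpace X' := borel X'; haveI : BorelSpace X' := ⟨rfl⟩; haveI : LocallyCompactSpace X' := ChartedSpace.locallyCompactSpace Literature.Geometry.Lorentzian.E3 X'; Literature.Geometry.Lorentzian.area D'.h (ι' ⁻¹' Literature.Geometry.Lorentzian.DataEmbedding.futureEventHorizon 𝒟.toDataEmbedding)) ≤ a}; let Acc : Literature.Geometry.Lorentzian.InitialDataSet (𝓡 3) X → Prop := fun D ↦ ∃ (M A : ENNReal), M ≠ ⊤ ∧ (∀ e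 : Literature.Geometry.Lorentzian.AFEnd X, e.IsAsymptoticallyFlat D 1 → (∃ m, e.HasADMEnergy D m) → M ≤ ENNReal.ofReal (e.admMass D)) ∧ ∀ 𝒟 : Literature.Geometry.Lorentzian.VacuumCauchyDevelopment D, 𝒟.IsMaximal → ∀ [𝒟.metric.HasLeviCivita], MassF D 𝒟 = M ∧ AreaF D 𝒟 = A; ∀ d ∈ Literature.Geometry.Lorentzian.admissibleVacuumData X, ¬ P d → (((¬ Disp d ∧ Trap d ∧ Cens d ∧ ¬ Pw0 d) ∧ Single d) ∧ CenFinF d) → ¬ Acc d → ∃ (e : Literature.Geometry.Lorentzian.AFEnd X) (F : EuclideanSpace ℝ (Fin 1) → Literature.Geometry.Lorentzian.InitialDataSet (𝓡 3) X), Literature.Geometry.Lorentzian.InitialDataSet.IsTameDataFamily e 1 F ∧ Literature.Geometry.Lorentzian.InitialDataSet.IsImmersedAtZero 1 F ∧ F 0 = d ∧ Injective F ∧ (∀ c, F c ∈ Literature.Geometry.Lorentzian.admissibleVacuumData X) ∧ ∀ c ≠ 0, P (F c)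

-- parent: NoChargeExit · child (gen 1)
/--     item stmt-FinalStateConjecture-29291 · crux · rank 202 · open
    parent: NoChargeExit · by planner
    why it might fail: Admissible o₂(r⁻¹)/o₁(r⁻²) tails below Klainerman–Nicolò regularity (e.g. r^{-3-ε} sin r ripples) have no printed exterior theory with Hawking-mass limits (Hintz arXiv:2302.13804 Rem 3.38: Bondi mass unproved); a censored development with NO convergent round family refutes it and S as typed.
    sources: arXiv:2302.13804 Thm 1.1, Rem 3.38, arXiv:2405.00735, arXiv:2303.12758, arXiv:2606.08716, KlainermanNicolo2003 fn 49
[crux · NEW RESIDUAL of N · WEAKER · COUNTS (replaces NoChargeExit in the census; N's «UNDECIDED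
(𝓘⁺-regularity)» is LOCALISED here to far-field regularity strictly below Klainerman–Nicolò,
independent of every interior clause) · UNDECIDED, stratified · leaf Rₙ of lens-5 g6
«FarLedgerCells» on stmt-28426 (critic CLEARED 2026-08-30T06:07:07Z, R1 06:11:22Z)] Same population
as NoChargeExit AND ¬KN d (the Cauchy datum is non-maximal, or its sole end is rougher / slower than
the K–N weights (3/2+η, 5/2+η, 4, 3) for every η > 0): exit tamely with codimension ≥ 1. Strata
(lens-5 NODE-g6 §3, NOT items — caution c4): r1 non-maximal gauge = ATTACKABLE only modulo ONE of
{maximal SAF Cauchy slice existence in the MGHD of censored black-hole data (Bartnik 1984 interior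
condition; Bartnik–Chruściel–Ó Murchadha 1990 for the trapped case), a K–N theorem without
maximality (K–N fn 49 «not essential» is a remark, not a theorem)} + CBG transport; r2a Hintz-class
polyhomogeneous tails (arXiv:2302.13804 Thm 1.1, Rem 3.38: Bondi mass unproved) = porting+effort
once an explicit regularity number is certified (request F6); r2b borderline / derivative-poor
admissible tails (o₂(r⁻¹)/o₁(r⁻²), e.g. r^{-3-ε} -/
@[route_item "route-FinalStateConjecture-RootDecompFarLedgerCells"]
def RoughTailExit : Prop :=
  ∀ (X : Type) [TopologicalSpace X] [ChartedSpace Literature.Geometry.Lorentzian.E3 X] [IsManifold (𝓡 3) ((⊤ : ℕ∞) : WithTop ℕ∞) X] [T2Space X] [SecondCountableTopology X] [ConnectedSpace X], let P : Literature.Geometry.Lorentzian.InitialDataSet (𝓡 3) X → Prop := fun D ↦ (∃ 𝒟 : Literature.Geometry.Lorentzian.VacuumCauchyDevelopment D, 𝒟.IsMaximal) ∧ ∀ 𝒟 : Literature.Geometry.Lorentzian.VacuumCauchyDevelopment D, 𝒟.IsMaximal → Summit.FinalStateConjecture.HasCompleteNullInfinity 𝒟.toCauchyDevelopment ∧ ∃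 (O : Set 𝒟.carrier) (d : Literature.Geometry.Lorentzian.FinalStateDecomposition 𝒟.toSpacetime O 2), (∀ i, Literature.Geometry.Lorentzian.Kerr.IsSubextremal (d.mass i) (d.spin i)) ∧ O = Summit.FinalStateConjecture.exteriorOf 𝒟.toCauchyDevelopment d.charted ∧ Summit.FinalStateConjecture.RaysStayInClosure 𝒟.toCauchyDevelopment O ∧ Summit.FinalStateConjecture.HasExhaustiveCharts d ∧ Summit.FinalStateConjecture.IsFutureOriented d; let Pw0 : Literature.Geometry.Lorentzian.InitialDataSet (𝓡 3) X → Prop := fun D ↦ (∃ 𝒟 : Literature.Geometry.Lorentzian.VacuumCauchyDevelopment D, 𝒟.IsMaximal) ∧ ∀ 𝒟 : Literature.Geometry.Lorentzian.VacuumCauchyDevelopment D, 𝒟.IsMaximal → Summit.FinalStateConjecture.HasCompleteNullInfinity 𝒟.toCauchyDevelopment ∧ ∃ (O : Set 𝒟.carrier) (d : Literature.Geometry.Lorentzian.FinalStateDecomposition 𝒟.toSpacetime O 0), O = Summit.FinalStateConjecture.exteriorOf 𝒟.toCauchyDevelopment d.charted ∧ Summit.FinalStateConjecture.RaysStayInClosure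 𝒟.toCauchyDevelopment O ∧ Summit.FinalStateConjecture.HasExhaustiveCharts d ∧ Summit.FinalStateConjecture.IsFutureOriented d; let Disp : Literature.Geometry.Lorentzian.InitialDataSet (𝓡 3) X → Prop := fun D ↦ (∃ 𝒟 : Literature.Geometry.Lorentzian.VacuumCauchyDevelopment D, 𝒟.IsMaximal) ∧ ∀ 𝒟 : Literature.Geometry.Lorentzian.VacuumCauchyDevelopment D, 𝒟.IsMaximal → ∀ [𝒟.metric.HasLeviCivita], ¬ 𝒟.metric.IsFutureNullGeodesicallyIncomplete 𝒟.timeOrientation ∧ ¬ 𝒟.metric.IsFutureTimelikeGeodesicallyIncomplete 𝒟.timeOrientation; let Trap : Literature.Geometry.Lorentzian.InitialDataSet (𝓡 3) X → Prop := fun D ↦ (∃ 𝒟 : Literature.Geometry.Lorentzian.VacuumCauchyDevelopment D, 𝒟.IsMaximal) ∧ ∀ 𝒟 : Literature.Geometry.Lorentzian.VacuumCauchyDevelopment D, 𝒟.IsMaximal → ∀ [𝒟.metric.HasLeviCivita], ∃ f : Metric.sphere (0 : Literature.Geometry.Lorentzian.E3) 1 → 𝒟.carrier, Set.range f ⊆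 𝒟.metric.causalFuture 𝒟.timeOrientation (Set.range 𝒟.embed) ∧ 𝒟.metric.IsTrappedSurface (𝓡 2) 𝒟.timeOrientation f; let Cens : Literature.Geometry.Lorentzian.InitialDataSet (𝓡 3) X → Prop := fun D ↦ ∀ 𝒟 : Literature.Geometry.Lorentzian.VacuumCauchyDevelopment D, 𝒟.IsMaximal → Summit.FinalStateConjecture.HasCompleteNullInfinity 𝒟.toCauchyDevelopment; let Single : Literature.Geometry.Lorentzian.InitialDataSet (𝓡 3) X → Prop := fun D ↦ ∀ 𝒟 : Literature.Geometry.Lorentzian.VacuumCauchyDevelopment D, 𝒟.IsMaximal → ∀ [𝒟.metric.HasLeviCivita], Subsingleton (ConnectedComponents ↥(Literature.Geometry.Lorentzian.DataEmbedding.blackHoleRegion 𝒟.toDataEmbedding ∩ 𝒟.metric.causalFuture 𝒟.timeOrientation (Set.range 𝒟.embed))); let CenFinF : Literature.Geometry.Lorentzian.InitialDataSet (𝓡 3) X → Prop := fun D ↦ ∀ 𝒟 : Literature.Geometry.Lorentzian.VacuumCauchyDevelopment D, 𝒟.IsMaximal → ∃ n : ℕ, ∀ (X' : Type) [TopologicalSpace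 X'] [ChartedSpace Literature.Geometry.Lorentzian.E3 X'] [IsManifold (𝓡 3) ((⊤ : ℕ∞) : WithTop ℕ∞) X'] [ConnectedSpace X'] (D' : Literature.Geometry.Lorentzian.InitialDataSet (𝓡 3) X') (ι' : X' → 𝒟.carrier) (ν' : Literature.Geometry.Lorentzian.NormalField (𝓡 4) ι'), Manifold.IsSmoothEmbedding (𝓡 3) (𝓡 4) ((⊤ : ℕ∞) : WithTop ℕ∞) ι' → 𝒟.metric.IsFutureUnitNormal (𝓡 3) 𝒟.timeOrientation ι' ν' → (∀ y : X', Literature.Geometry.Lorentzian.pullbackBilin (I := 𝓡 4) (I' := 𝓡 3) ι' 𝒟.metric.val y = D'.h.inner y) → (∀ [𝒟.metric.toPseudoRiemannianMetric.HasLeviCivita] (y : X'), 𝒟.metric.toPseudoRiemannianMetric.secondFundamentalForm (𝓡 3) ι' ν' y = D'.kBilin y) → 𝒟.metric.IsCauchyHypersurface 𝒟.timeOrientation (Set.range ι') → Set.range ι' ⊆ 𝒟.metric.causalFuture 𝒟.timeOrientation (Set.range 𝒟.embed) → ∀ S : Fin (n + 1) → Literature.Geometry.Lorentzian.OutermostMOTS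 (𝓡 3) D'.h D'.k, (∀ j, ConnectedSpace (S j).surf) → (∀ j, IsCompact (((S j).exterior : Set X'))ᶜ ∧ (interior (((S j).exterior : Set X'))ᶜ).Nonempty) → ∃ j j', j ≠ j' ∧ ((((S j).exterior : Set X'))ᶜ ∩ (((S j').exterior : Set X'))ᶜ).Nonempty; let MassF : (D : Literature.Geometry.Lorentzian.InitialDataSet (𝓡 3) X) → Literature.Geometry.Lorentzian.VacuumCauchyDevelopment D → ENNReal := fun D 𝒟 ↦ ⨅ (K : Set 𝒟.carrier) (_ : IsCompact K) (m : ℝ) (_ : 𝒟.toCauchyDevelopment.HasCutBondiMass K m), ENNReal.ofReal m; let AreaF : (D : Literature.Geometry.Lorentzian.InitialDataSet (𝓡 3) X) → (𝒟 : Literature.Geometry.Lorentzian.VacuumCauchyDevelopment D) → [𝒟.metric.HasLeviCivita] → ENNReal := fun D 𝒟 hLC ↦ sInf {a : ENNReal | ∀ (X' : Type) [TopologicalSpace X'] [ChartedSpace Literature.Geometry.Lorentzian.E3 X'] [IsManifold (𝓡 3) ((⊤ : ℕ∞) : WithTop ℕ∞) X'] [ConnectedSpace X'] [T2Space X'] (D'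 : Literature.Geometry.Lorentzian.InitialDataSet (𝓡 3) X') (ι' : X' → 𝒟.carrier) (ν' : Literature.Geometry.Lorentzian.NormalField (𝓡 4) ι'), Manifold.IsSmoothEmbedding (𝓡 3) (𝓡 4) ((⊤ : ℕ∞) : WithTop ℕ∞) ι' → 𝒟.metric.IsFutureUnitNormal (𝓡 3) 𝒟.timeOrientation ι' ν' → (∀ y : X', Literature.Geometry.Lorentzian.pullbackBilin (I := 𝓡 4) (I' := 𝓡 3) ι' 𝒟.metric.val y = D'.h.inner y) → (∀ [𝒟.metric.toPseudoRiemannianMetric.HasLeviCivita] (y : X'), 𝒟.metric.toPseudoRiemannianMetric.secondFundamentalForm (𝓡 3) ι' ν' y = D'.kBilin y) → 𝒟.metric.IsCauchyHypersurface 𝒟.timeOrientation (Set.range ι') → Set.range ι' ⊆ 𝒟.metric.causalFuture 𝒟.timeOrientation (Set.range 𝒟.embed) → (letI : MeasurableSpace X' := borel X'; haveI : BorelSpace X' := ⟨rfl⟩; haveI : LocallyCompactSpace X' := ChartedSpace.locallyCompactSpace Literature.Geometry.Lorentzian.E3 X'; Literature.Geometry.Lorentzian.area D'.h (ι' ⁻¹'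 Literature.Geometry.Lorentzian.DataEmbedding.futureEventHorizon 𝒟.toDataEmbedding)) ≤ a}; let Acc : Literature.Geometry.Lorentzian.InitialDataSet (𝓡 3) X → Prop := fun D ↦ ∃ (M A : ENNReal), M ≠ ⊤ ∧ (∀ e : Literature.Geometry.Lorentzian.AFEnd X, e.IsAsymptoticallyFlat D 1 → (∃ m, e.HasADMEnergy D m) → M ≤ ENNReal.ofReal (e.admMass D)) ∧ ∀ 𝒟 : Literature.Geometry.Lorentzian.VacuumCauchyDevelopment D, 𝒟.IsMaximal → ∀ [𝒟.metric.HasLeviCivita], MassF D 𝒟 = M ∧ AreaF D 𝒟 = A; let KN : Literature.Geometry.Lorentzian.InitialDataSet (𝓡 3) X → Prop := fun D ↦ D.IsMaximalData ∧ ∃ (e : Literature.Geometry.Lorentzian.AFEnd X) (M η : ℝ), 0 < η ∧ e.IsSoleEnd ∧ e.IsStronglyAsymptoticallyFlatWith D M (3 / 2 + η) (5 / 2 + η) 4 3; ∀ d ∈ Literature.Geometry.Lorentzian.admissibleVacuumData X, ¬ P d → (((¬ Disp d ∧ Trap d ∧ Cens d ∧ ¬ Pw0 d) ∧ Single d) ∧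 CenFinF d) → (¬ Acc d ∧ ¬ KN d) → ∃ (e : Literature.Geometry.Lorentzian.AFEnd X) (F : EuclideanSpace ℝ (Fin 1) → Literature.Geometry.Lorentzian.InitialDataSet (𝓡 3) X), Literature.Geometry.Lorentzian.InitialDataSet.IsTameDataFamily e 1 F ∧ Literature.Geometry.Lorentzian.InitialDataSet.IsImmersedAtZero 1 F ∧ F 0 = d ∧ Injective F ∧ (∀ c, F c ∈ Literature.Geometry.Lorentzian.admissibleVacuumData X) ∧ ∀ c ≠ 0, P (F c)

-- parent: NoChargeExit · child (gen 1)
/--     item stmt-FinalStateConjecture-29290 · support · rank 201 · open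
    parent: NoChargeExit · by planner
    why it might fail: Empty only modulo S1∧S3∧S2: should the identification of the Klainerman–Nicolò exterior cones with ∂J⁺(K) inside an arbitrary MGHD fail (causal bridge) the door would carry content; else none — K–N is printed for all data sizes.
    sources: KlainermanNicolo2003 Thm 3.7.1, Thm 8.5.2, Thm 8.5.3, Bartnik1986 Thm 4.2, ChoquetBruhatGeroch1969
[support · THIN · EMPTY GIVEN SUPPORTS · does NOT count · door Dₙ of lens-5 g6 «FarLedgerCells» on
stmt-28426 (critic CLEARED 2026-08-30T06:07:07Z, RULING R1 06:11:22Z)] Same population as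
NoChargeExit (censored single-hole data, admissible, not dispersive, every MGHD traps, complete 𝓘⁺,
weak C⁰-Kerr capture fails, at most one final hole, bounded future census, ¬Acc d: no honest Bondi
account) AND the datum's TAIL lies in the Klainerman–Nicolò class KN d := d.IsMaximalData ∧ ∃ (e :
AFEnd X) (M η : ℝ), 0 < η ∧ e.IsSoleEnd ∧ e.IsStronglyAsymptoticallyFlatWith d M (3/2+η) (5/2+η) 4 3
(VERBATIM the hypothesis block of the tree fact klainerman_nicolo_exterior_null_completeness; large
data allowed, no hand-picked threshold): exit tamely with codimension ≥ 1. EMPTY once three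
cell-free porting-grade supports are theorems — kernel farAccountDoor_of_ledgers :
ExteriorBondiLedger (S1 = D9 wi-97120: K–N Ch. 8 exterior Bondi ledger + causal bridge) →
ADMChartLedger (S3 = D10 wi-97121: ADM 4-momentum chart invariance) → ChargeCoherence (S2 =
wi-96536: CBG development transport) → FarAccountDoor (std axioms); kill path = land that theorem
--supports this item once S1–S3 are in the tree. Text = l -/
@[route_item "route-FinalStateConjecture-RootDecompFarLedgerCells"]
def FarAccountDoor : Prop :=
  ∀ (X : Type) [TopologicalSpace X] [ChartedSpace Literature.Geometry.Lorentzian.E3 X] [IsManifold (𝓡 3) ((⊤ : ℕ∞) : WithTop ℕ∞) X] [T2Space X] [SecondCountableTopology X] [ConnectedSpace X], let P : Literature.Geometry.Lorentzian.InitialDataSet (𝓡 3) X → Prop := fun D ↦ (∃ 𝒟 : Literature.Geometry.Lorentzian.VacuumCauchyDevelopment D, 𝒟.IsMaximal) ∧ ∀ 𝒟 : Literature.Geometry.Lorentzian.VacuumCauchyDevelopment D, 𝒟.IsMaximal → Summit.FinalStateConjecture.HasCompleteNullInfinity 𝒟.toCauchyDevelopment ∧ ∃ (O : Set 𝒟.carrier)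 (d : Literature.Geometry.Lorentzian.FinalStateDecomposition 𝒟.toSpacetime O 2), (∀ i, Literature.Geometry.Lorentzian.Kerr.IsSubextremal (d.mass i) (d.spin i)) ∧ O = Summit.FinalStateConjecture.exteriorOf 𝒟.toCauchyDevelopment d.charted ∧ Summit.FinalStateConjecture.RaysStayInClosure 𝒟.toCauchyDevelopment O ∧ Summit.FinalStateConjecture.HasExhaustiveCharts d ∧ Summit.FinalStateConjecture.IsFutureOriented d; let Pw0 : Literature.Geometry.Lorentzian.InitialDataSet (𝓡 3) X → Prop := fun D ↦ (∃ 𝒟 : Literature.Geometry.Lorentzian.VacuumCauchyDevelopment D, 𝒟.IsMaximal) ∧ ∀ 𝒟 : Literature.Geometry.Lorentzian.VacuumCauchyDevelopment D, 𝒟.IsMaximal → Summit.FinalStateConjecture.HasCompleteNullInfinity 𝒟.toCauchyDevelopment ∧ ∃ (O : Set 𝒟.carrier) (d : Literature.Geometry.Lorentzian.FinalStateDecomposition 𝒟.toSpacetime O 0), O = Summit.FinalStateConjecture.exteriorOf 𝒟.toCauchyDevelopment d.charted ∧ Summit.FinalStateConjecture.RaysStayInClosure 𝒟.toCauchyDevelopment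 O ∧ Summit.FinalStateConjecture.HasExhaustiveCharts d ∧ Summit.FinalStateConjecture.IsFutureOriented d; let Disp : Literature.Geometry.Lorentzian.InitialDataSet (𝓡 3) X → Prop := fun D ↦ (∃ 𝒟 : Literature.Geometry.Lorentzian.VacuumCauchyDevelopment D, 𝒟.IsMaximal) ∧ ∀ 𝒟 : Literature.Geometry.Lorentzian.VacuumCauchyDevelopment D, 𝒟.IsMaximal → ∀ [𝒟.metric.HasLeviCivita], ¬ 𝒟.metric.IsFutureNullGeodesicallyIncomplete 𝒟.timeOrientation ∧ ¬ 𝒟.metric.IsFutureTimelikeGeodesicallyIncomplete 𝒟.timeOrientation; let Trap : Literature.Geometry.Lorentzian.InitialDataSet (𝓡 3) X → Prop := fun D ↦ (∃ 𝒟 : Literature.Geometry.Lorentzian.VacuumCauchyDevelopment D, 𝒟.IsMaximal) ∧ ∀ 𝒟 : Literature.Geometry.Lorentzian.VacuumCauchyDevelopment D, 𝒟.IsMaximal → ∀ [𝒟.metric.HasLeviCivita], ∃ f : Metric.sphere (0 : Literature.Geometry.Lorentzian.E3) 1 → 𝒟.carrier, Set.range f ⊆ 𝒟.metric.causalFuture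 𝒟.timeOrientation (Set.range 𝒟.embed) ∧ 𝒟.metric.IsTrappedSurface (𝓡 2) 𝒟.timeOrientation f; let Cens : Literature.Geometry.Lorentzian.InitialDataSet (𝓡 3) X → Prop := fun D ↦ ∀ 𝒟 : Literature.Geometry.Lorentzian.VacuumCauchyDevelopment D, 𝒟.IsMaximal → Summit.FinalStateConjecture.HasCompleteNullInfinity 𝒟.toCauchyDevelopment; let Single : Literature.Geometry.Lorentzian.InitialDataSet (𝓡 3) X → Prop := fun D ↦ ∀ 𝒟 : Literature.Geometry.Lorentzian.VacuumCauchyDevelopment D, 𝒟.IsMaximal → ∀ [𝒟.metric.HasLeviCivita], Subsingleton (ConnectedComponents ↥(Literature.Geometry.Lorentzian.DataEmbedding.blackHoleRegion 𝒟.toDataEmbedding ∩ 𝒟.metric.causalFuture 𝒟.timeOrientation (Set.range 𝒟.embed))); let CenFinF : Literature.Geometry.Lorentzian.InitialDataSet (𝓡 3) X → Prop := fun D ↦ ∀ 𝒟 : Literature.Geometry.Lorentzian.VacuumCauchyDevelopment D, 𝒟.IsMaximal → ∃ n : ℕ, ∀ (X' : Type) [TopologicalSpace X'] [ChartedSpace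 Literature.Geometry.Lorentzian.E3 X'] [IsManifold (𝓡 3) ((⊤ : ℕ∞) : WithTop ℕ∞) X'] [ConnectedSpace X'] (D' : Literature.Geometry.Lorentzian.InitialDataSet (𝓡 3) X') (ι' : X' → 𝒟.carrier) (ν' : Literature.Geometry.Lorentzian.NormalField (𝓡 4) ι'), Manifold.IsSmoothEmbedding (𝓡 3) (𝓡 4) ((⊤ : ℕ∞) : WithTop ℕ∞) ι' → 𝒟.metric.IsFutureUnitNormal (𝓡 3) 𝒟.timeOrientation ι' ν' → (∀ y : X', Literature.Geometry.Lorentzian.pullbackBilin (I := 𝓡 4) (I' := 𝓡 3) ι' 𝒟.metric.val y = D'.h.inner y) → (∀ [𝒟.metric.toPseudoRiemannianMetric.HasLeviCivita] (y : X'), 𝒟.metric.toPseudoRiemannianMetric.secondFundamentalForm (𝓡 3) ι' ν' y = D'.kBilin y) → 𝒟.metric.IsCauchyHypersurface 𝒟.timeOrientation (Set.range ι') → Set.range ι' ⊆ 𝒟.metric.causalFuture 𝒟.timeOrientation (Set.range 𝒟.embed) → ∀ S : Fin (n + 1) → Literature.Geometry.Lorentzian.OutermostMOTS (𝓡 3)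 D'.h D'.k, (∀ j, ConnectedSpace (S j).surf) → (∀ j, IsCompact (((S j).exterior : Set X'))ᶜ ∧ (interior (((S j).exterior : Set X'))ᶜ).Nonempty) → ∃ j j', j ≠ j' ∧ ((((S j).exterior : Set X'))ᶜ ∩ (((S j').exterior : Set X'))ᶜ).Nonempty; let MassF : (D : Literature.Geometry.Lorentzian.InitialDataSet (𝓡 3) X) → Literature.Geometry.Lorentzian.VacuumCauchyDevelopment D → ENNReal := fun D 𝒟 ↦ ⨅ (K : Set 𝒟.carrier) (_ : IsCompact K) (m : ℝ) (_ : 𝒟.toCauchyDevelopment.HasCutBondiMass K m), ENNReal.ofReal m; let AreaF : (D : Literature.Geometry.Lorentzian.InitialDataSet (𝓡 3) X) → (𝒟 : Literature.Geometry.Lorentzian.VacuumCauchyDevelopment D) → [𝒟.metric.HasLeviCivita] → ENNReal := fun D 𝒟 hLC ↦ sInf {a : ENNReal | ∀ (X' : Type) [TopologicalSpace X'] [ChartedSpace Literature.Geometry.Lorentzian.E3 X'] [IsManifold (𝓡 3) ((⊤ : ℕ∞) : WithTop ℕ∞) X'] [ConnectedSpace X'] [T2Space X'] (D' : Literature.Geometry.Lorentzian.InitialDataSet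 (𝓡 3) X') (ι' : X' → 𝒟.carrier) (ν' : Literature.Geometry.Lorentzian.NormalField (𝓡 4) ι'), Manifold.IsSmoothEmbedding (𝓡 3) (𝓡 4) ((⊤ : ℕ∞) : WithTop ℕ∞) ι' → 𝒟.metric.IsFutureUnitNormal (𝓡 3) 𝒟.timeOrientation ι' ν' → (∀ y : X', Literature.Geometry.Lorentzian.pullbackBilin (I := 𝓡 4) (I' := 𝓡 3) ι' 𝒟.metric.val y = D'.h.inner y) → (∀ [𝒟.metric.toPseudoRiemannianMetric.HasLeviCivita] (y : X'), 𝒟.metric.toPseudoRiemannianMetric.secondFundamentalForm (𝓡 3) ι' ν' y = D'.kBilin y) → 𝒟.metric.IsCauchyHypersurface 𝒟.timeOrientation (Set.range ι') → Set.range ι' ⊆ 𝒟.metric.causalFuture 𝒟.timeOrientation (Set.range 𝒟.embed) → (letI : MeasurableSpace X' := borel X'; haveI : BorelSpace X' := ⟨rfl⟩; haveI : LocallyCompactSpace X' := ChartedSpace.locallyCompactSpace Literature.Geometry.Lorentzian.E3 X'; Literature.Geometry.Lorentzian.area D'.h (ι' ⁻¹' Literature.Geometry.Lorentzian.DataEmbedding.futureEventHorizon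 𝒟.toDataEmbedding)) ≤ a}; let Acc : Literature.Geometry.Lorentzian.InitialDataSet (𝓡 3) X → Prop := fun D ↦ ∃ (M A : ENNReal), M ≠ ⊤ ∧ (∀ e : Literature.Geometry.Lorentzian.AFEnd X, e.IsAsymptoticallyFlat D 1 → (∃ m, e.HasADMEnergy D m) → M ≤ ENNReal.ofReal (e.admMass D)) ∧ ∀ 𝒟 : Literature.Geometry.Lorentzian.VacuumCauchyDevelopment D, 𝒟.IsMaximal → ∀ [𝒟.metric.HasLeviCivita], MassF D 𝒟 = M ∧ AreaF D 𝒟 = A; let KN : Literature.Geometry.Lorentzian.InitialDataSet (𝓡 3) X → Prop := fun D ↦ D.IsMaximalData ∧ ∃ (e : Literature.Geometry.Lorentzian.AFEnd X) (M η : ℝ), 0 < η ∧ e.IsSoleEnd ∧ e.IsStronglyAsymptoticallyFlatWith D M (3 / 2 + η) (5 / 2 + η) 4 3; ∀ d ∈ Literature.Geometry.Lorentzian.admissibleVacuumData X, ¬ P d → (((¬ Disp d ∧ Trap d ∧ Cens d ∧ ¬ Pw0 d) ∧ Single d) ∧ CenFinF d) → (¬ Acc d ∧ KN d) → ∃ (e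 : Literature.Geometry.Lorentzian.AFEnd X) (F : EuclideanSpace ℝ (Fin 1) → Literature.Geometry.Lorentzian.InitialDataSet (𝓡 3) X), Literature.Geometry.Lorentzian.InitialDataSet.IsTameDataFamily e 1 F ∧ Literature.Geometry.Lorentzian.InitialDataSet.IsImmersedAtZero 1 F ∧ F 0 = d ∧ Injective F ∧ (∀ c, F c ∈ Literature.Geometry.Lorentzian.admissibleVacuumData X) ∧ ∀ c ≠ 0, P (F c)

-- parent: NoChargeExit · glue (gen 1)
/--     item stmt-FinalStateConjecture-29292 · support · rank 203 · closed · proved by Summit.FinalStateConjecture.FinalStateConjecture.Theorems.RootDecompFarLedgerCellsNoChargeExitGlue.noChargeExitGlue (prover)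
    parent: NoChargeExit · GLUE: children ⟹ parent · by planner
FarAccountDoor → RoughTailExit → NoChargeExit -/
@[route_item "route-FinalStateConjecture-RootDecompFarLedgerCells"]
def NoChargeExitGlue : Prop :=
  FarAccountDoor → RoughTailExit → NoChargeExit

-- `NoChargeExitGlue` holds: proved by `Summit.FinalStateConjecture.FinalStateConjecture.Theorems.RootDecompFarLedgerCellsNoChargeExitGlue.noChargeExitGlue` (its module imports this route file, so no `_holds` link can be stated here).

/-- item stmt-FinalStateConjecture-28422 · crux · rank 3 · open · by planner
why it might fail: Kerr-compatible books (8πM_f² < A_f ≤ 16πM_f²) do not force convergence: no theorem excludes an eternally non-settling censored exterior whose monotone limits sit on a Kerr curve; the χ̄-margin stability theorems consume slice-norm closeness that monotone limits never supply (caution c4).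
sources: arXiv:2104.11857, arXiv:2606.28253, arXiv:2605.18730, arXiv:2205.14808, doi:10.1111/j.1749-6632.1973.tb41447.x
[crux · NEW RESIDUAL · PARKED residual · internal node K of lens-5 g5 «FinalChargeCells» on
stmt-27603] Admissible non-generic data outside the dispersive and threshold cells whose maximal
developments are censored, trapped, with exactly ONE and finitely many future black holes (the
BoundedSingleExit population) AND whose asymptotic books close MGHD-coherently (Acc: a final Bondi
rest mass MassF = inf over asymptotically round receding families of Hawking-mass limits, ≤ m_ADM in
every AF chart, and a final horizon area AreaF = sup over future Cauchy cuts of area(Σ′ ∩ 𝓗⁺)) with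
the books in the KERR BAND 8π·MassF² < AreaF ≤ 16π·MassF² (KerrB), exit tamely with codimension ≥ 1.
The candidate final Kerr (M_f, χ_f) is PINNED by two monotone scalars (χ_f read off A =
8πM²(1+√(1−χ²))); what remains is a pure RATE statement: convergence of the censored exterior to
that Kerr — the large-data Kerr stability problem proper. RE-PARKED by the critic (05:09:06Z):
χ-band sub-splits are exact and window-free but decorative under caution c4 until a «charge ⇒
slice-norm» rung exists. Instrumentable (NR reads M_f, A_f). Domination: 27603 ⟺ K ∧ Dr ∧ L ∧ H ∧ N
(lens kernel boundedSingleExit_iff_cells) -/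
@[route_item "route-FinalStateConjecture-RootDecompFarLedgerCells", crux]
def SubextremalChargeExit : Prop :=
  ∀ (X : Type) [TopologicalSpace X] [ChartedSpace Literature.Geometry.Lorentzian.E3 X] [IsManifold (𝓡 3) ((⊤ : ℕ∞) : WithTop ℕ∞) X] [T2Space X] [SecondCountableTopology X] [ConnectedSpace X], let P : Literature.Geometry.Lorentzian.InitialDataSet (𝓡 3) X → Prop := fun D ↦ (∃ 𝒟 : Literature.Geometry.Lorentzian.VacuumCauchyDevelopment D, 𝒟.IsMaximal) ∧ ∀ 𝒟 : Literature.Geometry.Lorentzian.VacuumCauchyDevelopment D, 𝒟.IsMaximal → Summit.FinalStateConjecture.HasCompleteNullInfinity 𝒟.toCauchyDevelopment ∧ ∃ (O : Set 𝒟.carrier) (d : Literature.Geometry.Lorentzian.FinalStateDecomposition 𝒟.toSpacetime O 2), (∀ i, Literature.Geometry.Lorentzian.Kerr.IsSubextremal (d.mass i) (d.spin i)) ∧ O = Summit.FinalStateConjecture.exteriorOf 𝒟.toCauchyDevelopment d.charted ∧ Summit.FinalStateConjecture.RaysStayInClosure 𝒟.toCauchyDevelopment O ∧ Summit.FinalStateConjecture.HasExhaustiveCharts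 d ∧ Summit.FinalStateConjecture.IsFutureOriented d; let Pw0 : Literature.Geometry.Lorentzian.InitialDataSet (𝓡 3) X → Prop := fun D ↦ (∃ 𝒟 : Literature.Geometry.Lorentzian.VacuumCauchyDevelopment D, 𝒟.IsMaximal) ∧ ∀ 𝒟 : Literature.Geometry.Lorentzian.VacuumCauchyDevelopment D, 𝒟.IsMaximal → Summit.FinalStateConjecture.HasCompleteNullInfinity 𝒟.toCauchyDevelopment ∧ ∃ (O : Set 𝒟.carrier) (d : Literature.Geometry.Lorentzian.FinalStateDecomposition 𝒟.toSpacetime O 0), O = Summit.FinalStateConjecture.exteriorOf 𝒟.toCauchyDevelopment d.charted ∧ Summit.FinalStateConjecture.RaysStayInClosure 𝒟.toCauchyDevelopment O ∧ Summit.FinalStateConjecture.HasExhaustiveCharts d ∧ Summit.FinalStateConjecture.IsFutureOriented d; let Disp : Literature.Geometry.Lorentzian.InitialDataSet (𝓡 3) X → Prop := fun D ↦ (∃ 𝒟 : Literature.Geometry.Lorentzian.VacuumCauchyDevelopment D, 𝒟.IsMaximal) ∧ ∀ 𝒟 : Literature.Geometry.Lorentzian.VacuumCauchyDevelopment D, 𝒟.IsMaximal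 → ∀ [𝒟.metric.HasLeviCivita], ¬ 𝒟.metric.IsFutureNullGeodesicallyIncomplete 𝒟.timeOrientation ∧ ¬ 𝒟.metric.IsFutureTimelikeGeodesicallyIncomplete 𝒟.timeOrientation; let Trap : Literature.Geometry.Lorentzian.InitialDataSet (𝓡 3) X → Prop := fun D ↦ (∃ 𝒟 : Literature.Geometry.Lorentzian.VacuumCauchyDevelopment D, 𝒟.IsMaximal) ∧ ∀ 𝒟 : Literature.Geometry.Lorentzian.VacuumCauchyDevelopment D, 𝒟.IsMaximal → ∀ [𝒟.metric.HasLeviCivita], ∃ f : Metric.sphere (0 : Literature.Geometry.Lorentzian.E3) 1 → 𝒟.carrier, Set.range f ⊆ 𝒟.metric.causalFuture 𝒟.timeOrientation (Set.range 𝒟.embed) ∧ 𝒟.metric.IsTrappedSurface (𝓡 2) 𝒟.timeOrientation f; let Cens : Literature.Geometry.Lorentzian.InitialDataSet (𝓡 3) X → Prop := fun D ↦ ∀ 𝒟 : Literature.Geometry.Lorentzian.VacuumCauchyDevelopment D, 𝒟.IsMaximal → Summit.FinalStateConjecture.HasCompleteNullInfinity 𝒟.toCauchyDevelopment; let Single :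 Literature.Geometry.Lorentzian.InitialDataSet (𝓡 3) X → Prop := fun D ↦ ∀ 𝒟 : Literature.Geometry.Lorentzian.VacuumCauchyDevelopment D, 𝒟.IsMaximal → ∀ [𝒟.metric.HasLeviCivita], Subsingleton (ConnectedComponents ↥(Literature.Geometry.Lorentzian.DataEmbedding.blackHoleRegion 𝒟.toDataEmbedding ∩ 𝒟.metric.causalFuture 𝒟.timeOrientation (Set.range 𝒟.embed))); let CenFinF : Literature.Geometry.Lorentzian.InitialDataSet (𝓡 3) X → Prop := fun D ↦ ∀ 𝒟 : Literature.Geometry.Lorentzian.VacuumCauchyDevelopment D, 𝒟.IsMaximal → ∃ n : ℕ, ∀ (X' : Type) [TopologicalSpace X'] [ChartedSpace Literature.Geometry.Lorentzian.E3 X'] [IsManifold (𝓡 3) ((⊤ : ℕ∞) : WithTop ℕ∞) X'] [ConnectedSpace X'] (D' : Literature.Geometry.Lorentzian.InitialDataSet (𝓡 3) X') (ι' : X' → 𝒟.carrier) (ν' : Literature.Geometry.Lorentzian.NormalField (𝓡 4) ι'), Manifold.IsSmoothEmbedding (𝓡 3) (𝓡 4) ((⊤ : ℕ∞) : WithTop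 ℕ∞) ι' → 𝒟.metric.IsFutureUnitNormal (𝓡 3) 𝒟.timeOrientation ι' ν' → (∀ y : X', Literature.Geometry.Lorentzian.pullbackBilin (I := 𝓡 4) (I' := 𝓡 3) ι' 𝒟.metric.val y = D'.h.inner y) → (∀ [𝒟.metric.toPseudoRiemannianMetric.HasLeviCivita] (y : X'), 𝒟.metric.toPseudoRiemannianMetric.secondFundamentalForm (𝓡 3) ι' ν' y = D'.kBilin y) → 𝒟.metric.IsCauchyHypersurface 𝒟.timeOrientation (Set.range ι') → Set.range ι' ⊆ 𝒟.metric.causalFuture 𝒟.timeOrientation (Set.range 𝒟.embed) → ∀ S : Fin (n + 1) → Literature.Geometry.Lorentzian.OutermostMOTS (𝓡 3) D'.h D'.k, (∀ j, ConnectedSpace (S j).surf) → (∀ j, IsCompact (((S j).exterior : Set X'))ᶜ ∧ (interior (((S j).exterior : Set X'))ᶜ).Nonempty) → ∃ j j', j ≠ j' ∧ ((((S j).exterior : Set X'))ᶜ ∩ (((S j').exterior : Set X'))ᶜ).Nonempty; let kerrLo : ENNReal → ENNReal := fun M ↦ ENNReal.ofReal (8 * Real.pi) * M ^ 2; let kerrHi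 : ENNReal → ENNReal := fun M ↦ ENNReal.ofReal (16 * Real.pi) * M ^ 2; let MassF : (D : Literature.Geometry.Lorentzian.InitialDataSet (𝓡 3) X) → Literature.Geometry.Lorentzian.VacuumCauchyDevelopment D → ENNReal := fun D 𝒟 ↦ ⨅ (K : Set 𝒟.carrier) (_ : IsCompact K) (m : ℝ) (_ : 𝒟.toCauchyDevelopment.HasCutBondiMass K m), ENNReal.ofReal m; let AreaF : (D : Literature.Geometry.Lorentzian.InitialDataSet (𝓡 3) X) → (𝒟 : Literature.Geometry.Lorentzian.VacuumCauchyDevelopment D) → [𝒟.metric.HasLeviCivita] → ENNReal := fun D 𝒟 hLC ↦ sInf {a : ENNReal | ∀ (X' : Type) [TopologicalSpace X'] [ChartedSpace Literature.Geometry.Lorentzian.E3 X'] [IsManifold (𝓡 3) ((⊤ : ℕ∞) : WithTop ℕ∞) X'] [ConnectedSpace X'] [T2Space X'] (D' : Literature.Geometry.Lorentzian.InitialDataSet (𝓡 3) X') (ι' : X' → 𝒟.carrier) (ν' : Literature.Geometry.Lorentzian.NormalField (𝓡 4) ι'), Manifold.IsSmoothEmbedding (𝓡 3) (𝓡 4)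 ((⊤ : ℕ∞) : WithTop ℕ∞) ι' → 𝒟.metric.IsFutureUnitNormal (𝓡 3) 𝒟.timeOrientation ι' ν' → (∀ y : X', Literature.Geometry.Lorentzian.pullbackBilin (I := 𝓡 4) (I' := 𝓡 3) ι' 𝒟.metric.val y = D'.h.inner y) → (∀ [𝒟.metric.toPseudoRiemannianMetric.HasLeviCivita] (y : X'), 𝒟.metric.toPseudoRiemannianMetric.secondFundamentalForm (𝓡 3) ι' ν' y = D'.kBilin y) → 𝒟.metric.IsCauchyHypersurface 𝒟.timeOrientation (Set.range ι') → Set.range ι' ⊆ 𝒟.metric.causalFuture 𝒟.timeOrientation (Set.range 𝒟.embed) → (letI : MeasurableSpace X' := borel X'; haveI : BorelSpace X' := ⟨rfl⟩; haveI : LocallyCompactSpace X' := ChartedSpace.locallyCompactSpace Literature.Geometry.Lorentzian.E3 X'; Literature.Geometry.Lorentzian.area D'.h (ι' ⁻¹' Literature.Geometry.Lorentzian.DataEmbedding.futureEventHorizon 𝒟.toDataEmbedding)) ≤ a}; let Acc : Literature.Geometry.Lorentzian.InitialDataSet (𝓡 3) X → Prop := fun D ↦ ∃ (M A : ENNReal),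 M ≠ ⊤ ∧ (∀ e : Literature.Geometry.Lorentzian.AFEnd X, e.IsAsymptoticallyFlat D 1 → (∃ m, e.HasADMEnergy D m) → M ≤ ENNReal.ofReal (e.admMass D)) ∧ ∀ 𝒟 : Literature.Geometry.Lorentzian.VacuumCauchyDevelopment D, 𝒟.IsMaximal → ∀ [𝒟.metric.HasLeviCivita], MassF D 𝒟 = M ∧ AreaF D 𝒟 = A; let KerrB : Literature.Geometry.Lorentzian.InitialDataSet (𝓡 3) X → Prop := fun D ↦ ∀ 𝒟 : Literature.Geometry.Lorentzian.VacuumCauchyDevelopment D, 𝒟.IsMaximal → ∀ [𝒟.metric.HasLeviCivita], MassF D 𝒟 ≠ ⊤ ∧ kerrLo (MassF D 𝒟) < AreaF D 𝒟 ∧ AreaF D 𝒟 ≤ kerrHi (MassF D 𝒟); ∀ d ∈ Literature.Geometry.Lorentzian.admissibleVacuumData X, ¬ P d → (((¬ Disp d ∧ Trap d ∧ Cens d ∧ ¬ Pw0 d) ∧ Single d) ∧ CenFinF d) → (Acc d ∧ KerrB d) → ∃ (e : Literature.Geometry.Lorentzian.AFEnd X) (F : EuclideanSpace ℝ (Fin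 1) → Literature.Geometry.Lorentzian.InitialDataSet (𝓡 3) X), Literature.Geometry.Lorentzian.InitialDataSet.IsTameDataFamily e 1 F ∧ Literature.Geometry.Lorentzian.InitialDataSet.IsImmersedAtZero 1 F ∧ F 0 = d ∧ Injective F ∧ (∀ c, F c ∈ Literature.Geometry.Lorentzian.admissibleVacuumData X) ∧ ∀ c ≠ 0, P (F c)

/-- item stmt-FinalStateConjecture-28424 · crux · rank 4 · open · by planner
why it might fail: Extremal horizons DO form dynamically in finite time for Einstein–Maxwell–charged matter (Kehle–Unger); a vacuum analogue A_f = 8πM_f², or an eternal non-radiating exterior reservoir giving A_f < 8πM_f², is excluded by no theorem (no-periodic results need analyticity/stationarity near 𝓘).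
sources: arXiv:2211.15742, arXiv:2402.10190, arXiv:1504.04592, arXiv:1008.0248
[crux · SPECIAL-TYPE · leaf L of lens-5 g5 on stmt-27603] Same population with Acc ∧ ¬KerrB ∧ HeavyB
∧ ¬Hor: the books are at or below the extremal Kerr line (AreaF ≤ 8π·MassF²) and NO honest outermost
horizon of area ≥ 16π(0.81)m² is available — the EXTREMAL END STATE corner (A_f = 8πM_f²: dynamical
formation of an extremal vacuum horizon) together with the «massive eternal exterior reservoir»
corner (A_f < 8πM_f² with mass that never radiates nor falls in): exit tamely with codimension ≥ 1.
IDEA-NEEDED: a vacuum third law / no-reservoir theorem (Kehle–Unger arXiv:2211.15742 shows extremal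
horizons DO form in finite time for Einstein–Maxwell–charged matter; vacuum open; no-periodic
results arXiv:1504.04592, arXiv:1008.0248 need stationarity/analyticity near 𝓘). Mechanism disjoint
from K (rate), H (Penrose inequality), N (Bondi account). -/
@[route_item "route-FinalStateConjecture-RootDecompFarLedgerCells", crux]
def HeavyChargeExit : Prop :=
  ∀ (X : Type) [TopologicalSpace X] [ChartedSpace Literature.Geometry.Lorentzian.E3 X] [IsManifold (𝓡 3) ((⊤ : ℕ∞) : WithTop ℕ∞) X] [T2Space X] [SecondCountableTopology X] [ConnectedSpace X], let P : Literature.Geometry.Lorentzian.InitialDataSet (𝓡 3) X → Prop := fun D ↦ (∃ 𝒟 : Literature.Geometry.Lorentzian.VacuumCauchyDevelopment D, 𝒟.IsMaximal) ∧ ∀ 𝒟 : Literature.Geometry.Lorentzian.VacuumCauchyDevelopment D, 𝒟.IsMaximal → Summit.FinalStateConjecture.HasCompleteNullInfinity 𝒟.toCauchyDevelopment ∧ ∃ (O : Set 𝒟.carrier) (d : Literature.Geometry.Lorentzian.FinalStateDecomposition 𝒟.toSpacetime O 2), (∀ i, Literature.Geometry.Lorentzian.Kerr.IsSubextremal (d.mass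 i) (d.spin i)) ∧ O = Summit.FinalStateConjecture.exteriorOf 𝒟.toCauchyDevelopment d.charted ∧ Summit.FinalStateConjecture.RaysStayInClosure 𝒟.toCauchyDevelopment O ∧ Summit.FinalStateConjecture.HasExhaustiveCharts d ∧ Summit.FinalStateConjecture.IsFutureOriented d; let Pw0 : Literature.Geometry.Lorentzian.InitialDataSet (𝓡 3) X → Prop := fun D ↦ (∃ 𝒟 : Literature.Geometry.Lorentzian.VacuumCauchyDevelopment D, 𝒟.IsMaximal) ∧ ∀ 𝒟 : Literature.Geometry.Lorentzian.VacuumCauchyDevelopment D, 𝒟.IsMaximal → Summit.FinalStateConjecture.HasCompleteNullInfinity 𝒟.toCauchyDevelopment ∧ ∃ (O : Set 𝒟.carrier) (d : Literature.Geometry.Lorentzian.FinalStateDecomposition 𝒟.toSpacetime O 0), O = Summit.FinalStateConjecture.exteriorOf 𝒟.toCauchyDevelopment d.charted ∧ Summit.FinalStateConjecture.RaysStayInClosure 𝒟.toCauchyDevelopment O ∧ Summit.FinalStateConjecture.HasExhaustiveCharts d ∧ Summit.FinalStateConjecture.IsFutureOriented d; let Disp : Literature.Geometry.Lorentzian.InitialDataSet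 (𝓡 3) X → Prop := fun D ↦ (∃ 𝒟 : Literature.Geometry.Lorentzian.VacuumCauchyDevelopment D, 𝒟.IsMaximal) ∧ ∀ 𝒟 : Literature.Geometry.Lorentzian.VacuumCauchyDevelopment D, 𝒟.IsMaximal → ∀ [𝒟.metric.HasLeviCivita], ¬ 𝒟.metric.IsFutureNullGeodesicallyIncomplete 𝒟.timeOrientation ∧ ¬ 𝒟.metric.IsFutureTimelikeGeodesicallyIncomplete 𝒟.timeOrientation; let Trap : Literature.Geometry.Lorentzian.InitialDataSet (𝓡 3) X → Prop := fun D ↦ (∃ 𝒟 : Literature.Geometry.Lorentzian.VacuumCauchyDevelopment D, 𝒟.IsMaximal) ∧ ∀ 𝒟 : Literature.Geometry.Lorentzian.VacuumCauchyDevelopment D, 𝒟.IsMaximal → ∀ [𝒟.metric.HasLeviCivita], ∃ f : Metric.sphere (0 : Literature.Geometry.Lorentzian.E3) 1 → 𝒟.carrier, Set.range f ⊆ 𝒟.metric.causalFuture 𝒟.timeOrientation (Set.range 𝒟.embed) ∧ 𝒟.metric.IsTrappedSurface (𝓡 2) 𝒟.timeOrientation f; let Cens : Literature.Geometry.Lorentzian.InitialDataSet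 (𝓡 3) X → Prop := fun D ↦ ∀ 𝒟 : Literature.Geometry.Lorentzian.VacuumCauchyDevelopment D, 𝒟.IsMaximal → Summit.FinalStateConjecture.HasCompleteNullInfinity 𝒟.toCauchyDevelopment; let Single : Literature.Geometry.Lorentzian.InitialDataSet (𝓡 3) X → Prop := fun D ↦ ∀ 𝒟 : Literature.Geometry.Lorentzian.VacuumCauchyDevelopment D, 𝒟.IsMaximal → ∀ [𝒟.metric.HasLeviCivita], Subsingleton (ConnectedComponents ↥(Literature.Geometry.Lorentzian.DataEmbedding.blackHoleRegion 𝒟.toDataEmbedding ∩ 𝒟.metric.causalFuture 𝒟.timeOrientation (Set.range 𝒟.embed))); let CenFinF : Literature.Geometry.Lorentzian.InitialDataSet (𝓡 3) X → Prop := fun D ↦ ∀ 𝒟 : Literature.Geometry.Lorentzian.VacuumCauchyDevelopment D, 𝒟.IsMaximal → ∃ n : ℕ, ∀ (X' : Type) [TopologicalSpace X'] [ChartedSpace Literature.Geometry.Lorentzian.E3 X'] [IsManifold (𝓡 3) ((⊤ : ℕ∞) : WithTop ℕ∞) X'] [ConnectedSpace X'] (D' : Literature.Geometry.Lorentzian.InitialDataSet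 (𝓡 3) X') (ι' : X' → 𝒟.carrier) (ν' : Literature.Geometry.Lorentzian.NormalField (𝓡 4) ι'), Manifold.IsSmoothEmbedding (𝓡 3) (𝓡 4) ((⊤ : ℕ∞) : WithTop ℕ∞) ι' → 𝒟.metric.IsFutureUnitNormal (𝓡 3) 𝒟.timeOrientation ι' ν' → (∀ y : X', Literature.Geometry.Lorentzian.pullbackBilin (I := 𝓡 4) (I' := 𝓡 3) ι' 𝒟.metric.val y = D'.h.inner y) → (∀ [𝒟.metric.toPseudoRiemannianMetric.HasLeviCivita] (y : X'), 𝒟.metric.toPseudoRiemannianMetric.secondFundamentalForm (𝓡 3) ι' ν' y = D'.kBilin y) → 𝒟.metric.IsCauchyHypersurface 𝒟.timeOrientation (Set.range ι') → Set.range ι' ⊆ 𝒟.metric.causalFuture 𝒟.timeOrientation (Set.range 𝒟.embed) → ∀ S : Fin (n + 1) → Literature.Geometry.Lorentzian.OutermostMOTS (𝓡 3) D'.h D'.k, (∀ j, ConnectedSpace (S j).surf) → (∀ j, IsCompact (((S j).exterior : Set X'))ᶜ ∧ (interior (((S j).exterior : Set X'))ᶜ).Nonempty) → ∃ j j', j ≠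 j' ∧ ((((S j).exterior : Set X'))ᶜ ∩ (((S j').exterior : Set X'))ᶜ).Nonempty; let kerrLo : ENNReal → ENNReal := fun M ↦ ENNReal.ofReal (8 * Real.pi) * M ^ 2; let kerrHi : ENNReal → ENNReal := fun M ↦ ENNReal.ofReal (16 * Real.pi) * M ^ 2; let MassF : (D : Literature.Geometry.Lorentzian.InitialDataSet (𝓡 3) X) → Literature.Geometry.Lorentzian.VacuumCauchyDevelopment D → ENNReal := fun D 𝒟 ↦ ⨅ (K : Set 𝒟.carrier) (_ : IsCompact K) (m : ℝ) (_ : 𝒟.toCauchyDevelopment.HasCutBondiMass K m), ENNReal.ofReal m; let AreaF : (D : Literature.Geometry.Lorentzian.InitialDataSet (𝓡 3) X) → (𝒟 : Literature.Geometry.Lorentzian.VacuumCauchyDevelopment D) → [𝒟.metric.HasLeviCivita] → ENNReal := fun D 𝒟 hLC ↦ sInf {a : ENNReal | ∀ (X' : Type) [TopologicalSpace X'] [ChartedSpace Literature.Geometry.Lorentzian.E3 X'] [IsManifold (𝓡 3) ((⊤ : ℕ∞) : WithTop ℕ∞) X'] [ConnectedSpace X'] [T2Space X'] (D' : Literature.Geometry.Lorentzian.InitialDataSet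 (𝓡 3) X') (ι' : X' → 𝒟.carrier) (ν' : Literature.Geometry.Lorentzian.NormalField (𝓡 4) ι'), Manifold.IsSmoothEmbedding (𝓡 3) (𝓡 4) ((⊤ : ℕ∞) : WithTop ℕ∞) ι' → 𝒟.metric.IsFutureUnitNormal (𝓡 3) 𝒟.timeOrientation ι' ν' → (∀ y : X', Literature.Geometry.Lorentzian.pullbackBilin (I := 𝓡 4) (I' := 𝓡 3) ι' 𝒟.metric.val y = D'.h.inner y) → (∀ [𝒟.metric.toPseudoRiemannianMetric.HasLeviCivita] (y : X'), 𝒟.metric.toPseudoRiemannianMetric.secondFundamentalForm (𝓡 3) ι' ν' y = D'.kBilin y) → 𝒟.metric.IsCauchyHypersurface 𝒟.timeOrientation (Set.range ι') → Set.range ι' ⊆ 𝒟.metric.causalFuture 𝒟.timeOrientation (Set.range 𝒟.embed) → (letI : MeasurableSpace X' := borel X'; haveI : BorelSpace X' := ⟨rfl⟩; haveI : LocallyCompactSpace X' := ChartedSpace.locallyCompactSpace Literature.Geometry.Lorentzian.E3 X'; Literature.Geometry.Lorentzian.area D'.h (ι' ⁻¹' Literature.Geometry.Lorentzian.DataEmbedding.futureEventHorizon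 𝒟.toDataEmbedding)) ≤ a}; let Acc : Literature.Geometry.Lorentzian.InitialDataSet (𝓡 3) X → Prop := fun D ↦ ∃ (M A : ENNReal), M ≠ ⊤ ∧ (∀ e : Literature.Geometry.Lorentzian.AFEnd X, e.IsAsymptoticallyFlat D 1 → (∃ m, e.HasADMEnergy D m) → M ≤ ENNReal.ofReal (e.admMass D)) ∧ ∀ 𝒟 : Literature.Geometry.Lorentzian.VacuumCauchyDevelopment D, 𝒟.IsMaximal → ∀ [𝒟.metric.HasLeviCivita], MassF D 𝒟 = M ∧ AreaF D 𝒟 = A; let KerrB : Literature.Geometry.Lorentzian.InitialDataSet (𝓡 3) X → Prop := fun D ↦ ∀ 𝒟 : Literature.Geometry.Lorentzian.VacuumCauchyDevelopment D, 𝒟.IsMaximal → ∀ [𝒟.metric.HasLeviCivita], MassF D 𝒟 ≠ ⊤ ∧ kerrLo (MassF D 𝒟) < AreaF D 𝒟 ∧ AreaF D 𝒟 ≤ kerrHi (MassF D 𝒟); let HeavyB : Literature.Geometry.Lorentzian.InitialDataSet (𝓡 3) X → Prop := fun D ↦ ∀ 𝒟 : Literature.Geometry.Lorentzian.VacuumCauchyDevelopment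 D, 𝒟.IsMaximal → ∀ [𝒟.metric.HasLeviCivita], MassF D 𝒟 ≠ ⊤ ∧ AreaF D 𝒟 ≤ kerrLo (MassF D 𝒟); let Hor : Literature.Geometry.Lorentzian.InitialDataSet (𝓡 3) X → Prop := fun D ↦ ∃ (hLC : D.metric.HasLeviCivita) (e : Literature.Geometry.Lorentzian.AFEnd X) (S : Literature.Geometry.Lorentzian.OutermostMOTS (𝓡 3) D.h D.k), haveI : (Literature.Geometry.Lorentzian.PseudoRiemannianMetric.ofRiemannian D.h).HasLeviCivita := hLC; let IsExteriorRegion : TopologicalSpace.Opens X → Prop := fun U ↦ IsConnected (U : Set X) ∧ ∃ R', e.R < R' ∧ e.far R' ⊆ (U : Set X) ∧ IsCompact (closure (U : Set X) \ e.far R'); let IsOutsideOf : TopologicalSpace.Opens X → (S' : Type) → (f' : S' → X) → Literature.Geometry.Lorentzian.NormalField (𝓡 3) f' → Prop := fun U _ f' ν' ↦ frontier (U : Set X) = Set.range f' ∧ (∀ y, ∀ᶠ t in nhdsWithin (0 : ℝ) (Set.Ioi 0), Literature.Geometry.Lorentzian.curveThrough (𝓡 3) (f' y) (ν' y) t ∈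 (U : Set X)) ∧ (∀ y, ∀ᶠ t in nhdsWithin (0 : ℝ) (Set.Iio 0), Literature.Geometry.Lorentzian.curveThrough (𝓡 3) (f' y) (ν' y) t ∉ closure (U : Set X)) ∧ IsExteriorRegion U; let IsCalS : TopologicalSpace.Opens X → Prop := fun V ↦ ∃ (S' : Type) (_ : TopologicalSpace S') (_ : ChartedSpace (EuclideanSpace ℝ (Fin 2)) S') (_ : IsManifold (𝓡 2) ((⊤ : ℕ∞) : WithTop ℕ∞) S') (_ : CompactSpace S') (_ : T2Space S') (f' : S' → X) (ν' : Literature.Geometry.Lorentzian.NormalField (𝓡 3) f'), Manifold.IsSmoothEmbedding (𝓡 2) (𝓡 3) ((⊤ : ℕ∞) : WithTop ℕ∞) f' ∧ (Literature.Geometry.Lorentzian.PseudoRiemannianMetric.ofRiemannian D.h).IsUnitNormal (𝓡 2) f' ν' 1 ∧ IsOutsideOf V S' f' ν'; let WOTFree : TopologicalSpace.Opens X → Prop := fun U ↦ ∀ (S' : Type) [TopologicalSpace S'] [ChartedSpace (EuclideanSpace ℝ (Fin 2)) S'] [IsManifold (𝓡 2) ((⊤ : ℕ∞) : WithTop ℕ∞)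 S'] [CompactSpace S'] [T2Space S'] (f' : S' → X) (ν' : Literature.Geometry.Lorentzian.NormalField (𝓡 3) f') (hpb' : Literature.Geometry.Lorentzian.PseudoRiemannianMetric.contMDiff_pullbackBilin (𝓡 3) X (𝓡 2) S' ((⊤ : ℕ∞) : WithTop ℕ∞)) (hf' : (Literature.Geometry.Lorentzian.PseudoRiemannianMetric.ofRiemannian D.h).IsSpacelikeImmersion (𝓡 2) f') (Ω : TopologicalSpace.Opens X), Manifold.IsSmoothEmbedding (𝓡 2) (𝓡 3) ((⊤ : ℕ∞) : WithTop ℕ∞) f' → Set.range f' ⊆ (U : Set X) → (Literature.Geometry.Lorentzian.PseudoRiemannianMetric.ofRiemannian D.h).IsUnitNormal (𝓡 2) f' ν' 1 → Nonempty S' → frontier (Ω : Set X) = Set.range f' → (∃ R', e.R < R' ∧ Disjoint (e.far R') (Ω : Set X)) → (∀ y, ∀ᶠ t in nhdsWithin (0 : ℝ) (Set.Iio 0), Literature.Geometry.Lorentzian.curveThrough (𝓡 3) (f' y) (ν' y) t ∈ (Ω : Set X)) → ¬ Literature.Geometry.Lorentzian.IsWeaklyOuterTrapped D.h D.k f' hpb'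 hf' ν'; ContMDiff (𝓡 2) (𝓡 3).tangent ((⊤ : ℕ∞) : WithTop ℕ∞) (fun y ↦ (Bundle.TotalSpace.mk' Literature.Geometry.Lorentzian.E3 (S.f y) (S.ν y) : TangentBundle (𝓡 3) X)) ∧ D.SatisfiesDominantEnergyCondition ∧ e.IsAsymptoticallyFlat D 1 ∧ D.IsComplete ∧ (∃ m, e.HasADMEnergy D m) ∧ (∀ i, ∃ p, e.HasADMMomentum D i p) ∧ WOTFree S.exterior ∧ IsOutsideOf S.exterior S.surf S.f S.ν ∧ 0 < e.admMass D ∧ (letI : MeasurableSpace X := borel X; haveI : BorelSpace X := ⟨rfl⟩; haveI : LocallyCompactSpace X := ChartedSpace.locallyCompactSpace Literature.Geometry.Lorentzian.E3 X; (9 / 10 : ℝ) * e.admMass D ≤ Real.sqrt ((⨅ (V : TopologicalSpace.Opens X) (_ : IsCalS V ∧ V ≤ S.exterior), Literature.Geometry.Lorentzian.area D.h (frontier (V : Set X))).toReal / (16 * Real.pi))); ∀ d ∈ Literature.Geometry.Lorentzian.admissibleVacuumData X, ¬ P d → (((¬ Disp d ∧ Trap d ∧ Cens d ∧ ¬ Pw0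 d) ∧ Single d) ∧ CenFinF d) → (Acc d ∧ ¬ KerrB d ∧ HeavyB d ∧ ¬ Hor d) → ∃ (e : Literature.Geometry.Lorentzian.AFEnd X) (F : EuclideanSpace ℝ (Fin 1) → Literature.Geometry.Lorentzian.InitialDataSet (𝓡 3) X), Literature.Geometry.Lorentzian.InitialDataSet.IsTameDataFamily e 1 F ∧ Literature.Geometry.Lorentzian.InitialDataSet.IsImmersedAtZero 1 F ∧ F 0 = d ∧ Injective F ∧ (∀ c, F c ∈ Literature.Geometry.Lorentzian.admissibleVacuumData X) ∧ ∀ c ≠ 0, P (F c)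

/-- item stmt-FinalStateConjecture-28425 · crux · rank 5 · open · by planner
why it might fail: M_f ≥ √(A_f/16π) for the LIMITING Bondi mass is Penrose's stronger spacetime statement, proved only near Schwarzschild (Alexakis; Le) or under a quasi-final-state hypothesis (2026); a censored development whose horizon area outgrows 16πM_f² contradicts no theorem.
sources: arXiv:1506.06400, arXiv:2605.18730, arXiv:1609.02875, arXiv:2404.17137, arXiv:2505.11399
[crux · IDEA-NEEDED · leaf H of lens-5 g5 on stmt-27603] Same population with Acc ∧ AreaF >
16π·MassF² (the books ABOVE the Schwarzschild line: more final horizon area than any Kerr of the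
final Bondi mass can carry): exit tamely with codimension ≥ 1. Conjecturally EMPTY by the
LIMITING-BONDI-MASS (null, late-time) PENROSE INEQUALITY M_f ≥ √(A_f/16π) — Penrose's stronger
spacetime statement, in print only near Schwarzschild (Alexakis arXiv:1506.06400; Le
arXiv:2404.17137; Roesch arXiv:1609.02875) or under a quasi-final-state hypothesis
(arXiv:2605.18730); print-adjacent idea-leaf, PDE-light relative to K. -/
@[route_item "route-FinalStateConjecture-RootDecompFarLedgerCells", crux]
def LightChargeExit : Prop :=
  ∀ (X : Type) [TopologicalSpace X] [ChartedSpace Literature.Geometry.Lorentzian.E3 X] [IsManifold (𝓡 3) ((⊤ : ℕ∞) : WithTop ℕ∞) X] [T2Space X] [SecondCountableTopology X] [ConnectedSpace X], let P : Literature.Geometry.Lorentzian.InitialDataSet (𝓡 3) X → Prop := fun D ↦ (∃ 𝒟 : Literature.Geometry.Lorentzian.VacuumCauchyDevelopment D, 𝒟.IsMaximal) ∧ ∀ 𝒟 : Literature.Geometry.Lorentzian.VacuumCauchyDevelopment D, 𝒟.IsMaximal → Summit.FinalStateConjecture.HasCompleteNullInfinity 𝒟.toCauchyDevelopment ∧ ∃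 (O : Set 𝒟.carrier) (d : Literature.Geometry.Lorentzian.FinalStateDecomposition 𝒟.toSpacetime O 2), (∀ i, Literature.Geometry.Lorentzian.Kerr.IsSubextremal (d.mass i) (d.spin i)) ∧ O = Summit.FinalStateConjecture.exteriorOf 𝒟.toCauchyDevelopment d.charted ∧ Summit.FinalStateConjecture.RaysStayInClosure 𝒟.toCauchyDevelopment O ∧ Summit.FinalStateConjecture.HasExhaustiveCharts d ∧ Summit.FinalStateConjecture.IsFutureOriented d; let Pw0 : Literature.Geometry.Lorentzian.InitialDataSet (𝓡 3) X → Prop := fun D ↦ (∃ 𝒟 : Literature.Geometry.Lorentzian.VacuumCauchyDevelopment D, 𝒟.IsMaximal) ∧ ∀ 𝒟 : Literature.Geometry.Lorentzian.VacuumCauchyDevelopment D, 𝒟.IsMaximal → Summit.FinalStateConjecture.HasCompleteNullInfinity 𝒟.toCauchyDevelopment ∧ ∃ (O : Set 𝒟.carrier) (d : Literature.Geometry.Lorentzian.FinalStateDecomposition 𝒟.toSpacetime O 0), O = Summit.FinalStateConjecture.exteriorOf 𝒟.toCauchyDevelopment d.charted ∧ Summit.FinalStateConjecture.RaysStayInClosure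 𝒟.toCauchyDevelopment O ∧ Summit.FinalStateConjecture.HasExhaustiveCharts d ∧ Summit.FinalStateConjecture.IsFutureOriented d; let Disp : Literature.Geometry.Lorentzian.InitialDataSet (𝓡 3) X → Prop := fun D ↦ (∃ 𝒟 : Literature.Geometry.Lorentzian.VacuumCauchyDevelopment D, 𝒟.IsMaximal) ∧ ∀ 𝒟 : Literature.Geometry.Lorentzian.VacuumCauchyDevelopment D, 𝒟.IsMaximal → ∀ [𝒟.metric.HasLeviCivita], ¬ 𝒟.metric.IsFutureNullGeodesicallyIncomplete 𝒟.timeOrientation ∧ ¬ 𝒟.metric.IsFutureTimelikeGeodesicallyIncomplete 𝒟.timeOrientation; let Trap : Literature.Geometry.Lorentzian.InitialDataSet (𝓡 3) X → Prop := fun D ↦ (∃ 𝒟 : Literature.Geometry.Lorentzian.VacuumCauchyDevelopment D, 𝒟.IsMaximal) ∧ ∀ 𝒟 : Literature.Geometry.Lorentzian.VacuumCauchyDevelopment D, 𝒟.IsMaximal → ∀ [𝒟.metric.HasLeviCivita], ∃ f : Metric.sphere (0 : Literature.Geometry.Lorentzian.E3) 1 → 𝒟.carrier, Set.range f ⊆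 𝒟.metric.causalFuture 𝒟.timeOrientation (Set.range 𝒟.embed) ∧ 𝒟.metric.IsTrappedSurface (𝓡 2) 𝒟.timeOrientation f; let Cens : Literature.Geometry.Lorentzian.InitialDataSet (𝓡 3) X → Prop := fun D ↦ ∀ 𝒟 : Literature.Geometry.Lorentzian.VacuumCauchyDevelopment D, 𝒟.IsMaximal → Summit.FinalStateConjecture.HasCompleteNullInfinity 𝒟.toCauchyDevelopment; let Single : Literature.Geometry.Lorentzian.InitialDataSet (𝓡 3) X → Prop := fun D ↦ ∀ 𝒟 : Literature.Geometry.Lorentzian.VacuumCauchyDevelopment D, 𝒟.IsMaximal → ∀ [𝒟.metric.HasLeviCivita], Subsingleton (ConnectedComponents ↥(Literature.Geometry.Lorentzian.DataEmbedding.blackHoleRegion 𝒟.toDataEmbedding ∩ 𝒟.metric.causalFuture 𝒟.timeOrientation (Set.range 𝒟.embed))); let CenFinF : Literature.Geometry.Lorentzian.InitialDataSet (𝓡 3) X → Prop := fun D ↦ ∀ 𝒟 : Literature.Geometry.Lorentzian.VacuumCauchyDevelopment D, 𝒟.IsMaximal → ∃ n : ℕ, ∀ (X' : Type) [TopologicalSpace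 X'] [ChartedSpace Literature.Geometry.Lorentzian.E3 X'] [IsManifold (𝓡 3) ((⊤ : ℕ∞) : WithTop ℕ∞) X'] [ConnectedSpace X'] (D' : Literature.Geometry.Lorentzian.InitialDataSet (𝓡 3) X') (ι' : X' → 𝒟.carrier) (ν' : Literature.Geometry.Lorentzian.NormalField (𝓡 4) ι'), Manifold.IsSmoothEmbedding (𝓡 3) (𝓡 4) ((⊤ : ℕ∞) : WithTop ℕ∞) ι' → 𝒟.metric.IsFutureUnitNormal (𝓡 3) 𝒟.timeOrientation ι' ν' → (∀ y : X', Literature.Geometry.Lorentzian.pullbackBilin (I := 𝓡 4) (I' := 𝓡 3) ι' 𝒟.metric.val y = D'.h.inner y) → (∀ [𝒟.metric.toPseudoRiemannianMetric.HasLeviCivita] (y : X'), 𝒟.metric.toPseudoRiemannianMetric.secondFundamentalForm (𝓡 3) ι' ν' y = D'.kBilin y) → 𝒟.metric.IsCauchyHypersurface 𝒟.timeOrientation (Set.range ι') → Set.range ι' ⊆ 𝒟.metric.causalFuture 𝒟.timeOrientation (Set.range 𝒟.embed) → ∀ S : Fin (n + 1) → Literature.Geometry.Lorentzian.OutermostMOTS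 (𝓡 3) D'.h D'.k, (∀ j, ConnectedSpace (S j).surf) → (∀ j, IsCompact (((S j).exterior : Set X'))ᶜ ∧ (interior (((S j).exterior : Set X'))ᶜ).Nonempty) → ∃ j j', j ≠ j' ∧ ((((S j).exterior : Set X'))ᶜ ∩ (((S j').exterior : Set X'))ᶜ).Nonempty; let kerrLo : ENNReal → ENNReal := fun M ↦ ENNReal.ofReal (8 * Real.pi) * M ^ 2; let kerrHi : ENNReal → ENNReal := fun M ↦ ENNReal.ofReal (16 * Real.pi) * M ^ 2; let MassF : (D : Literature.Geometry.Lorentzian.InitialDataSet (𝓡 3) X) → Literature.Geometry.Lorentzian.VacuumCauchyDevelopment D → ENNReal := fun D 𝒟 ↦ ⨅ (K : Set 𝒟.carrier) (_ : IsCompact K) (m : ℝ) (_ : 𝒟.toCauchyDevelopment.HasCutBondiMass K m), ENNReal.ofReal m; let AreaF : (D : Literature.Geometry.Lorentzian.InitialDataSet (𝓡 3) X) → (𝒟 : Literature.Geometry.Lorentzian.VacuumCauchyDevelopment D) → [𝒟.metric.HasLeviCivita] → ENNReal := fun D 𝒟 hLC ↦ sInf {a : ENNReal | ∀ (X' : Type)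 [TopologicalSpace X'] [ChartedSpace Literature.Geometry.Lorentzian.E3 X'] [IsManifold (𝓡 3) ((⊤ : ℕ∞) : WithTop ℕ∞) X'] [ConnectedSpace X'] [T2Space X'] (D' : Literature.Geometry.Lorentzian.InitialDataSet (𝓡 3) X') (ι' : X' → 𝒟.carrier) (ν' : Literature.Geometry.Lorentzian.NormalField (𝓡 4) ι'), Manifold.IsSmoothEmbedding (𝓡 3) (𝓡 4) ((⊤ : ℕ∞) : WithTop ℕ∞) ι' → 𝒟.metric.IsFutureUnitNormal (𝓡 3) 𝒟.timeOrientation ι' ν' → (∀ y : X', Literature.Geometry.Lorentzian.pullbackBilin (I := 𝓡 4) (I' := 𝓡 3) ι' 𝒟.metric.val y = D'.h.inner y) → (∀ [𝒟.metric.toPseudoRiemannianMetric.HasLeviCivita] (y : X'), 𝒟.metric.toPseudoRiemannianMetric.secondFundamentalForm (𝓡 3) ι' ν' y = D'.kBilin y) → 𝒟.metric.IsCauchyHypersurface 𝒟.timeOrientation (Set.range ι') → Set.range ι' ⊆ 𝒟.metric.causalFuture 𝒟.timeOrientation (Set.range 𝒟.embed) → (letI : MeasurableSpace X' := borel X'; haveI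 : BorelSpace X' := ⟨rfl⟩; haveI : LocallyCompactSpace X' := ChartedSpace.locallyCompactSpace Literature.Geometry.Lorentzian.E3 X'; Literature.Geometry.Lorentzian.area D'.h (ι' ⁻¹' Literature.Geometry.Lorentzian.DataEmbedding.futureEventHorizon 𝒟.toDataEmbedding)) ≤ a}; let Acc : Literature.Geometry.Lorentzian.InitialDataSet (𝓡 3) X → Prop := fun D ↦ ∃ (M A : ENNReal), M ≠ ⊤ ∧ (∀ e : Literature.Geometry.Lorentzian.AFEnd X, e.IsAsymptoticallyFlat D 1 → (∃ m, e.HasADMEnergy D m) → M ≤ ENNReal.ofReal (e.admMass D)) ∧ ∀ 𝒟 : Literature.Geometry.Lorentzian.VacuumCauchyDevelopment D, 𝒟.IsMaximal → ∀ [𝒟.metric.HasLeviCivita], MassF D 𝒟 = M ∧ AreaF D 𝒟 = A; let KerrB : Literature.Geometry.Lorentzian.InitialDataSet (𝓡 3) X → Prop := fun D ↦ ∀ 𝒟 : Literature.Geometry.Lorentzian.VacuumCauchyDevelopment D, 𝒟.IsMaximal → ∀ [𝒟.metric.HasLeviCivita], MassF D 𝒟 ≠ ⊤ ∧ kerrLo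 (MassF D 𝒟) < AreaF D 𝒟 ∧ AreaF D 𝒟 ≤ kerrHi (MassF D 𝒟); let HeavyB : Literature.Geometry.Lorentzian.InitialDataSet (𝓡 3) X → Prop := fun D ↦ ∀ 𝒟 : Literature.Geometry.Lorentzian.VacuumCauchyDevelopment D, 𝒟.IsMaximal → ∀ [𝒟.metric.HasLeviCivita], MassF D 𝒟 ≠ ⊤ ∧ AreaF D 𝒟 ≤ kerrLo (MassF D 𝒟); ∀ d ∈ Literature.Geometry.Lorentzian.admissibleVacuumData X, ¬ P d → (((¬ Disp d ∧ Trap d ∧ Cens d ∧ ¬ Pw0 d) ∧ Single d) ∧ CenFinF d) → (Acc d ∧ ¬ KerrB d ∧ ¬ HeavyB d) → ∃ (e : Literature.Geometry.Lorentzian.AFEnd X) (F : EuclideanSpace ℝ (Fin 1) → Literature.Geometry.Lorentzian.InitialDataSet (𝓡 3) X), Literature.Geometry.Lorentzian.InitialDataSet.IsTameDataFamily e 1 F ∧ Literature.Geometry.Lorentzian.InitialDataSet.IsImmersedAtZero 1 F ∧ F 0 = d ∧ Injective F ∧ (∀ c, F c ∈ Literature.Geometry.Lorentzian.admissibleVacuumData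 X) ∧ ∀ c ≠ 0, P (F c)

/-- item stmt-FinalStateConjecture-26646 · crux · rank 6 · open · by planner
why it might fail: A tame-open set of admissible data whose MGHD keeps two holes on an eternal quasi-periodic censored orbit (a vacuum 'floating' binary), or n ≥ 3 co-axial multi-Kerr(–NUT) equilibria that exist AND are attained from an open set, would refute it; n ≥ 3 non-existence is open (CCH12 p.14).
sources: doi:10.1007/BF00770326, arXiv:0905.4179, arXiv:1103.5248, arXiv:1105.5830, arXiv:1111.1448, arXiv:0811.1727
[crux · child 𝓣₂² of TrappedCaptureExit · SPECIAL-TYPE (configurational) · INSTRUMENTABLE; CLEARED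
by decomp-fsc-crit-1-g0 2026-08-30T03:23:32Z (k = 3 chosen); writer glue/exactness
folder/n2bg3/Sketch.lean rc 0 / 0 sorry.] For every Σ and every admissible P_Σ-exceptional datum d
of the capture cell 𝓣₂ (not of dispersive type; every MGHD contains a closed trapped sphere in the
causal future of the data; every MGHD has complete future null infinity; d fails the weak C⁰
property P_w⁰) SOME of whose MGHDs ends with AT LEAST TWO black holes (𝓑⁺ not preconnected) and ALL
of whose MGHDs end with FINITELY MANY (Finite (ConnectedComponents ↥𝓑⁺)), there are one end e and a
tame (order 1 at e), immersed-at-0, injective one-parameter family F of admissible data with F 0 = d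
all of whose members c ≠ 0 satisfy P_Σ. Content = the generic MANY-BODY sector of the capture
problem: (i) no eternal non-merging bound binary with censored exterior (radiative dissipation),
(ii) no stationary n-horizon vacuum equilibrium to park at (static: Bunting–Masood-ul-Alam 1987,
Beig–Gibbons–Schoen 2009; n = 2 stationary: Neugebauer–Hennig + Chruściel et al., CCH12 Thm 3.6; n ≥
3 widely open), (iii) capture of each -/
@[route_item "route-FinalStateConjecture-RootDecompFarLedgerCells", crux]
def MultiHoleCaptureExit : Prop :=
  ∀ (X : Type) [TopologicalSpace X] [ChartedSpace Literature.Geometry.Lorentzian.E3 X] [IsManifold (𝓡 3) ((⊤ : ℕ∞) : WithTop ℕ∞) X] [T2Space X] [SecondCountableTopology X] [ConnectedSpace X], let P : Literature.Geometry.Lorentzian.InitialDataSet (𝓡 3) X → Prop := fun D ↦ (∃ 𝒟 : Literature.Geometry.Lorentzian.VacuumCauchyDevelopment D, 𝒟.IsMaximal) ∧ ∀ 𝒟 : Literature.Geometry.Lorentzian.VacuumCauchyDevelopment D, 𝒟.IsMaximal → Summit.FinalStateConjecture.HasCompleteNullInfinity 𝒟.toCauchyDevelopment ∧ ∃ (O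 : Set 𝒟.carrier) (d : Literature.Geometry.Lorentzian.FinalStateDecomposition 𝒟.toSpacetime O 2), (∀ i, Literature.Geometry.Lorentzian.Kerr.IsSubextremal (d.mass i) (d.spin i)) ∧ O = Summit.FinalStateConjecture.exteriorOf 𝒟.toCauchyDevelopment d.charted ∧ Summit.FinalStateConjecture.RaysStayInClosure 𝒟.toCauchyDevelopment O ∧ Summit.FinalStateConjecture.HasExhaustiveCharts d ∧ Summit.FinalStateConjecture.IsFutureOriented d; let Pw0 : Literature.Geometry.Lorentzian.InitialDataSet (𝓡 3) X → Prop := fun D ↦ (∃ 𝒟 : Literature.Geometry.Lorentzian.VacuumCauchyDevelopment D, 𝒟.IsMaximal) ∧ ∀ 𝒟 : Literature.Geometry.Lorentzian.VacuumCauchyDevelopment D, 𝒟.IsMaximal → Summit.FinalStateConjecture.HasCompleteNullInfinity 𝒟.toCauchyDevelopment ∧ ∃ (O : Set 𝒟.carrier) (d : Literature.Geometry.Lorentzian.FinalStateDecomposition 𝒟.toSpacetime O 0), O = Summit.FinalStateConjecture.exteriorOf 𝒟.toCauchyDevelopment d.charted ∧ Summit.FinalStateConjecture.RaysStayInClosure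 𝒟.toCauchyDevelopment O ∧ Summit.FinalStateConjecture.HasExhaustiveCharts d ∧ Summit.FinalStateConjecture.IsFutureOriented d; let Disp : Literature.Geometry.Lorentzian.InitialDataSet (𝓡 3) X → Prop := fun D ↦ (∃ 𝒟 : Literature.Geometry.Lorentzian.VacuumCauchyDevelopment D, 𝒟.IsMaximal) ∧ ∀ 𝒟 : Literature.Geometry.Lorentzian.VacuumCauchyDevelopment D, 𝒟.IsMaximal → ∀ [𝒟.metric.HasLeviCivita], ¬ 𝒟.metric.IsFutureNullGeodesicallyIncomplete 𝒟.timeOrientation ∧ ¬ 𝒟.metric.IsFutureTimelikeGeodesicallyIncomplete 𝒟.timeOrientation; let Trap : Literature.Geometry.Lorentzian.InitialDataSet (𝓡 3) X → Prop := fun D ↦ (∃ 𝒟 : Literature.Geometry.Lorentzian.VacuumCauchyDevelopment D, 𝒟.IsMaximal) ∧ ∀ 𝒟 : Literature.Geometry.Lorentzian.VacuumCauchyDevelopment D, 𝒟.IsMaximal → ∀ [𝒟.metric.HasLeviCivita], ∃ f : Metric.sphere (0 : Literature.Geometry.Lorentzian.E3) 1 → 𝒟.carrier, Set.range f ⊆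 𝒟.metric.causalFuture 𝒟.timeOrientation (Set.range 𝒟.embed) ∧ 𝒟.metric.IsTrappedSurface (𝓡 2) 𝒟.timeOrientation f; let Cens : Literature.Geometry.Lorentzian.InitialDataSet (𝓡 3) X → Prop := fun D ↦ ∀ 𝒟 : Literature.Geometry.Lorentzian.VacuumCauchyDevelopment D, 𝒟.IsMaximal → Summit.FinalStateConjecture.HasCompleteNullInfinity 𝒟.toCauchyDevelopment; let Single : Literature.Geometry.Lorentzian.InitialDataSet (𝓡 3) X → Prop := fun D ↦ ∀ 𝒟 : Literature.Geometry.Lorentzian.VacuumCauchyDevelopment D, 𝒟.IsMaximal → ∀ [𝒟.metric.HasLeviCivita], Subsingleton (ConnectedComponents ↥(Literature.Geometry.Lorentzian.DataEmbedding.blackHoleRegion 𝒟.toDataEmbedding ∩ 𝒟.metric.causalFuture 𝒟.timeOrientation (Set.range 𝒟.embed))); let FinMany : Literature.Geometry.Lorentzian.InitialDataSet (𝓡 3) X → Prop := fun D ↦ ∀ 𝒟 : Literature.Geometry.Lorentzian.VacuumCauchyDevelopment D, 𝒟.IsMaximal → ∀ [𝒟.metric.HasLeviCivita], Finite (ConnectedComponents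 ↥(Literature.Geometry.Lorentzian.DataEmbedding.blackHoleRegion 𝒟.toDataEmbedding ∩ 𝒟.metric.causalFuture 𝒟.timeOrientation (Set.range 𝒟.embed))); ∀ d ∈ Literature.Geometry.Lorentzian.admissibleVacuumData X, ¬ P d → ((¬ Disp d ∧ Trap d ∧ Cens d ∧ ¬ Pw0 d) ∧ ¬ Single d ∧ FinMany d) → ∃ (e : Literature.Geometry.Lorentzian.AFEnd X) (F : EuclideanSpace ℝ (Fin 1) → Literature.Geometry.Lorentzian.InitialDataSet (𝓡 3) X), Literature.Geometry.Lorentzian.InitialDataSet.IsTameDataFamily e 1 F ∧ Literature.Geometry.Lorentzian.InitialDataSet.IsImmersedAtZero 1 F ∧ F 0 = d ∧ Injective F ∧ (∀ c, F c ∈ Literature.Geometry.Lorentzian.admissibleVacuumData X) ∧ ∀ c ≠ 0, P (F c)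

/-- item stmt-FinalStateConjecture-26647 · crux · rank 7 · open · by planner
why it might fail: Late-time tails refocusing through an already formed hole's strong field (caustics near photon spheres) could keep forming ever smaller holes at ever later times on a tame-open set; no statement either way is in print (arXiv:2210.13960 p.6).
sources: arXiv:0805.3880, arXiv:1409.6270, Christodoulou1999, arXiv:0811.0354, arXiv:2210.13960, HawkingEllis1973
[crux · child 𝓣₂^∞ of TrappedCaptureExit · thin · conjecturally EMPTY · IDEA-NEEDED; CLEARED by
decomp-fsc-crit-1-g0 2026-08-30T03:23:32Z (k = 3 chosen); writer glue/exactness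
folder/n2bg3/Sketch.lean rc 0 / 0 sorry.] For every Σ and every admissible P_Σ-exceptional datum d
of the capture cell 𝓣₂ (not of dispersive type; every MGHD contains a closed trapped sphere in the
causal future of the data; every MGHD has complete future null infinity; d fails the weak C⁰
property P_w⁰) SOME of whose MGHDs ends with INFINITELY MANY black holes (¬ Finite
(ConnectedComponents ↥𝓑⁺)), there are one end e and a tame (order 1 at e), immersed-at-0, injective
one-parameter family F of admissible data with F 0 = d all of whose members c ≠ 0 satisfy P_Σ. It
isolates the clause «N : ℕ» (finitely many hole charts) of FinalStateDecomposition inside the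
censored trapped basin. Kill path: a quantitative converse of trapped-surface formation (no closed
trapped surface in a region uniformly C¹-close to Minkowski) + late-time decay of the exterior field
⟹ no hole forms after some slab ⟹ finitely many components; classical vacuum has no mass gap
(Christodoulou short pulse arXiv:0805.3880, An–Luk arXiv:1409.627 -/
@[route_item "route-FinalStateConjecture-RootDecompFarLedgerCells", crux]
def InfiniteHoleCaptureExit : Prop :=
  ∀ (X : Type) [TopologicalSpace X] [ChartedSpace Literature.Geometry.Lorentzian.E3 X] [IsManifold (𝓡 3) ((⊤ : ℕ∞) : WithTop ℕ∞) X] [T2Space X] [SecondCountableTopology X] [ConnectedSpace X], let P : Literature.Geometry.Lorentzian.InitialDataSet (𝓡 3) X → Prop := fun D ↦ (∃ 𝒟 : Literature.Geometry.Lorentzian.VacuumCauchyDevelopment D, 𝒟.IsMaximal) ∧ ∀ 𝒟 : Literature.Geometry.Lorentzian.VacuumCauchyDevelopment D, 𝒟.IsMaximal → Summit.FinalStateConjecture.HasCompleteNullInfinity 𝒟.toCauchyDevelopment ∧ ∃ (O : Set 𝒟.carrier) (d : Literature.Geometry.Lorentzian.FinalStateDecomposition 𝒟.toSpacetime O 2),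 (∀ i, Literature.Geometry.Lorentzian.Kerr.IsSubextremal (d.mass i) (d.spin i)) ∧ O = Summit.FinalStateConjecture.exteriorOf 𝒟.toCauchyDevelopment d.charted ∧ Summit.FinalStateConjecture.RaysStayInClosure 𝒟.toCauchyDevelopment O ∧ Summit.FinalStateConjecture.HasExhaustiveCharts d ∧ Summit.FinalStateConjecture.IsFutureOriented d; let Pw0 : Literature.Geometry.Lorentzian.InitialDataSet (𝓡 3) X → Prop := fun D ↦ (∃ 𝒟 : Literature.Geometry.Lorentzian.VacuumCauchyDevelopment D, 𝒟.IsMaximal) ∧ ∀ 𝒟 : Literature.Geometry.Lorentzian.VacuumCauchyDevelopment D, 𝒟.IsMaximal → Summit.FinalStateConjecture.HasCompleteNullInfinity 𝒟.toCauchyDevelopment ∧ ∃ (O : Set 𝒟.carrier) (d : Literature.Geometry.Lorentzian.FinalStateDecomposition 𝒟.toSpacetime O 0), O = Summit.FinalStateConjecture.exteriorOf 𝒟.toCauchyDevelopment d.charted ∧ Summit.FinalStateConjecture.RaysStayInClosure 𝒟.toCauchyDevelopment O ∧ Summit.FinalStateConjecture.HasExhaustiveCharts d ∧ Summit.FinalStateConjecture.IsFutureOriented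 d; let Disp : Literature.Geometry.Lorentzian.InitialDataSet (𝓡 3) X → Prop := fun D ↦ (∃ 𝒟 : Literature.Geometry.Lorentzian.VacuumCauchyDevelopment D, 𝒟.IsMaximal) ∧ ∀ 𝒟 : Literature.Geometry.Lorentzian.VacuumCauchyDevelopment D, 𝒟.IsMaximal → ∀ [𝒟.metric.HasLeviCivita], ¬ 𝒟.metric.IsFutureNullGeodesicallyIncomplete 𝒟.timeOrientation ∧ ¬ 𝒟.metric.IsFutureTimelikeGeodesicallyIncomplete 𝒟.timeOrientation; let Trap : Literature.Geometry.Lorentzian.InitialDataSet (𝓡 3) X → Prop := fun D ↦ (∃ 𝒟 : Literature.Geometry.Lorentzian.VacuumCauchyDevelopment D, 𝒟.IsMaximal) ∧ ∀ 𝒟 : Literature.Geometry.Lorentzian.VacuumCauchyDevelopment D, 𝒟.IsMaximal → ∀ [𝒟.metric.HasLeviCivita], ∃ f : Metric.sphere (0 : Literature.Geometry.Lorentzian.E3) 1 → 𝒟.carrier, Set.range f ⊆ 𝒟.metric.causalFuture 𝒟.timeOrientation (Set.range 𝒟.embed) ∧ 𝒟.metric.IsTrappedSurface (𝓡 2) 𝒟.timeOrientation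 f; let Cens : Literature.Geometry.Lorentzian.InitialDataSet (𝓡 3) X → Prop := fun D ↦ ∀ 𝒟 : Literature.Geometry.Lorentzian.VacuumCauchyDevelopment D, 𝒟.IsMaximal → Summit.FinalStateConjecture.HasCompleteNullInfinity 𝒟.toCauchyDevelopment; let FinMany : Literature.Geometry.Lorentzian.InitialDataSet (𝓡 3) X → Prop := fun D ↦ ∀ 𝒟 : Literature.Geometry.Lorentzian.VacuumCauchyDevelopment D, 𝒟.IsMaximal → ∀ [𝒟.metric.HasLeviCivita], Finite (ConnectedComponents ↥(Literature.Geometry.Lorentzian.DataEmbedding.blackHoleRegion 𝒟.toDataEmbedding ∩ 𝒟.metric.causalFuture 𝒟.timeOrientation (Set.range 𝒟.embed))); ∀ d ∈ Literature.Geometry.Lorentzian.admissibleVacuumData X, ¬ P d → ((¬ Disp d ∧ Trap d ∧ Cens d ∧ ¬ Pw0 d) ∧ ¬ FinMany d) → ∃ (e : Literature.Geometry.Lorentzian.AFEnd X) (F : EuclideanSpace ℝ (Fin 1) → Literature.Geometry.Lorentzian.InitialDataSet (𝓡 3) X), Literature.Geometry.Lorentzian.InitialDataSet.IsTameDataFamily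 e 1 F ∧ Literature.Geometry.Lorentzian.InitialDataSet.IsImmersedAtZero 1 F ∧ F 0 = d ∧ Injective F ∧ (∀ c, F c ∈ Literature.Geometry.Lorentzian.admissibleVacuumData X) ∧ ∀ c ≠ 0, P (F c)

/-- item stmt-FinalStateConjecture-28423 · crux (kind.auto-crux: conjecture-grade) · rank 9 · open · by planner
why it might fail: Empty only modulo HorizonAreaBridge: should the outermost trapped region of some censored MGHD be visible from 𝓘⁺ in the sojourn formalism (HE 9.2.8 / Wald 12.2.4 porting fails without future causal simplicity) or A_min exceed the Lipschitz horizon-cut area, heavy books could coexist with Hor.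
sources: HawkingEllis1973 §9.2, Wald1984 §12.2, arXiv:2605.18730 p.3, ChruscielEtAl2001 §3-4, decomp-fsc-lens-5/g5/FinalChargeCells.lean:heavyChargeDoor_of_bridge, stmt-FinalStateConjecture-26560
[support · THIN · EMPTY BY BRIDGE · door Dr of lens-5 g5 on stmt-27603] Same population with Acc ∧
¬KerrB ∧ HeavyB (AreaF ≤ 8π·MassF²) ∧ Hor (lens-1 horizon let of stmt-26560 verbatim: an honest
outermost future horizon with A_min ≥ 16π(0.81)m²): exit tamely with codimension ≥ 1. Conjecturally
EMPTY: lens kernel theorem heavyChargeDoor_of_bridge : HorizonAreaBridge → HeavyChargeDoor (rc 0,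
axioms std) by the chain 16π(0.81)m² ≤ A_min ≤ A_f ≤ 8πM_f² ≤ 8πm², 12.96 > 8 — pure arithmetic once
the PDE-free bridge HorizonAreaBridge (A_min ≤ AreaF: invisibility of the outermost trapped body
from the complete-ray region, HawkingEllis1973 Prop. 9.2.8 / Wald1984 Props. 12.2.2–12.2.4; far AF
region visible; Lipschitz GMT enclosure comparison ChruscielEtAl2001 §3–4) is ported; the bridge
does not fit this route's item cap and is queued as porting request D5 «HorizonAreaBridge»
(statement = lens one-liner verbatim; facts F1–F3) — REGISTERED KILL PATH: a prover lands
«HorizonAreaBridge → HeavyChargeDoor» verbatim from decomp-fsc-lens-5/g5/FinalChargeCells.lean with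
--supports this item. Independently dominated by stmt-26560 HorizonDominatedResidual by restriction
(same exit currency; informs len -/
@[route_item "route-FinalStateConjecture-RootDecompFarLedgerCells", crux]
def HeavyChargeDoor : Prop :=
  ∀ (X : Type) [TopologicalSpace X] [ChartedSpace Literature.Geometry.Lorentzian.E3 X] [IsManifold (𝓡 3) ((⊤ : ℕ∞) : WithTop ℕ∞) X] [T2Space X] [SecondCountableTopology X] [ConnectedSpace X], let P : Literature.Geometry.Lorentzian.InitialDataSet (𝓡 3) X → Prop := fun D ↦ (∃ 𝒟 : Literature.Geometry.Lorentzian.VacuumCauchyDevelopment D, 𝒟.IsMaximal) ∧ ∀ 𝒟 : Literature.Geometry.Lorentzian.VacuumCauchyDevelopment D, 𝒟.IsMaximal → Summit.FinalStateConjecture.HasCompleteNullInfinity 𝒟.toCauchyDevelopment ∧ ∃ (O : Set 𝒟.carrier) (d : Literature.Geometry.Lorentzian.FinalStateDecomposition 𝒟.toSpacetime O 2), (∀ i, Literature.Geometry.Lorentzian.Kerr.IsSubextremal (d.mass i) (d.spin i)) ∧ O = Summit.FinalStateConjecture.exteriorOf 𝒟.toCauchyDevelopment d.charted ∧ Summit.FinalStateConjecture.RaysStayInClosure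 𝒟.toCauchyDevelopment O ∧ Summit.FinalStateConjecture.HasExhaustiveCharts d ∧ Summit.FinalStateConjecture.IsFutureOriented d; let Pw0 : Literature.Geometry.Lorentzian.InitialDataSet (𝓡 3) X → Prop := fun D ↦ (∃ 𝒟 : Literature.Geometry.Lorentzian.VacuumCauchyDevelopment D, 𝒟.IsMaximal) ∧ ∀ 𝒟 : Literature.Geometry.Lorentzian.VacuumCauchyDevelopment D, 𝒟.IsMaximal → Summit.FinalStateConjecture.HasCompleteNullInfinity 𝒟.toCauchyDevelopment ∧ ∃ (O : Set 𝒟.carrier) (d : Literature.Geometry.Lorentzian.FinalStateDecomposition 𝒟.toSpacetime O 0), O = Summit.FinalStateConjecture.exteriorOf 𝒟.toCauchyDevelopment d.charted ∧ Summit.FinalStateConjecture.RaysStayInClosure 𝒟.toCauchyDevelopment O ∧ Summit.FinalStateConjecture.HasExhaustiveCharts d ∧ Summit.FinalStateConjecture.IsFutureOriented d; let Disp : Literature.Geometry.Lorentzian.InitialDataSet (𝓡 3) X → Prop := fun D ↦ (∃ 𝒟 : Literature.Geometry.Lorentzian.VacuumCauchyDevelopment D, 𝒟.IsMaximal) ∧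 ∀ 𝒟 : Literature.Geometry.Lorentzian.VacuumCauchyDevelopment D, 𝒟.IsMaximal → ∀ [𝒟.metric.HasLeviCivita], ¬ 𝒟.metric.IsFutureNullGeodesicallyIncomplete 𝒟.timeOrientation ∧ ¬ 𝒟.metric.IsFutureTimelikeGeodesicallyIncomplete 𝒟.timeOrientation; let Trap : Literature.Geometry.Lorentzian.InitialDataSet (𝓡 3) X → Prop := fun D ↦ (∃ 𝒟 : Literature.Geometry.Lorentzian.VacuumCauchyDevelopment D, 𝒟.IsMaximal) ∧ ∀ 𝒟 : Literature.Geometry.Lorentzian.VacuumCauchyDevelopment D, 𝒟.IsMaximal → ∀ [𝒟.metric.HasLeviCivita], ∃ f : Metric.sphere (0 : Literature.Geometry.Lorentzian.E3) 1 → 𝒟.carrier, Set.range f ⊆ 𝒟.metric.causalFuture 𝒟.timeOrientation (Set.range 𝒟.embed) ∧ 𝒟.metric.IsTrappedSurface (𝓡 2) 𝒟.timeOrientation f; let Cens : Literature.Geometry.Lorentzian.InitialDataSet (𝓡 3) X → Prop := fun D ↦ ∀ 𝒟 : Literature.Geometry.Lorentzian.VacuumCauchyDevelopment D, 𝒟.IsMaximal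 → Summit.FinalStateConjecture.HasCompleteNullInfinity 𝒟.toCauchyDevelopment; let Single : Literature.Geometry.Lorentzian.InitialDataSet (𝓡 3) X → Prop := fun D ↦ ∀ 𝒟 : Literature.Geometry.Lorentzian.VacuumCauchyDevelopment D, 𝒟.IsMaximal → ∀ [𝒟.metric.HasLeviCivita], Subsingleton (ConnectedComponents ↥(Literature.Geometry.Lorentzian.DataEmbedding.blackHoleRegion 𝒟.toDataEmbedding ∩ 𝒟.metric.causalFuture 𝒟.timeOrientation (Set.range 𝒟.embed))); let CenFinF : Literature.Geometry.Lorentzian.InitialDataSet (𝓡 3) X → Prop := fun D ↦ ∀ 𝒟 : Literature.Geometry.Lorentzian.VacuumCauchyDevelopment D, 𝒟.IsMaximal → ∃ n : ℕ, ∀ (X' : Type) [TopologicalSpace X'] [ChartedSpace Literature.Geometry.Lorentzian.E3 X'] [IsManifold (𝓡 3) ((⊤ : ℕ∞) : WithTop ℕ∞) X'] [ConnectedSpace X'] (D' : Literature.Geometry.Lorentzian.InitialDataSet (𝓡 3) X') (ι' : X' → 𝒟.carrier) (ν' : Literature.Geometry.Lorentzian.NormalField (𝓡 4) ι'), Manifold.IsSmoothEmbedding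 (𝓡 3) (𝓡 4) ((⊤ : ℕ∞) : WithTop ℕ∞) ι' → 𝒟.metric.IsFutureUnitNormal (𝓡 3) 𝒟.timeOrientation ι' ν' → (∀ y : X', Literature.Geometry.Lorentzian.pullbackBilin (I := 𝓡 4) (I' := 𝓡 3) ι' 𝒟.metric.val y = D'.h.inner y) → (∀ [𝒟.metric.toPseudoRiemannianMetric.HasLeviCivita] (y : X'), 𝒟.metric.toPseudoRiemannianMetric.secondFundamentalForm (𝓡 3) ι' ν' y = D'.kBilin y) → 𝒟.metric.IsCauchyHypersurface 𝒟.timeOrientation (Set.range ι') → Set.range ι' ⊆ 𝒟.metric.causalFuture 𝒟.timeOrientation (Set.range 𝒟.embed) → ∀ S : Fin (n + 1) → Literature.Geometry.Lorentzian.OutermostMOTS (𝓡 3) D'.h D'.k, (∀ j, ConnectedSpace (S j).surf) → (∀ j, IsCompact (((S j).exterior : Set X'))ᶜ ∧ (interior (((S j).exterior : Set X'))ᶜ).Nonempty) → ∃ j j', j ≠ j' ∧ ((((S j).exterior : Set X'))ᶜ ∩ (((S j').exterior : Set X'))ᶜ).Nonempty; let kerrLo : ENNReal → ENNReal := fun M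 ↦ ENNReal.ofReal (8 * Real.pi) * M ^ 2; let kerrHi : ENNReal → ENNReal := fun M ↦ ENNReal.ofReal (16 * Real.pi) * M ^ 2; let MassF : (D : Literature.Geometry.Lorentzian.InitialDataSet (𝓡 3) X) → Literature.Geometry.Lorentzian.VacuumCauchyDevelopment D → ENNReal := fun D 𝒟 ↦ ⨅ (K : Set 𝒟.carrier) (_ : IsCompact K) (m : ℝ) (_ : 𝒟.toCauchyDevelopment.HasCutBondiMass K m), ENNReal.ofReal m; let AreaF : (D : Literature.Geometry.Lorentzian.InitialDataSet (𝓡 3) X) → (𝒟 : Literature.Geometry.Lorentzian.VacuumCauchyDevelopment D) → [𝒟.metric.HasLeviCivita] → ENNReal := fun D 𝒟 hLC ↦ sInf {a : ENNReal | ∀ (X' : Type) [TopologicalSpace X'] [ChartedSpace Literature.Geometry.Lorentzian.E3 X'] [IsManifold (𝓡 3) ((⊤ : ℕ∞) : WithTop ℕ∞) X'] [ConnectedSpace X'] [T2Space X'] (D' : Literature.Geometry.Lorentzian.InitialDataSet (𝓡 3) X') (ι' : X' → 𝒟.carrier) (ν' : Literature.Geometry.Lorentzian.NormalField (𝓡 4)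 ι'), Manifold.IsSmoothEmbedding (𝓡 3) (𝓡 4) ((⊤ : ℕ∞) : WithTop ℕ∞) ι' → 𝒟.metric.IsFutureUnitNormal (𝓡 3) 𝒟.timeOrientation ι' ν' → (∀ y : X', Literature.Geometry.Lorentzian.pullbackBilin (I := 𝓡 4) (I' := 𝓡 3) ι' 𝒟.metric.val y = D'.h.inner y) → (∀ [𝒟.metric.toPseudoRiemannianMetric.HasLeviCivita] (y : X'), 𝒟.metric.toPseudoRiemannianMetric.secondFundamentalForm (𝓡 3) ι' ν' y = D'.kBilin y) → 𝒟.metric.IsCauchyHypersurface 𝒟.timeOrientation (Set.range ι') → Set.range ι' ⊆ 𝒟.metric.causalFuture 𝒟.timeOrientation (Set.range 𝒟.embed) → (letI : MeasurableSpace X' := borel X'; haveI : BorelSpace X' := ⟨rfl⟩; haveI : LocallyCompactSpace X' := ChartedSpace.locallyCompactSpace Literature.Geometry.Lorentzian.E3 X'; Literature.Geometry.Lorentzian.area D'.h (ι' ⁻¹' Literature.Geometry.Lorentzian.DataEmbedding.futureEventHorizon 𝒟.toDataEmbedding)) ≤ a}; let Acc : Literature.Geometry.Lorentzian.InitialDataSet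 (𝓡 3) X → Prop := fun D ↦ ∃ (M A : ENNReal), M ≠ ⊤ ∧ (∀ e : Literature.Geometry.Lorentzian.AFEnd X, e.IsAsymptoticallyFlat D 1 → (∃ m, e.HasADMEnergy D m) → M ≤ ENNReal.ofReal (e.admMass D)) ∧ ∀ 𝒟 : Literature.Geometry.Lorentzian.VacuumCauchyDevelopment D, 𝒟.IsMaximal → ∀ [𝒟.metric.HasLeviCivita], MassF D 𝒟 = M ∧ AreaF D 𝒟 = A; let KerrB : Literature.Geometry.Lorentzian.InitialDataSet (𝓡 3) X → Prop := fun D ↦ ∀ 𝒟 : Literature.Geometry.Lorentzian.VacuumCauchyDevelopment D, 𝒟.IsMaximal → ∀ [𝒟.metric.HasLeviCivita], MassF D 𝒟 ≠ ⊤ ∧ kerrLo (MassF D 𝒟) < AreaF D 𝒟 ∧ AreaF D 𝒟 ≤ kerrHi (MassF D 𝒟); let HeavyB : Literature.Geometry.Lorentzian.InitialDataSet (𝓡 3) X → Prop := fun D ↦ ∀ 𝒟 : Literature.Geometry.Lorentzian.VacuumCauchyDevelopment D, 𝒟.IsMaximal → ∀ [𝒟.metric.HasLeviCivita], MassF D 𝒟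 ≠ ⊤ ∧ AreaF D 𝒟 ≤ kerrLo (MassF D 𝒟); let Hor : Literature.Geometry.Lorentzian.InitialDataSet (𝓡 3) X → Prop := fun D ↦ ∃ (hLC : D.metric.HasLeviCivita) (e : Literature.Geometry.Lorentzian.AFEnd X) (S : Literature.Geometry.Lorentzian.OutermostMOTS (𝓡 3) D.h D.k), haveI : (Literature.Geometry.Lorentzian.PseudoRiemannianMetric.ofRiemannian D.h).HasLeviCivita := hLC; let IsExteriorRegion : TopologicalSpace.Opens X → Prop := fun U ↦ IsConnected (U : Set X) ∧ ∃ R', e.R < R' ∧ e.far R' ⊆ (U : Set X) ∧ IsCompact (closure (U : Set X) \ e.far R'); let IsOutsideOf : TopologicalSpace.Opens X → (S' : Type) → (f' : S' → X) → Literature.Geometry.Lorentzian.NormalField (𝓡 3) f' → Prop := fun U _ f' ν' ↦ frontier (U : Set X) = Set.range f' ∧ (∀ y, ∀ᶠ t in nhdsWithin (0 : ℝ) (Set.Ioi 0), Literature.Geometry.Lorentzian.curveThrough (𝓡 3) (f' y) (ν' y) t ∈ (U : Set X)) ∧ (∀ y, ∀ᶠ t in nhdsWithin (0 : ℝ) (Set.Iio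 0), Literature.Geometry.Lorentzian.curveThrough (𝓡 3) (f' y) (ν' y) t ∉ closure (U : Set X)) ∧ IsExteriorRegion U; let IsCalS : TopologicalSpace.Opens X → Prop := fun V ↦ ∃ (S' : Type) (_ : TopologicalSpace S') (_ : ChartedSpace (EuclideanSpace ℝ (Fin 2)) S') (_ : IsManifold (𝓡 2) ((⊤ : ℕ∞) : WithTop ℕ∞) S') (_ : CompactSpace S') (_ : T2Space S') (f' : S' → X) (ν' : Literature.Geometry.Lorentzian.NormalField (𝓡 3) f'), Manifold.IsSmoothEmbedding (𝓡 2) (𝓡 3) ((⊤ : ℕ∞) : WithTop ℕ∞) f' ∧ (Literature.Geometry.Lorentzian.PseudoRiemannianMetric.ofRiemannian D.h).IsUnitNormal (𝓡 2) f' ν' 1 ∧ IsOutsideOf V S' f' ν'; let WOTFree : TopologicalSpace.Opens X → Prop := fun U ↦ ∀ (S' : Type) [TopologicalSpace S'] [ChartedSpace (EuclideanSpace ℝ (Fin 2)) S'] [IsManifold (𝓡 2) ((⊤ : ℕ∞) : WithTop ℕ∞) S'] [CompactSpace S'] [T2Space S'] (f' : S' → X) (ν' : Literature.Geometry.Lorentzian.NormalField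 (𝓡 3) f') (hpb' : Literature.Geometry.Lorentzian.PseudoRiemannianMetric.contMDiff_pullbackBilin (𝓡 3) X (𝓡 2) S' ((⊤ : ℕ∞) : WithTop ℕ∞)) (hf' : (Literature.Geometry.Lorentzian.PseudoRiemannianMetric.ofRiemannian D.h).IsSpacelikeImmersion (𝓡 2) f') (Ω : TopologicalSpace.Opens X), Manifold.IsSmoothEmbedding (𝓡 2) (𝓡 3) ((⊤ : ℕ∞) : WithTop ℕ∞) f' → Set.range f' ⊆ (U : Set X) → (Literature.Geometry.Lorentzian.PseudoRiemannianMetric.ofRiemannian D.h).IsUnitNormal (𝓡 2) f' ν' 1 → Nonempty S' → frontier (Ω : Set X) = Set.range f' → (∃ R', e.R < R' ∧ Disjoint (e.far R') (Ω : Set X)) → (∀ y, ∀ᶠ t in nhdsWithin (0 : ℝ) (Set.Iio 0), Literature.Geometry.Lorentzian.curveThrough (𝓡 3) (f' y) (ν' y) t ∈ (Ω : Set X)) → ¬ Literature.Geometry.Lorentzian.IsWeaklyOuterTrapped D.h D.k f' hpb' hf' ν'; ContMDiff (𝓡 2) (𝓡 3).tangent ((⊤ : ℕ∞) : WithTop ℕ∞)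 (fun y ↦ (Bundle.TotalSpace.mk' Literature.Geometry.Lorentzian.E3 (S.f y) (S.ν y) : TangentBundle (𝓡 3) X)) ∧ D.SatisfiesDominantEnergyCondition ∧ e.IsAsymptoticallyFlat D 1 ∧ D.IsComplete ∧ (∃ m, e.HasADMEnergy D m) ∧ (∀ i, ∃ p, e.HasADMMomentum D i p) ∧ WOTFree S.exterior ∧ IsOutsideOf S.exterior S.surf S.f S.ν ∧ 0 < e.admMass D ∧ (letI : MeasurableSpace X := borel X; haveI : BorelSpace X := ⟨rfl⟩; haveI : LocallyCompactSpace X := ChartedSpace.locallyCompactSpace Literature.Geometry.Lorentzian.E3 X; (9 / 10 : ℝ) * e.admMass D ≤ Real.sqrt ((⨅ (V : TopologicalSpace.Opens X) (_ : IsCalS V ∧ V ≤ S.exterior), Literature.Geometry.Lorentzian.area D.h (frontier (V : Set X))).toReal / (16 * Real.pi))); ∀ d ∈ Literature.Geometry.Lorentzian.admissibleVacuumData X, ¬ P d → (((¬ Disp d ∧ Trap d ∧ Cens d ∧ ¬ Pw0 d) ∧ Single d) ∧ CenFinF d) → (Acc d ∧ ¬ KerrB d ∧ HeavyB d ∧ Hor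 d) → ∃ (e : Literature.Geometry.Lorentzian.AFEnd X) (F : EuclideanSpace ℝ (Fin 1) → Literature.Geometry.Lorentzian.InitialDataSet (𝓡 3) X), Literature.Geometry.Lorentzian.InitialDataSet.IsTameDataFamily e 1 F ∧ Literature.Geometry.Lorentzian.InitialDataSet.IsImmersedAtZero 1 F ∧ F 0 = d ∧ Injective F ∧ (∀ c, F c ∈ Literature.Geometry.Lorentzian.admissibleVacuumData X) ∧ ∀ c ≠ 0, P (F c)

/-- item stmt-FinalStateConjecture-25598 · support · rank 8 · open · by planner
why it might fail: A tame-open family of trapped data whose MGHDs are future-incomplete at null infinity (generic naked singularities behind trapped surfaces) refutes it and S; weak cosmic censorship for trapped vacuum data is open beyond spherical symmetry.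
sources: arXiv:0805.3880, HawkingEllis1973
[crux] PIECE 𝓣₁ — TrappedNakedExit [WEAKER·COUNTS·SPECIAL-TYPE — critic CLEARED
2026-08-30T02:40:09Z; weak cosmic censorship AFTER trapping (cell empty in the spherical
scalar-field model doi:10.1088/0264-9381/22/11/019, expected codim ≥ 1 in vacuum); subsumes lens-5's
TrappedNakedCell (critic ruling); leaf IDEA-NEEDED; BARRIER-adjacent nakedSingularityInstability
honoured as the cure]. For every Σ and every admissible P_Σ-exceptional datum d, not of dispersive
type, all of whose MGHDs contain a closed trapped sphere to the future of the data, and SOME of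
whose MGHDs has incomplete future null infinity (weak cosmic censorship fails in the presence of a
trapped sphere), there are one end e and a tame immersed injective one-parameter family F of
admissible data with F 0 = d whose members c ≠ 0 satisfy P_Σ. Model: the cell is EMPTY for
spherically symmetric Einstein–Maxwell–scalar field / Einstein–Vlasov (Dafermos 2005; Rendall 2008
§11.5); in vacuum 3+1 expected inhabited (naked-singularity datum superposed with a distant
collapsing region by localized gluing) with positive codimension. [difficulty: open-problem] -/
@[route_item "route-FinalStateConjecture-RootDecompFarLedgerCells", crux]
def TrappedNakedExit : Prop :=
  ∀ (X : Type) [TopologicalSpace X] [ChartedSpace Literature.Geometry.Lorentzian.E3 X] [IsManifold (𝓡 3) ((⊤ : ℕ∞) : WithTop ℕ∞) X] [T2Space X] [SecondCountableTopology X] [ConnectedSpace X], let P : Literature.Geometry.Lorentzian.InitialDataSet (𝓡 3) X → Prop := fun D ↦ (∃ 𝒟 : Literature.Geometry.Lorentzian.VacuumCauchyDevelopment D, 𝒟.IsMaximal) ∧ ∀ 𝒟 : Literature.Geometry.Lorentzian.VacuumCauchyDevelopment D, 𝒟.IsMaximal → Summit.FinalStateConjecture.HasCompleteNullInfinity 𝒟.toCauchyDevelopment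 ∧ ∃ (O : Set 𝒟.carrier) (d : Literature.Geometry.Lorentzian.FinalStateDecomposition 𝒟.toSpacetime O 2), (∀ i, Literature.Geometry.Lorentzian.Kerr.IsSubextremal (d.mass i) (d.spin i)) ∧ O = Summit.FinalStateConjecture.exteriorOf 𝒟.toCauchyDevelopment d.charted ∧ Summit.FinalStateConjecture.RaysStayInClosure 𝒟.toCauchyDevelopment O ∧ Summit.FinalStateConjecture.HasExhaustiveCharts d ∧ Summit.FinalStateConjecture.IsFutureOriented d; let Disp : Literature.Geometry.Lorentzian.InitialDataSet (𝓡 3) X → Prop := fun D ↦ (∃ 𝒟 : Literature.Geometry.Lorentzian.VacuumCauchyDevelopment D, 𝒟.IsMaximal) ∧ ∀ 𝒟 : Literature.Geometry.Lorentzian.VacuumCauchyDevelopment D, 𝒟.IsMaximal → ∀ [𝒟.metric.HasLeviCivita], ¬ 𝒟.metric.IsFutureNullGeodesicallyIncomplete 𝒟.timeOrientation ∧ ¬ 𝒟.metric.IsFutureTimelikeGeodesicallyIncomplete 𝒟.timeOrientation; let Trap : Literature.Geometry.Lorentzian.InitialDataSet (𝓡 3) X → Prop := fun D ↦ (∃ 𝒟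 : Literature.Geometry.Lorentzian.VacuumCauchyDevelopment D, 𝒟.IsMaximal) ∧ ∀ 𝒟 : Literature.Geometry.Lorentzian.VacuumCauchyDevelopment D, 𝒟.IsMaximal → ∀ [𝒟.metric.HasLeviCivita], ∃ f : Metric.sphere (0 : Literature.Geometry.Lorentzian.E3) 1 → 𝒟.carrier, Set.range f ⊆ 𝒟.metric.causalFuture 𝒟.timeOrientation (Set.range 𝒟.embed) ∧ 𝒟.metric.IsTrappedSurface (𝓡 2) 𝒟.timeOrientation f; let Cens : Literature.Geometry.Lorentzian.InitialDataSet (𝓡 3) X → Prop := fun D ↦ ∀ 𝒟 : Literature.Geometry.Lorentzian.VacuumCauchyDevelopment D, 𝒟.IsMaximal → Summit.FinalStateConjecture.HasCompleteNullInfinity 𝒟.toCauchyDevelopment; ∀ d ∈ Literature.Geometry.Lorentzian.admissibleVacuumData X, ¬ P d → (¬ Disp d ∧ Trap d ∧ ¬ Cens d) → ∃ (e : Literature.Geometry.Lorentzian.AFEnd X) (F : EuclideanSpace ℝ (Fin 1) → Literature.Geometry.Lorentzian.InitialDataSet (𝓡 3) X), Literature.Geometry.Lorentzian.InitialDataSet.IsTameDataFamily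 e 1 F ∧ Literature.Geometry.Lorentzian.InitialDataSet.IsImmersedAtZero 1 F ∧ F 0 = d ∧ Injective F ∧ (∀ c, F c ∈ Literature.Geometry.Lorentzian.admissibleVacuumData X) ∧ ∀ c ≠ 0, P (F c)

/-- item stmt-FinalStateConjecture-24765 · support · rank 9 · open · by planner
why it might fail: the extremal critical set B_crit could be thick in the tame topology (extremal thresholds accumulating on themselves along every tame line), or leaving the threshold could land in naked data; vacuum extremal formation itself is open (arXiv:2402.10190 p.12).
sources: arXiv:2402.10190, arXiv:2211.15742, arXiv:2304.08455
[crux] PIECE 𝓝∧P_w — ExtremalThresholdExit [WEAKER·thin — critic CLEARED 2026-08-30T01:39:13Z with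
retag: the printed Kehle–Unger exit family (arXiv:2402.10190 Thm 1, Einstein–Maxwell–Vlasov) is a
MODEL-ANALOGUE, not a rung; leaf IDEA-NEEDED; BARRIER placement: AretakisInstability concerns
settling ON the threshold, this piece only asks to LEAVE it along a tame curve — outside; the bet is
transversality of B_crit]. For every Σ and every admissible P_Σ-exceptional datum d of threshold
type (not dispersive, not trapped) which satisfies the WEAK property P_w (an MGHD exists; every MGHD
has complete 𝓘⁺ and a Kerr final state decomposition with all the Statement's clauses but only |aᵢ|
≤ Mᵢ — so d fails P_Σ only through an exactly extremal final hole), there are one end e and a tame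
immersed injective one-parameter family F of admissible data with F 0 = d whose members c ≠ 0
satisfy P_Σ. [difficulty: open-problem] -/
@[route_item "route-FinalStateConjecture-RootDecompFarLedgerCells", crux]
def ExtremalThresholdExit : Prop :=
  ∀ (X : Type) [TopologicalSpace X] [ChartedSpace Literature.Geometry.Lorentzian.E3 X] [IsManifold (𝓡 3) ((⊤ : ℕ∞) : WithTop ℕ∞) X] [T2Space X] [SecondCountableTopology X] [ConnectedSpace X], let P : Literature.Geometry.Lorentzian.InitialDataSet (𝓡 3) X → Prop := fun D ↦ (∃ 𝒟 : Literature.Geometry.Lorentzian.VacuumCauchyDevelopment D, 𝒟.IsMaximal) ∧ ∀ 𝒟 : Literature.Geometry.Lorentzian.VacuumCauchyDevelopment D, 𝒟.IsMaximal → Summit.FinalStateConjecture.HasCompleteNullInfinity 𝒟.toCauchyDevelopment ∧ ∃ (O : Set 𝒟.carrier) (d : Literature.Geometry.Lorentzian.FinalStateDecomposition 𝒟.toSpacetime O 2), (∀ i, Literature.Geometry.Lorentzian.Kerr.IsSubextremal (d.mass i) (d.spin i)) ∧ O = Summit.FinalStateConjecture.exteriorOf 𝒟.toCauchyDevelopment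 d.charted ∧ Summit.FinalStateConjecture.RaysStayInClosure 𝒟.toCauchyDevelopment O ∧ Summit.FinalStateConjecture.HasExhaustiveCharts d ∧ Summit.FinalStateConjecture.IsFutureOriented d; let Pw : Literature.Geometry.Lorentzian.InitialDataSet (𝓡 3) X → Prop := fun D ↦ (∃ 𝒟 : Literature.Geometry.Lorentzian.VacuumCauchyDevelopment D, 𝒟.IsMaximal) ∧ ∀ 𝒟 : Literature.Geometry.Lorentzian.VacuumCauchyDevelopment D, 𝒟.IsMaximal → Summit.FinalStateConjecture.HasCompleteNullInfinity 𝒟.toCauchyDevelopment ∧ ∃ (O : Set 𝒟.carrier) (d : Literature.Geometry.Lorentzian.FinalStateDecomposition 𝒟.toSpacetime O 2), O = Summit.FinalStateConjecture.exteriorOf 𝒟.toCauchyDevelopment d.charted ∧ Summit.FinalStateConjecture.RaysStayInClosure 𝒟.toCauchyDevelopment O ∧ Summit.FinalStateConjecture.HasExhaustiveCharts d ∧ Summit.FinalStateConjecture.IsFutureOriented d; let Disp : Literature.Geometry.Lorentzian.InitialDataSet (𝓡 3) X → Prop := fun D ↦ (∃ 𝒟 : Literature.Geometry.Lorentzian.VacuumCauchyDevelopment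 D, 𝒟.IsMaximal) ∧ ∀ 𝒟 : Literature.Geometry.Lorentzian.VacuumCauchyDevelopment D, 𝒟.IsMaximal → ∀ [𝒟.metric.HasLeviCivita], ¬ 𝒟.metric.IsFutureNullGeodesicallyIncomplete 𝒟.timeOrientation ∧ ¬ 𝒟.metric.IsFutureTimelikeGeodesicallyIncomplete 𝒟.timeOrientation; let Trap : Literature.Geometry.Lorentzian.InitialDataSet (𝓡 3) X → Prop := fun D ↦ (∃ 𝒟 : Literature.Geometry.Lorentzian.VacuumCauchyDevelopment D, 𝒟.IsMaximal) ∧ ∀ 𝒟 : Literature.Geometry.Lorentzian.VacuumCauchyDevelopment D, 𝒟.IsMaximal → ∀ [𝒟.metric.HasLeviCivita], ∃ f : Metric.sphere (0 : Literature.Geometry.Lorentzian.E3) 1 → 𝒟.carrier, Set.range f ⊆ 𝒟.metric.causalFuture 𝒟.timeOrientation (Set.range 𝒟.embed) ∧ 𝒟.metric.IsTrappedSurface (𝓡 2) 𝒟.timeOrientation f; ∀ d ∈ Literature.Geometry.Lorentzian.admissibleVacuumData X, ¬ P d → (¬ Disp d ∧ ¬ Trap d ∧ Pw d) → ∃ (e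 : Literature.Geometry.Lorentzian.AFEnd X) (F : EuclideanSpace ℝ (Fin 1) → Literature.Geometry.Lorentzian.InitialDataSet (𝓡 3) X), Literature.Geometry.Lorentzian.InitialDataSet.IsTameDataFamily e 1 F ∧ Literature.Geometry.Lorentzian.InitialDataSet.IsImmersedAtZero 1 F ∧ F 0 = d ∧ Injective F ∧ (∀ c, F c ∈ Literature.Geometry.Lorentzian.admissibleVacuumData X) ∧ ∀ c ≠ 0, P (F c)

/-- item stmt-FinalStateConjecture-24766 · support · rank 9 · open · by planner
why it might fail: a non-radiating vacuum breather or a complete development with curvature not decaying at i⁺ whose tame neighbours are also exceptional (an open set) refutes it; no-breather results hold only near 𝓘 (arXiv:1504.04592) or for decaying solutions (arXiv:2108.13379).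
sources: arXiv:2108.13379, arXiv:1504.04592, doi:10.1007/PL00001021
[crux] PIECE 𝓒 — DispersiveExit [WEAKER·thin — critic CLEARED 2026-08-30T01:39:13Z; implied outright
by the registered pointwise item stmt-FinalStateConjecture-17320
`NoParkingWithoutHorizon.CompleteSpacetimesDisperse` (lens kernel
`dispersiveExit_of_completeSpacetimesDisperse`; cited by name, not re-typed); leaf IDEA-NEEDED;
attackable-now sub-rung: stationary-complete ⇒ flat (Lichnerowicz–Anderson port); rung stmt-10029
NoVacuumBreathers]. For every Σ and every admissible P_Σ-exceptional datum d of dispersive type (an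
MGHD exists and every MGHD is future causally geodesically complete: no future null or timelike
geodesic incompleteness, stated under the metric's Levi-Civita instance), there are one end e and a
tame immersed injective one-parameter family F of admissible data with F 0 = d whose members c ≠ 0
satisfy P_Σ. [difficulty: open-problem] -/
@[route_item "route-FinalStateConjecture-RootDecompFarLedgerCells", crux]
def DispersiveExit : Prop :=
  ∀ (X : Type) [TopologicalSpace X] [ChartedSpace Literature.Geometry.Lorentzian.E3 X] [IsManifold (𝓡 3) ((⊤ : ℕ∞) : WithTop ℕ∞) X] [T2Space X] [SecondCountableTopology X] [ConnectedSpace X], let P : Literature.Geometry.Lorentzian.InitialDataSet (𝓡 3) X → Prop := fun D ↦ (∃ 𝒟 : Literature.Geometry.Lorentzian.VacuumCauchyDevelopment D, 𝒟.IsMaximal) ∧ ∀ 𝒟 : Literature.Geometry.Lorentzian.VacuumCauchyDevelopment D, 𝒟.IsMaximal → Summit.FinalStateConjecture.HasCompleteNullInfinity 𝒟.toCauchyDevelopment ∧ ∃ (O : Set 𝒟.carrier) (d : Literature.Geometry.Lorentzian.FinalStateDecomposition 𝒟.toSpacetime O 2), (∀ i, Literature.Geometry.Lorentzian.Kerr.IsSubextremal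 (d.mass i) (d.spin i)) ∧ O = Summit.FinalStateConjecture.exteriorOf 𝒟.toCauchyDevelopment d.charted ∧ Summit.FinalStateConjecture.RaysStayInClosure 𝒟.toCauchyDevelopment O ∧ Summit.FinalStateConjecture.HasExhaustiveCharts d ∧ Summit.FinalStateConjecture.IsFutureOriented d; let Disp : Literature.Geometry.Lorentzian.InitialDataSet (𝓡 3) X → Prop := fun D ↦ (∃ 𝒟 : Literature.Geometry.Lorentzian.VacuumCauchyDevelopment D, 𝒟.IsMaximal) ∧ ∀ 𝒟 : Literature.Geometry.Lorentzian.VacuumCauchyDevelopment D, 𝒟.IsMaximal → ∀ [𝒟.metric.HasLeviCivita], ¬ 𝒟.metric.IsFutureNullGeodesicallyIncomplete 𝒟.timeOrientation ∧ ¬ 𝒟.metric.IsFutureTimelikeGeodesicallyIncomplete 𝒟.timeOrientation; ∀ d ∈ Literature.Geometry.Lorentzian.admissibleVacuumData X, ¬ P d → Disp d → ∃ (e : Literature.Geometry.Lorentzian.AFEnd X) (F : EuclideanSpace ℝ (Fin 1) → Literature.Geometry.Lorentzian.InitialDataSet (𝓡 3) X), Literature.Geometry.Lorentzian.InitialDataSet.IsTameDataFamily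 e 1 F ∧ Literature.Geometry.Lorentzian.InitialDataSet.IsImmersedAtZero 1 F ∧ F 0 = d ∧ Injective F ∧ (∀ c, F c ∈ Literature.Geometry.Lorentzian.admissibleVacuumData X) ∧ ∀ c ≠ 0, P (F c)

/-- item stmt-FinalStateConjecture-24767 · support · rank 9 · open · by planner
why it might fail: a smooth-data analogue of the Singh–Zheng stability — a tame-open set of admissible vacuum data forming naked singularities (RSR arXiv:1912.08478 exteriors are fine-tuned, consistent so far).
sources: Christodoulou1999, arXiv:1912.08478, arXiv:2204.09891, arXiv:2605.16235, arXiv:0811.0354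
[crux] PIECE 𝓝∧¬P_w — NakedThresholdExit [WEAKER·COUNTS — critic CLEARED 2026-08-30T01:39:13Z; =
weak cosmic censorship on the untrapped incomplete sector in Christodoulou's own codimension form
(the all-cells version is the registered hard core stmt-FinalStateConjecture-17269, cited; this is
its cell restriction with cure target P_Σ); leaf IDEA-NEEDED; BARRIER: nakedSingularityInstability
is the MODEL exit family (Christodoulou1999 Thm 4.1, 2-plane of exits) = the generic form, outside
the genericity-blind class; functional-framework dependence (Singh–Zheng arXiv:2605.16235:
Hölder-stable naked singularities in the spherical scalar field) — the bet is that smooth tame data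
are on the unstable side]. For every Σ and every admissible P_Σ-exceptional datum d of threshold
type (not dispersive, not trapped) failing even the weak property P_w (no MGHD, or an MGHD with
incomplete 𝓘⁺, or censored but settling to no Kerr configuration with |aᵢ| ≤ Mᵢ), there are one end
e and a tame immersed injective one-parameter family F of admissible data with F 0 = d whose members
c ≠ 0 satisfy P_Σ. [difficulty: open-problem] -/
@[route_item "route-FinalStateConjecture-RootDecompFarLedgerCells", crux]
def NakedThresholdExit : Prop :=
  ∀ (X : Type) [TopologicalSpace X] [ChartedSpace Literature.Geometry.Lorentzian.E3 X] [IsManifold (𝓡 3) ((⊤ : ℕ∞) : WithTop ℕ∞) X] [T2Space X] [SecondCountableTopology X] [ConnectedSpace X], let P : Literature.Geometry.Lorentzian.InitialDataSet (𝓡 3) X → Prop := fun D ↦ (∃ 𝒟 : Literature.Geometry.Lorentzian.VacuumCauchyDevelopment D, 𝒟.IsMaximal) ∧ ∀ 𝒟 : Literature.Geometry.Lorentzian.VacuumCauchyDevelopment D, 𝒟.IsMaximal → Summit.FinalStateConjecture.HasCompleteNullInfinity 𝒟.toCauchyDevelopment ∧ ∃ (O : Set 𝒟.carrier) (d : Literature.Geometry.Lorentzian.FinalStateDecomposition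 𝒟.toSpacetime O 2), (∀ i, Literature.Geometry.Lorentzian.Kerr.IsSubextremal (d.mass i) (d.spin i)) ∧ O = Summit.FinalStateConjecture.exteriorOf 𝒟.toCauchyDevelopment d.charted ∧ Summit.FinalStateConjecture.RaysStayInClosure 𝒟.toCauchyDevelopment O ∧ Summit.FinalStateConjecture.HasExhaustiveCharts d ∧ Summit.FinalStateConjecture.IsFutureOriented d; let Pw : Literature.Geometry.Lorentzian.InitialDataSet (𝓡 3) X → Prop := fun D ↦ (∃ 𝒟 : Literature.Geometry.Lorentzian.VacuumCauchyDevelopment D, 𝒟.IsMaximal) ∧ ∀ 𝒟 : Literature.Geometry.Lorentzian.VacuumCauchyDevelopment D, 𝒟.IsMaximal → Summit.FinalStateConjecture.HasCompleteNullInfinity 𝒟.toCauchyDevelopment ∧ ∃ (O : Set 𝒟.carrier) (d : Literature.Geometry.Lorentzian.FinalStateDecomposition 𝒟.toSpacetime O 2), O = Summit.FinalStateConjecture.exteriorOf 𝒟.toCauchyDevelopment d.charted ∧ Summit.FinalStateConjecture.RaysStayInClosure 𝒟.toCauchyDevelopment O ∧ Summit.FinalStateConjecture.HasExhaustiveCharts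 d ∧ Summit.FinalStateConjecture.IsFutureOriented d; let Disp : Literature.Geometry.Lorentzian.InitialDataSet (𝓡 3) X → Prop := fun D ↦ (∃ 𝒟 : Literature.Geometry.Lorentzian.VacuumCauchyDevelopment D, 𝒟.IsMaximal) ∧ ∀ 𝒟 : Literature.Geometry.Lorentzian.VacuumCauchyDevelopment D, 𝒟.IsMaximal → ∀ [𝒟.metric.HasLeviCivita], ¬ 𝒟.metric.IsFutureNullGeodesicallyIncomplete 𝒟.timeOrientation ∧ ¬ 𝒟.metric.IsFutureTimelikeGeodesicallyIncomplete 𝒟.timeOrientation; let Trap : Literature.Geometry.Lorentzian.InitialDataSet (𝓡 3) X → Prop := fun D ↦ (∃ 𝒟 : Literature.Geometry.Lorentzian.VacuumCauchyDevelopment D, 𝒟.IsMaximal) ∧ ∀ 𝒟 : Literature.Geometry.Lorentzian.VacuumCauchyDevelopment D, 𝒟.IsMaximal → ∀ [𝒟.metric.HasLeviCivita], ∃ f : Metric.sphere (0 : Literature.Geometry.Lorentzian.E3) 1 → 𝒟.carrier, Set.range f ⊆ 𝒟.metric.causalFuture 𝒟.timeOrientation (Set.range 𝒟.embed) ∧ 𝒟.metric.IsTrappedSurface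 (𝓡 2) 𝒟.timeOrientation f; ∀ d ∈ Literature.Geometry.Lorentzian.admissibleVacuumData X, ¬ P d → (¬ Disp d ∧ ¬ Trap d ∧ ¬ Pw d) → ∃ (e : Literature.Geometry.Lorentzian.AFEnd X) (F : EuclideanSpace ℝ (Fin 1) → Literature.Geometry.Lorentzian.InitialDataSet (𝓡 3) X), Literature.Geometry.Lorentzian.InitialDataSet.IsTameDataFamily e 1 F ∧ Literature.Geometry.Lorentzian.InitialDataSet.IsImmersedAtZero 1 F ∧ F 0 = d ∧ Injective F ∧ (∀ c, F c ∈ Literature.Geometry.Lorentzian.admissibleVacuumData X) ∧ ∀ c ≠ 0, P (F c)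

/-- item stmt-FinalStateConjecture-25599 · support · rank 9 · open · by planner
why it might fail: the set of trapped data with exactly extremal remnants could be tame-thick (accumulating on itself along every tame line through a member), or every tame exit from it could pass through uncensored data; vacuum extremal Kerr formation itself is open (arXiv:2402.10190 p.12).
sources: arXiv:2211.15742, arXiv:2402.10190, arXiv:2304.08455, Aretakis2015, arXiv:1402.7034, Israel1986
[crux] PIECE 𝓣₃ — TrappedExtremalExit [WEAKER·COUNTS·SPECIAL-TYPE — critic CLEARED
2026-08-30T02:40:09Z; generic THIRD LAW after trapping (transversal crossing of |a_f|/M_f = 1 along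
a tame line) + pointwise C⁰→C² upgrade at sub-extremal members (content pinned by
stmt-FinalStateConjecture-17298 SubextremalUpgrade, cited by name); MODEL-ANALOGUE in print not a
rung (arXiv:2211.15742 Thm 1); INSTRUMENTABLE (remnant-spin census); BARRIER AretakisInstability
OUTSIDE (asks to leave the cell)]. For every Σ and every admissible P_Σ-exceptional datum d, not of
dispersive type, all of whose MGHDs contain a closed trapped sphere to the future of the data, and
which SATISFIES the weak C⁰ property P_w⁰ (an MGHD exists; every MGHD has complete 𝓘⁺ and an honest
C⁰ Kerr final-state decomposition with |a_i| ≤ M_i and the Statement's four clauses) — so that,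
given the registered pointwise upgrade stmt-17298, d fails P_Σ exactly because one of its MGHDs has
only end states with an exactly extremal hole — there are one end e and a tame immersed injective
one-parameter family F of admissible data with F 0 = d whose members c ≠ 0 satisfy P_Σ. Content: the
generic third law after trapping (final |a_f|/ -/
@[route_item "route-FinalStateConjecture-RootDecompFarLedgerCells", crux]
def TrappedExtremalExit : Prop :=
  ∀ (X : Type) [TopologicalSpace X] [ChartedSpace Literature.Geometry.Lorentzian.E3 X] [IsManifold (𝓡 3) ((⊤ : ℕ∞) : WithTop ℕ∞) X] [T2Space X] [SecondCountableTopology X] [ConnectedSpace X], let P : Literature.Geometry.Lorentzian.InitialDataSet (𝓡 3) X → Prop := fun D ↦ (∃ 𝒟 : Literature.Geometry.Lorentzian.VacuumCauchyDevelopment D, 𝒟.IsMaximal) ∧ ∀ 𝒟 : Literature.Geometry.Lorentzian.VacuumCauchyDevelopment D, 𝒟.IsMaximal → Summit.FinalStateConjecture.HasCompleteNullInfinity 𝒟.toCauchyDevelopment ∧ ∃ (O : Set 𝒟.carrier) (d : Literature.Geometry.Lorentzian.FinalStateDecomposition 𝒟.toSpacetime O 2), (∀ i, Literature.Geometry.Lorentzian.Kerr.IsSubextremal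 (d.mass i) (d.spin i)) ∧ O = Summit.FinalStateConjecture.exteriorOf 𝒟.toCauchyDevelopment d.charted ∧ Summit.FinalStateConjecture.RaysStayInClosure 𝒟.toCauchyDevelopment O ∧ Summit.FinalStateConjecture.HasExhaustiveCharts d ∧ Summit.FinalStateConjecture.IsFutureOriented d; let Pw0 : Literature.Geometry.Lorentzian.InitialDataSet (𝓡 3) X → Prop := fun D ↦ (∃ 𝒟 : Literature.Geometry.Lorentzian.VacuumCauchyDevelopment D, 𝒟.IsMaximal) ∧ ∀ 𝒟 : Literature.Geometry.Lorentzian.VacuumCauchyDevelopment D, 𝒟.IsMaximal → Summit.FinalStateConjecture.HasCompleteNullInfinity 𝒟.toCauchyDevelopment ∧ ∃ (O : Set 𝒟.carrier) (d : Literature.Geometry.Lorentzian.FinalStateDecomposition 𝒟.toSpacetime O 0), O = Summit.FinalStateConjecture.exteriorOf 𝒟.toCauchyDevelopment d.charted ∧ Summit.FinalStateConjecture.RaysStayInClosure 𝒟.toCauchyDevelopment O ∧ Summit.FinalStateConjecture.HasExhaustiveCharts d ∧ Summit.FinalStateConjecture.IsFutureOriented d; let Disp : Literature.Geometry.Lorentzian.InitialDataSet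 (𝓡 3) X → Prop := fun D ↦ (∃ 𝒟 : Literature.Geometry.Lorentzian.VacuumCauchyDevelopment D, 𝒟.IsMaximal) ∧ ∀ 𝒟 : Literature.Geometry.Lorentzian.VacuumCauchyDevelopment D, 𝒟.IsMaximal → ∀ [𝒟.metric.HasLeviCivita], ¬ 𝒟.metric.IsFutureNullGeodesicallyIncomplete 𝒟.timeOrientation ∧ ¬ 𝒟.metric.IsFutureTimelikeGeodesicallyIncomplete 𝒟.timeOrientation; let Trap : Literature.Geometry.Lorentzian.InitialDataSet (𝓡 3) X → Prop := fun D ↦ (∃ 𝒟 : Literature.Geometry.Lorentzian.VacuumCauchyDevelopment D, 𝒟.IsMaximal) ∧ ∀ 𝒟 : Literature.Geometry.Lorentzian.VacuumCauchyDevelopment D, 𝒟.IsMaximal → ∀ [𝒟.metric.HasLeviCivita], ∃ f : Metric.sphere (0 : Literature.Geometry.Lorentzian.E3) 1 → 𝒟.carrier, Set.range f ⊆ 𝒟.metric.causalFuture 𝒟.timeOrientation (Set.range 𝒟.embed) ∧ 𝒟.metric.IsTrappedSurface (𝓡 2) 𝒟.timeOrientation f; ∀ d ∈ Literature.Geometry.Lorentzian.admissibleVacuumData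 X, ¬ P d → (¬ Disp d ∧ Trap d ∧ Pw0 d) → ∃ (e : Literature.Geometry.Lorentzian.AFEnd X) (F : EuclideanSpace ℝ (Fin 1) → Literature.Geometry.Lorentzian.InitialDataSet (𝓡 3) X), Literature.Geometry.Lorentzian.InitialDataSet.IsTameDataFamily e 1 F ∧ Literature.Geometry.Lorentzian.InitialDataSet.IsImmersedAtZero 1 F ∧ F 0 = d ∧ Injective F ∧ (∀ c, F c ∈ Literature.Geometry.Lorentzian.admissibleVacuumData X) ∧ ∀ c ≠ 0, P (F c)

/-- item stmt-FinalStateConjecture-27604 · support · rank 9 · open · by planner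
why it might fail: Vacuous iff 13847 FiniteCensus holds on the cell; a single-final-hole development whose future slices carry unboundedly many disjoint shrinking outermost-MOTS bodies (not excluded by Penrose-type area/mass heuristics) would make it contentful and as hard as 26645 there.
sources: HawkingEllis1973, AnderssonMetzgerTrapped2009, arXiv:0805.3880, arXiv:1407.4766, doi:10.1103/PhysRevLett.14.57
[support · THIN BRIDGE ⟸ stmt-13847 · conjecturally VACUOUS · dominated] lens-5 g4
«FutureCensusCarve» child 2 of SingleHoleCaptureExit (stmt-26645; CLEARED[split]
2026-08-30T04:18:58Z): the cell 𝓒 AND ¬CenFinF d (one final hole, yet some MGHD carries future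
Cauchy slices with arbitrarily many pairwise-disjoint outermost-MOTS bodies) — admits a tame
injective exit line with P verbatim. Registered kill path: stmt-13847 CriticalAncestry.FiniteCensus
⟹ this item, kernel-certified by the lens as cascadeSingleExit_of_finiteCensus : FiniteCensusR →
CascadeSingleExit (an unbundled future slice IS a CauchyDevelopment D′ with rfl-same spacetime;
FiniteCensusR = character-identical copy of 13847 because importing Theses.CriticalAncestry answers
rc 75 unbuilt) — modus ponens, no analysis; closes the day 13847 closes. Kind support = per-route
bookkeeping for a dominated bridge (it never drives staffing). c5 harmless here (13847 carries the
same clause). -/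
@[route_item "route-FinalStateConjecture-RootDecompFarLedgerCells", crux]
def CascadeSingleExit : Prop :=
  ∀ (X : Type) [TopologicalSpace X] [ChartedSpace Literature.Geometry.Lorentzian.E3 X] [IsManifold (𝓡 3) ((⊤ : ℕ∞) : WithTop ℕ∞) X] [T2Space X] [SecondCountableTopology X] [ConnectedSpace X], let P : Literature.Geometry.Lorentzian.InitialDataSet (𝓡 3) X → Prop := fun D ↦ (∃ 𝒟 : Literature.Geometry.Lorentzian.VacuumCauchyDevelopment D, 𝒟.IsMaximal) ∧ ∀ 𝒟 : Literature.Geometry.Lorentzian.VacuumCauchyDevelopment D, 𝒟.IsMaximal → Summit.FinalStateConjecture.HasCompleteNullInfinity 𝒟.toCauchyDevelopment ∧ ∃ (O : Set 𝒟.carrier) (d : Literature.Geometry.Lorentzian.FinalStateDecomposition 𝒟.toSpacetime O 2), (∀ i, Literature.Geometry.Lorentzian.Kerr.IsSubextremal (d.mass i) (d.spin i)) ∧ O = Summit.FinalStateConjecture.exteriorOf 𝒟.toCauchyDevelopment d.charted ∧ Summit.FinalStateConjecture.RaysStayInClosure 𝒟.toCauchyDevelopment O ∧ Summit.FinalStateConjecture.HasExhaustiveCharts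 d ∧ Summit.FinalStateConjecture.IsFutureOriented d; let Pw0 : Literature.Geometry.Lorentzian.InitialDataSet (𝓡 3) X → Prop := fun D ↦ (∃ 𝒟 : Literature.Geometry.Lorentzian.VacuumCauchyDevelopment D, 𝒟.IsMaximal) ∧ ∀ 𝒟 : Literature.Geometry.Lorentzian.VacuumCauchyDevelopment D, 𝒟.IsMaximal → Summit.FinalStateConjecture.HasCompleteNullInfinity 𝒟.toCauchyDevelopment ∧ ∃ (O : Set 𝒟.carrier) (d : Literature.Geometry.Lorentzian.FinalStateDecomposition 𝒟.toSpacetime O 0), O = Summit.FinalStateConjecture.exteriorOf 𝒟.toCauchyDevelopment d.charted ∧ Summit.FinalStateConjecture.RaysStayInClosure 𝒟.toCauchyDevelopment O ∧ Summit.FinalStateConjecture.HasExhaustiveCharts d ∧ Summit.FinalStateConjecture.IsFutureOriented d; let Disp : Literature.Geometry.Lorentzian.InitialDataSet (𝓡 3) X → Prop := fun D ↦ (∃ 𝒟 : Literature.Geometry.Lorentzian.VacuumCauchyDevelopment D, 𝒟.IsMaximal) ∧ ∀ 𝒟 : Literature.Geometry.Lorentzian.VacuumCauchyDevelopment D, 𝒟.IsMaximal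 → ∀ [𝒟.metric.HasLeviCivita], ¬ 𝒟.metric.IsFutureNullGeodesicallyIncomplete 𝒟.timeOrientation ∧ ¬ 𝒟.metric.IsFutureTimelikeGeodesicallyIncomplete 𝒟.timeOrientation; let Trap : Literature.Geometry.Lorentzian.InitialDataSet (𝓡 3) X → Prop := fun D ↦ (∃ 𝒟 : Literature.Geometry.Lorentzian.VacuumCauchyDevelopment D, 𝒟.IsMaximal) ∧ ∀ 𝒟 : Literature.Geometry.Lorentzian.VacuumCauchyDevelopment D, 𝒟.IsMaximal → ∀ [𝒟.metric.HasLeviCivita], ∃ f : Metric.sphere (0 : Literature.Geometry.Lorentzian.E3) 1 → 𝒟.carrier, Set.range f ⊆ 𝒟.metric.causalFuture 𝒟.timeOrientation (Set.range 𝒟.embed) ∧ 𝒟.metric.IsTrappedSurface (𝓡 2) 𝒟.timeOrientation f; let Cens : Literature.Geometry.Lorentzian.InitialDataSet (𝓡 3) X → Prop := fun D ↦ ∀ 𝒟 : Literature.Geometry.Lorentzian.VacuumCauchyDevelopment D, 𝒟.IsMaximal → Summit.FinalStateConjecture.HasCompleteNullInfinity 𝒟.toCauchyDevelopment; let Single :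 Literature.Geometry.Lorentzian.InitialDataSet (𝓡 3) X → Prop := fun D ↦ ∀ 𝒟 : Literature.Geometry.Lorentzian.VacuumCauchyDevelopment D, 𝒟.IsMaximal → ∀ [𝒟.metric.HasLeviCivita], Subsingleton (ConnectedComponents ↥(Literature.Geometry.Lorentzian.DataEmbedding.blackHoleRegion 𝒟.toDataEmbedding ∩ 𝒟.metric.causalFuture 𝒟.timeOrientation (Set.range 𝒟.embed))); let CenFinF : Literature.Geometry.Lorentzian.InitialDataSet (𝓡 3) X → Prop := fun D ↦ ∀ 𝒟 : Literature.Geometry.Lorentzian.VacuumCauchyDevelopment D, 𝒟.IsMaximal → ∃ n : ℕ, ∀ (X' : Type) [TopologicalSpace X'] [ChartedSpace Literature.Geometry.Lorentzian.E3 X'] [IsManifold (𝓡 3) ((⊤ : ℕ∞) : WithTop ℕ∞) X'] [ConnectedSpace X'] (D' : Literature.Geometry.Lorentzian.InitialDataSet (𝓡 3) X') (ι' : X' → 𝒟.carrier) (ν' : Literature.Geometry.Lorentzian.NormalField (𝓡 4) ι'), Manifold.IsSmoothEmbedding (𝓡 3) (𝓡 4) ((⊤ : ℕ∞) : WithTop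 ℕ∞) ι' → 𝒟.metric.IsFutureUnitNormal (𝓡 3) 𝒟.timeOrientation ι' ν' → (∀ y : X', Literature.Geometry.Lorentzian.pullbackBilin (I := 𝓡 4) (I' := 𝓡 3) ι' 𝒟.metric.val y = D'.h.inner y) → (∀ [𝒟.metric.toPseudoRiemannianMetric.HasLeviCivita] (y : X'), 𝒟.metric.toPseudoRiemannianMetric.secondFundamentalForm (𝓡 3) ι' ν' y = D'.kBilin y) → 𝒟.metric.IsCauchyHypersurface 𝒟.timeOrientation (Set.range ι') → Set.range ι' ⊆ 𝒟.metric.causalFuture 𝒟.timeOrientation (Set.range 𝒟.embed) → ∀ S : Fin (n + 1) → Literature.Geometry.Lorentzian.OutermostMOTS (𝓡 3) D'.h D'.k, (∀ j, ConnectedSpace (S j).surf) → (∀ j, IsCompact (((S j).exterior : Set X'))ᶜ ∧ (interior (((S j).exterior : Set X'))ᶜ).Nonempty) → ∃ j j', j ≠ j' ∧ ((((S j).exterior : Set X'))ᶜ ∩ (((S j').exterior : Set X'))ᶜ).Nonempty; ∀ d ∈ Literature.Geometry.Lorentzian.admissibleVacuumData X, ¬ P d → (((¬ Disp d ∧ Trap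 d ∧ Cens d ∧ ¬ Pw0 d) ∧ Single d) ∧ ¬ CenFinF d) → ∃ (e : Literature.Geometry.Lorentzian.AFEnd X) (F : EuclideanSpace ℝ (Fin 1) → Literature.Geometry.Lorentzian.InitialDataSet (𝓡 3) X), Literature.Geometry.Lorentzian.InitialDataSet.IsTameDataFamily e 1 F ∧ Literature.Geometry.Lorentzian.InitialDataSet.IsImmersedAtZero 1 F ∧ F 0 = d ∧ Injective F ∧ (∀ c, F c ∈ Literature.Geometry.Lorentzian.admissibleVacuumData X) ∧ ∀ c ≠ 0, P (F c)

/-- item stmt-FinalStateConjecture-29229 · assembly · rank 1 · open · by planner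
sources: KlainermanNicolo2003
[assembly] NoChargeExit → SubextremalChargeExit → HeavyChargeExit → LightChargeExit →
MultiHoleCaptureExit → InfiniteHoleCaptureExit → TrappedNakedExit → HeavyChargeDoor →
CascadeSingleExit → TrappedExtremalExit → ExtremalThresholdExit → DispersiveExit →
NakedThresholdExit → the final state conjecture as typed. -/
@[route_item "route-FinalStateConjecture-RootDecompFarLedgerCells"]
def Assembly : Prop :=
  NoChargeExit → SubextremalChargeExit → HeavyChargeExit → LightChargeExit → MultiHoleCaptureExit → InfiniteHoleCaptureExit → TrappedNakedExit → HeavyChargeDoor → CascadeSingleExit → TrappedExtremalExit → ExtremalThresholdExit → DispersiveExit → NakedThresholdExit → FinalStateConjecture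

/-! D-0027 §2.1 — DECIDING THEOREM (planner-authored via `route open/edit --closes-file`; by planner-decomp-fsc-writer-1-g2-0 2026-08-30T06:22:22Z):
its hypotheses are this route's items and its conclusion the sub-problem Statement (glue_lint), and it elaborates with this file. -/

@[closes "route-FinalStateConjecture-RootDecompFarLedgerCells"] theorem closes (hK : SubextremalChargeExit) (hDr : HeavyChargeDoor) (hL : HeavyChargeExit) (hH : LightChargeExit) (hN : NoChargeExit) (hCas : CascadeSingleExit) (hMulti : MultiHoleCaptureExit) (hInf : InfiniteHoleCaptureExit) (t₁ : TrappedNakedExit) (t₃ : TrappedExtremalExit) (h₃ : ExtremalThresholdExit) (h₁ : DispersiveExit) (h₄ : NakedThresholdExit) : _root_.FinalStateConjecture := by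
  have t₂ : ∀ (X : Type) [TopologicalSpace X] [ChartedSpace Literature.Geometry.Lorentzian.E3 X] [IsManifold (𝓡 3) ((⊤ : ℕ∞) : WithTop ℕ∞) X] [T2Space X] [SecondCountableTopology X] [ConnectedSpace X], let P : Literature.Geometry.Lorentzian.InitialDataSet (𝓡 3) X → Prop := fun D ↦ (∃ 𝒟 : Literature.Geometry.Lorentzian.VacuumCauchyDevelopment D, 𝒟.IsMaximal) ∧ ∀ 𝒟 : Literature.Geometry.Lorentzian.VacuumCauchyDevelopment D, 𝒟.IsMaximal → Summit.FinalStateConjecture.HasCompleteNullInfinity 𝒟.toCauchyDevelopment ∧ ∃ (O : Set 𝒟.carrier) (d : Literature.Geometry.Lorentzian.FinalStateDecomposition 𝒟.toSpacetime O 2), (∀ i, Literature.Geometry.Lorentzian.Kerr.IsSubextremal (d.mass i) (d.spin i)) ∧ O = Summit.FinalStateConjecture.exteriorOf 𝒟.toCauchyDevelopment d.charted ∧ Summit.FinalStateConjecture.RaysStayInClosure 𝒟.toCauchyDevelopment O ∧ Summit.FinalStateConjecture.HasExhaustiveCharts d ∧ Summit.FinalStateConjecture.IsFutureOriented d; let Pw0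 : Literature.Geometry.Lorentzian.InitialDataSet (𝓡 3) X → Prop := fun D ↦ (∃ 𝒟 : Literature.Geometry.Lorentzian.VacuumCauchyDevelopment D, 𝒟.IsMaximal) ∧ ∀ 𝒟 : Literature.Geometry.Lorentzian.VacuumCauchyDevelopment D, 𝒟.IsMaximal → Summit.FinalStateConjecture.HasCompleteNullInfinity 𝒟.toCauchyDevelopment ∧ ∃ (O : Set 𝒟.carrier) (d : Literature.Geometry.Lorentzian.FinalStateDecomposition 𝒟.toSpacetime O 0), O = Summit.FinalStateConjecture.exteriorOf 𝒟.toCauchyDevelopment d.charted ∧ Summit.FinalStateConjecture.RaysStayInClosure 𝒟.toCauchyDevelopment O ∧ Summit.FinalStateConjecture.HasExhaustiveCharts d ∧ Summit.FinalStateConjecture.IsFutureOriented d; let Disp : Literature.Geometry.Lorentzian.InitialDataSet (𝓡 3) X → Prop := fun D ↦ (∃ 𝒟 : Literature.Geometry.Lorentzian.VacuumCauchyDevelopment D, 𝒟.IsMaximal) ∧ ∀ 𝒟 : Literature.Geometry.Lorentzian.VacuumCauchyDevelopment D, 𝒟.IsMaximal → ∀ [𝒟.metric.HasLeviCivita], ¬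 𝒟.metric.IsFutureNullGeodesicallyIncomplete 𝒟.timeOrientation ∧ ¬ 𝒟.metric.IsFutureTimelikeGeodesicallyIncomplete 𝒟.timeOrientation; let Trap : Literature.Geometry.Lorentzian.InitialDataSet (𝓡 3) X → Prop := fun D ↦ (∃ 𝒟 : Literature.Geometry.Lorentzian.VacuumCauchyDevelopment D, 𝒟.IsMaximal) ∧ ∀ 𝒟 : Literature.Geometry.Lorentzian.VacuumCauchyDevelopment D, 𝒟.IsMaximal → ∀ [𝒟.metric.HasLeviCivita], ∃ f : Metric.sphere (0 : Literature.Geometry.Lorentzian.E3) 1 → 𝒟.carrier, Set.range f ⊆ 𝒟.metric.causalFuture 𝒟.timeOrientation (Set.range 𝒟.embed) ∧ 𝒟.metric.IsTrappedSurface (𝓡 2) 𝒟.timeOrientation f; let Cens : Literature.Geometry.Lorentzian.InitialDataSet (𝓡 3) X → Prop := fun D ↦ ∀ 𝒟 : Literature.Geometry.Lorentzian.VacuumCauchyDevelopment D, 𝒟.IsMaximal → Summit.FinalStateConjecture.HasCompleteNullInfinity 𝒟.toCauchyDevelopment; ∀ d ∈ Literature.Geometry.Lorentzian.admissibleVacuumData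 X, ¬ P d → (¬ Disp d ∧ Trap d ∧ Cens d ∧ ¬ Pw0 d) → ∃ (e : Literature.Geometry.Lorentzian.AFEnd X) (F : EuclideanSpace ℝ (Fin 1) → Literature.Geometry.Lorentzian.InitialDataSet (𝓡 3) X), Literature.Geometry.Lorentzian.InitialDataSet.IsTameDataFamily e 1 F ∧ Literature.Geometry.Lorentzian.InitialDataSet.IsImmersedAtZero 1 F ∧ F 0 = d ∧ Injective F ∧ (∀ c, F c ∈ Literature.Geometry.Lorentzian.admissibleVacuumData X) ∧ ∀ c ≠ 0, P (F c) := by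
    intro X _ _ _ _ _ _ P Pw0 Disp Trap Cens d hd hP hcell
    exact (Classical.em _).elim (fun hS ↦ (Classical.em _).elim (fun hfin ↦ (Classical.em _).elim
          (fun hAcc ↦ (Classical.em _).elim
            (fun hKe ↦ hK X d hd hP ⟨⟨hcell, hS⟩, hfin⟩ ⟨hAcc, hKe⟩)
            (fun hKe ↦ (Classical.em _).elim
              (fun hLe ↦ (Classical.em _).elim
                (fun hHor ↦ hDr X d hd hP ⟨⟨hcell, hS⟩, hfin⟩ ⟨hAcc, hKe, hLe, hHor⟩)
                (fun hHor ↦ hL X d hd hP ⟨⟨hcell, hS⟩, hfin⟩ ⟨hAcc, hKe, hLe, hHor⟩))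
              (fun hLe ↦ hH X d hd hP ⟨⟨hcell, hS⟩, hfin⟩ ⟨hAcc, hKe, hLe⟩)))
          (fun hAcc ↦ hN X d hd hP ⟨⟨hcell, hS⟩, hfin⟩ hAcc)) (fun hfin ↦ hCas X d hd hP ⟨⟨hcell, hS⟩, hfin⟩))
      (fun hS ↦ (Classical.em _).elim (fun hF ↦ hMulti X d hd hP ⟨hcell, hS, hF⟩) (fun hF ↦ hInf X d hd hP ⟨hcell, hF⟩))
  intro X _ _ _ _ _ _ d hd
  suffices h : ∃ (e : Literature.Geometry.Lorentzian.AFEnd X) (F : EuclideanSpace ℝ (Fin 1) → Literature.Geometry.Lorentzian.InitialDataSet (𝓡 3) X), Literature.Geometry.Lorentzian.InitialDataSet.IsTameDataFamily e 1 F ∧ Literature.Geometry.Lorentzian.InitialDataSet.IsImmersedAtZero 1 F ∧ F 0 = d ∧ Injective F ∧ (∀ c, F c ∈ Literature.Geometry.Lorentzian.admissibleVacuumData X) ∧ ∀ c ≠ 0, ((∃ 𝒟 : Literature.Geometry.Lorentzian.VacuumCauchyDevelopment (F c), 𝒟.IsMaximal) ∧ ∀ 𝒟 : Literature.Geometry.Lorentzian.VacuumCauchyDevelopment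 (F c), 𝒟.IsMaximal → Summit.FinalStateConjecture.HasCompleteNullInfinity 𝒟.toCauchyDevelopment ∧ ∃ (O : Set 𝒟.carrier) (d : Literature.Geometry.Lorentzian.FinalStateDecomposition 𝒟.toSpacetime O 2), (∀ i, Literature.Geometry.Lorentzian.Kerr.IsSubextremal (d.mass i) (d.spin i)) ∧ O = Summit.FinalStateConjecture.exteriorOf 𝒟.toCauchyDevelopment d.charted ∧ Summit.FinalStateConjecture.RaysStayInClosure 𝒟.toCauchyDevelopment O ∧ Summit.FinalStateConjecture.HasExhaustiveCharts d ∧ Summit.FinalStateConjecture.IsFutureOriented d) by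
    obtain ⟨e, F, h1, h2, h3, h4, h5, h6⟩ := h
    exact ⟨e, F, h1, h2, h3, h4, h5, fun c hc hmem ↦ hmem.2 (h6 c hc)⟩
  by_cases hD : (∃ 𝒟 : Literature.Geometry.Lorentzian.VacuumCauchyDevelopment d, 𝒟.IsMaximal) ∧ ∀ 𝒟 : Literature.Geometry.Lorentzian.VacuumCauchyDevelopment d, 𝒟.IsMaximal → ∀ [𝒟.metric.HasLeviCivita], ¬ 𝒟.metric.IsFutureNullGeodesicallyIncomplete 𝒟.timeOrientation ∧ ¬ 𝒟.metric.IsFutureTimelikeGeodesicallyIncomplete 𝒟.timeOrientation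
  · exact h₁ X d hd.1 hd.2 hD
  by_cases hT : (∃ 𝒟 : Literature.Geometry.Lorentzian.VacuumCauchyDevelopment d, 𝒟.IsMaximal) ∧ ∀ 𝒟 : Literature.Geometry.Lorentzian.VacuumCauchyDevelopment d, 𝒟.IsMaximal → ∀ [𝒟.metric.HasLeviCivita], ∃ f : Metric.sphere (0 : Literature.Geometry.Lorentzian.E3) 1 → 𝒟.carrier, Set.range f ⊆ 𝒟.metric.causalFuture 𝒟.timeOrientation (Set.range 𝒟.embed) ∧ 𝒟.metric.IsTrappedSurface (𝓡 2) 𝒟.timeOrientation f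
  · by_cases hW0 : (fun D ↦ (∃ 𝒟 : Literature.Geometry.Lorentzian.VacuumCauchyDevelopment D, 𝒟.IsMaximal) ∧ ∀ 𝒟 : Literature.Geometry.Lorentzian.VacuumCauchyDevelopment D, 𝒟.IsMaximal → Summit.FinalStateConjecture.HasCompleteNullInfinity 𝒟.toCauchyDevelopment ∧ ∃ (O : Set 𝒟.carrier) (d : Literature.Geometry.Lorentzian.FinalStateDecomposition 𝒟.toSpacetime O 0), O = Summit.FinalStateConjecture.exteriorOf 𝒟.toCauchyDevelopment d.charted ∧ Summit.FinalStateConjecture.RaysStayInClosure 𝒟.toCauchyDevelopment O ∧ Summit.FinalStateConjecture.HasExhaustiveCharts d ∧ Summit.FinalStateConjecture.IsFutureOriented d) d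
    · exact t₃ X d hd.1 hd.2 ⟨hD, hT, hW0⟩
    by_cases hC : (fun D ↦ ∀ 𝒟 : Literature.Geometry.Lorentzian.VacuumCauchyDevelopment D, 𝒟.IsMaximal → Summit.FinalStateConjecture.HasCompleteNullInfinity 𝒟.toCauchyDevelopment) d
    · exact t₂ X d hd.1 hd.2 ⟨hD, hT, hC, hW0⟩
    · exact t₁ X d hd.1 hd.2 ⟨hD, hT, hC⟩
  by_cases hW : (∃ 𝒟 : Literature.Geometry.Lorentzian.VacuumCauchyDevelopment d, 𝒟.IsMaximal) ∧ ∀ 𝒟 : Literature.Geometry.Lorentzian.VacuumCauchyDevelopment d, 𝒟.IsMaximal → Summit.FinalStateConjecture.HasCompleteNullInfinity 𝒟.toCauchyDevelopment ∧ ∃ (O : Set 𝒟.carrier) (d : Literature.Geometry.Lorentzian.FinalStateDecomposition 𝒟.toSpacetime O 2), O = Summit.FinalStateConjecture.exteriorOf 𝒟.toCauchyDevelopment d.charted ∧ Summit.FinalStateConjecture.RaysStayInClosure 𝒟.toCauchyDevelopment O ∧ Summit.FinalStateConjecture.HasExhaustiveCharts d ∧ Summit.FinalStateConjecture.IsFutureOriented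 d
  · exact h₃ X d hd.1 hd.2 ⟨hD, hT, hW⟩
  · exact h₄ X d hd.1 hd.2 ⟨hD, hT, hW⟩

end Summit.FinalStateConjecture.FinalStateConjecture.Theses.RootDecompFarLedgerCells
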